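import Mathlib
import Literature.NumberTheory.Transcendental.PadicLogPrincipalUnits
import Literature.NumberTheory.LocalFields.PadicExpLogHomomorphisms
import Literature.NumberTheory.EllipticCurves.PAdicOneVariableSupportOfColemanTraceTwo
import Literature.NumberTheory.GaloisRepresentations.LubinTateComparisonAddPoints
import Literature.NumberTheory.GaloisRepresentations.LubinTateColemanRelativeInterpolationTwo
import Literature.NumberTheory.GaloisRepresentations.LubinTateComparisonReflectionTwo
import HarnessLib
import Literature.NumberTheory.GaloisRepresentations.LubinTateUnramifiedRelativeRestrict
import Literature.NumberTheory.GaloisRepresentations.LubinTateColemanRelativeAnomalyTwo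
import Literature.NumberTheory.GaloisRepresentations.LubinTateColemanRelativeProductTwo


set_option linter.dupNamespace false

/-!
# CRITIC g42 — JUNCTION CERTIFICATE k3-g40 ⟷ k3-g41 («THE LOCAL UNTWIST EXISTS») + the R222 «SHIFT₂» certificate

Stub-critic `scrit-stub_heegnerIndexLowerAtTwo` g42 (planner), crux `SplitBadTwoLowerHalfOfFacts`
(stmt-BirchSwinnertonDyer-27851), route `PrintCf2`, stub `stub_heegnerIndexLowerAtTwo` (ACTIVE skeleton
`f2bd84c029a8a938`).  BSD is NOT proved; the stub is not re-typed; nothing here is a route item.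

CONTENTS.  PART A = the body of `STUB_IDEAS_stub_heegnerIndexLowerAtTwo_3_g40.lean` (row 117, sha16
`2333f3139e2b61f4`) VERBATIM; PART B = the body of `STUB_IDEAS_stub_heegnerIndexLowerAtTwo_3_g41.lean` (row 119,
sha16 `dd11a8b2fa6fa744`) VERBATIM; PART C (namespace `…CriticG42`) = the critic's junction theorems:

* `actsAsFrobPow_iff`, `localUntwistExists_iff` — k3-g41's node predicates ARE k3-g40's (`Iff.rfl`: token-identical bodies);
* ★ `localUntwistExists_holds : ReadTwoCutK3G40.LocalUntwistExists hπ E hE σ₀` — k3-g40's typed sub-stub K2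
  (R217∃ of STUB-PLAN v7.4) HOLDS, by k3-g41's `localUntwistExists`;
* ★ `exists_untwisted_table'` — k3-g40's `exists_untwisted_table` with its hypothesis `hex` DISCHARGED;
* ★ `untwisted_table_explicit` — sharper: the untwist may be taken to be THE explicit `localUntwist (m+1+k) v`
  (`σ₀^{m+1+k}| ∘ σ_{χ_π(σ₀^{m+1+k})⁻¹ v}`), so R219-INST₂ computes with a NAMED automorphism, not an `∃`;
* `localUntwist_bot` — DEGENERATE INSTANCE (B68) `E = ⊥` (= `F`): over `F` itself every untwist is `σ_v`
  (`φ` acts trivially on `𝒪_F`; uniqueness) — the untwist depends on `σ₀` only through `σ₀|_E`;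
* ★ `shift₂` / `exists_shift₂` — R222 «SHIFT₂», FIELD SIDE, in the tree's currency: for a primitive `2^{n+1}`-th root of
  unity `ζ ∈ ℂ_F`, `ϑ(ζ^{j+2^n} − 1) = −π' − ϑ(ζ^j − 1)` (`= ϑ(ζ^j − 1) [+]_{f'} ω₁'`), by the tree's ★★
  `coe_evalPt₁_compSeriesC_reflect` (`LubinTateComparisonReflectionTwo`) + k3-g41's kernel identity
  `pow_add_two_pow_sub_one`; the torsion points `ζ^j − 1 ∈ 𝔪_ℂ` exist (`norm_sub_one_lt_one_of_pow_two_pow_eq_one`);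
* `units_mul_gamma0`, `hshift_units` — R222, INDEX SIDE: the hypothesis `hshift` of k3-g40's `read₂_of_refl_cut` at the
  instance of record `Γ := (ZMod 2^{n+1})ˣ`, `e := Equiv.refl`, `γ₀ := 1 + 2^n`, `s := 2^n`, DISCHARGED from k3-g41's
  `odd_mul_gamma0_zmod`; `unitsChar_gamma0_eq_neg_one` — `χ(γ₀)² = 1`, so `χ(γ₀) = −1` as soon as `χ(γ₀) ≠ 1`
  (exact conductor `2^{n+1}`; B72).

Hence after rows 117 + 119: R219 READ₂ = {R219-INST₂} (XS–S) — R217∃ and R222 are kernel.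
-/


/-!
# k3-g40 — DECOMPOSITION of R219 «READ₂» (STUB-PLAN v7.3: the ONLY open node of road B′'s table atom) into sub-stubs
# with PROVED glue, with R221 «EVAL₂» CLOSED IN KERNEL by a change of currency: the reading witness is `Λ₂` of an
# INTEGRAL series (`Λ₂ = ½·log(1+2X) ∈ ℤ₂⟦X⟧`), so evaluation is the tree's `evS`/`evS_subst` + the closed-ball Mercator sum

Stub: `stub_heegnerIndexLowerAtTwo` (skeleton `f2bd84c0…`, crux `SplitBadTwoLowerHalfOfFacts`, route PrintCf2).
Placement (JUNCTION J, π4): B′ = construction-world credit for the normalised family `prints_family_def_two`; this file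
does NOT close frame (i-c), does NOT touch A′, proves NEITHER the stub NOR the crux, and BSD is NOT proved by any of it.

THE CUT (v7.3 names).  READ₂ = `RamifiedReading` for the torsion-value table `V(j) = A_b(ζ^j − 1)` of the bounded
`D`-primitive `A_b` of `H_b` (R218 CLOSED, row 115; `A_b = L_b + const`, `L_b` = the series-side witness certified a
primitive by R218a′ CHAIN-RULE₂).  Row 114/115 type `L_b` through Mathlib's FORMAL `logOf` and price its evaluation as
R221 «EVAL₂» (S): "formal `logOf g` evaluated on the open disc = `logU` of the value + subst/eval commutation; Mathlib has
no evaluation API for `logOf`".  THIS FILE: the series whose `logOf` is read is `≡ 1 (mod 2)` in BOTH presentations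
(REFL: `Q_β = g_β/τ_E g_β ≡ 1 (mod π')`, k3-g39's PROVED `reflQuot_sub_one_mem`/H6; FROB: `g² = (g^φ∘f')(1+2y)`, k1-g37),
and `logOf(1 + 2y) = 2•Λ₂(y)` (§5, PROVED) with `Λ₂` INTEGRAL — so the composite `Λ₂∘y∘ϑ` lives in `𝒪_ℂ⟦X⟧`, its value
at `z ∈ 𝔪_ℂ` is an `evS`-value, `evS` commutes with `subst` ON THE NOSE (tree `evS_subst`), and the only analysis left is
the Mercator series on the CLOSED ball `‖t‖ ≤ 1` with majorant `(d+1)2^{−d}` (§2, PROVED).  Sub-stubs: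
* S1 PULLBACK₂            = R218a′ CHAIN-RULE₂ (k3-g39 `ComparisonChainRule`, SHARED input; not re-carded here);
* S4 = R221 «EVAL₂»        PROVED here (§2–§3, `read_value_eq_tsum_lamTerm` + `lambda_value_refl_evS` /
                            `lambda_value_split_evS`): value of the reading witness = `½·plog θ Q(w)` (REFL) =
                            `plog θ g(w) − ½·plog θ g^φ(f′w)` (FROB) — no radius-1 theorem, no `LogOfEvalCommutes`;
* S3 TORSION-TRANSPORT₂    = R222 SHIFT₂ (REFL: `ϑ(ζ^{j+2^n}−1) = ϑ(ζ^j−1) [+] ω₁'`) resp. (16)+(18) (FROB: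
                            `f′(ϑx) = ϑ^φ(f x)`, `f = (1+X)²−1`); XS, tree plumbing, typed in prose with decl names;
* S2 = R217 LOCAL-UNTWIST₂ value half PROVED here (§4, `evS_mapPt_eq_of_actsAsFrobPow`: semilinearity of `evS` under
                            `algEquiv_evS`, every Frobenius offset); existence half = typed sub-stub `LocalUntwistExists`
                            (XS–S, pure Galois theory over `relRestrict`/`relGalOfUnit`);
* GLUE `read₂_of_cut`      PROVED (§1): the four value-table identities ⟹ `UnitReading` ⟹ `RamifiedReading` with
                            `V₁ := V + V₂∘cast` (REFL: `V₂ = const`; FROB: level-`n` junk killed downstream by k3-g38's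
                            `sum_mulChar_mul_apply_castHom_eq_zero`) — the (7′) two-term split is bookkeeping.
Residual debt of R219 after this file: R218a′ (S⁻, shared) ⊕ `LocalUntwistExists` (XS–S) ⊕ S3 plumbing (XS) ⊕ the
20-line instantiation of `read₂_of_cut`.  R221 leaves the debt vector.
-/

noncomputable section

open scoped PowerSeries.WithPiTopology

namespace Summit.BirchSwinnertonDyer.BirchSwinnertonDyer.Cruxes.SplitBadTwoLowerHalfOfFacts.ReadTwoCutK3G40

/-! ## §1. The glue (Mathlib-only, PROVED): READ₂ ⟸ one identity on units ⟸ the four sub-stub value identities -/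

section Glue

variable {R' : Type*} [CommRing R'] {N : ℕ} [NeZero N]

/-- `RamifiedReading` — VERBATIM the consumer's input (k3-g38 `atom_shape`): two-term structure + unit covariance. -/
def RamifiedReading {M : ℕ} (hMN : M ∣ N) (V V₁ : ZMod N → R') (V₂ : ZMod M → R')
    {Γ : Type*} (e : Γ ≃ (ZMod N)ˣ) (ℓ : Γ → R') : Prop :=
  (∀ j : ZMod N, V j = V₁ j - V₂ (ZMod.castHom hMN (ZMod M) j)) ∧ ∀ γ : Γ, V₁ (e γ : ZMod N) = ℓ γ

/-- **The content of READ₂ is ONE identity on units**: `V(eγ) + V₂(eγ mod M) = ℓ(γ)`. -/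
def UnitReading {M : ℕ} (hMN : M ∣ N) (V : ZMod N → R') (V₂ : ZMod M → R')
    {Γ : Type*} (e : Γ ≃ (ZMod N)ˣ) (ℓ : Γ → R') : Prop :=
  ∀ γ : Γ, V (e γ : ZMod N) + V₂ (ZMod.castHom hMN (ZMod M) (e γ : ZMod N)) = ℓ γ

/-- `UnitReading ⟹ RamifiedReading` with `V₁ := V + V₂ ∘ cast` (conjunct 1 becomes definitional). -/
theorem ramifiedReading_of_unitReading {M : ℕ} (hMN : M ∣ N) {V : ZMod N → R'} {V₂ : ZMod M → R'}
    {Γ : Type*} {e : Γ ≃ (ZMod N)ˣ} {ℓ : Γ → R'} (h : UnitReading hMN V V₂ e ℓ) :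
    RamifiedReading hMN V (fun j => V j + V₂ (ZMod.castHom hMN (ZMod M) j)) V₂ e ℓ :=
  ⟨fun j => (add_sub_cancel_right _ _).symm, fun γ => h γ⟩

/-- … and conversely: ANY ramified reading yields the unit identity (so nothing is lost by the normal form). -/
theorem unitReading_of_ramifiedReading {M : ℕ} (hMN : M ∣ N) {V V₁ : ZMod N → R'} {V₂ : ZMod M → R'}
    {Γ : Type*} {e : Γ ≃ (ZMod N)ˣ} {ℓ : Γ → R'} (h : RamifiedReading hMN V V₁ V₂ e ℓ) :
    UnitReading hMN V V₂ e ℓ := fun γ => by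
  rw [h.1 (e γ : ZMod N), sub_add_cancel, h.2 γ]

/-- ★ **THE CUT GLUE `read₂_of_cut`.**  Value tables on `(ℤ/N)ˣ` (`N = 2^{n+1}`, `M = 2^n`):
`Λv a` = value of the primitive series `log̃ g_b ∘ ϑ` at `ζ^a − 1`; `Lg a = plog g_b(w_a)` (`w_a = ϑ(ζ^a−1)`);
`Lφ m = plog g_b^φ(w'_m)` (`w'_{a mod M} = f′(w_a)`, level `n`); `T γ` = the untwisted table (`log` of `σ_γ(b_n)`).
S1 (pullback, up to the period `Ω⁻¹` and an additive constant) + S4 (Λ-split) + S3 (transport: the `½`-term factors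
through `a mod M`) + S2 (untwist on units) ⟹ `UnitReading`, hence `RamifiedReading`. -/
theorem unitReading_of_cut {M : ℕ} (hMN : M ∣ N) {Γ : Type*} (e : Γ ≃ (ZMod N)ˣ)
    (V : ZMod N → R') (Λv Lg Lφ' : (ZMod N)ˣ → R') (Lφ : ZMod M → R') (T : Γ → R') (Ωinv half c : R')
    (hS1 : ∀ a : (ZMod N)ˣ, V (a : ZMod N) = Ωinv * Λv a + c)
    (hS4 : ∀ a : (ZMod N)ˣ, Λv a = Lg a - half * Lφ' a)
    (hS3 : ∀ a : (ZMod N)ˣ, Lφ' a = Lφ (ZMod.castHom hMN (ZMod M) (a : ZMod N)))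
    (hS2 : ∀ γ : Γ, Lg (e γ) = T γ) :
    UnitReading hMN V (fun m => Ωinv * half * Lφ m - c) e (fun γ => Ωinv * T γ) := fun γ => by
  simp only [hS1, hS4, hS3, hS2]
  ring

/-- READ₂ from the cut. -/
theorem read₂_of_cut {M : ℕ} (hMN : M ∣ N) {Γ : Type*} (e : Γ ≃ (ZMod N)ˣ)
    (V : ZMod N → R') (Λv Lg Lφ' : (ZMod N)ˣ → R') (Lφ : ZMod M → R') (T : Γ → R') (Ωinv half c : R')
    (hS1 : ∀ a : (ZMod N)ˣ, V (a : ZMod N) = Ωinv * Λv a + c)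
    (hS4 : ∀ a : (ZMod N)ˣ, Λv a = Lg a - half * Lφ' a)
    (hS3 : ∀ a : (ZMod N)ˣ, Lφ' a = Lφ (ZMod.castHom hMN (ZMod M) (a : ZMod N)))
    (hS2 : ∀ γ : Γ, Lg (e γ) = T γ) :
    RamifiedReading hMN V (fun j => V j + (Ωinv * half * Lφ (ZMod.castHom hMN (ZMod M) j) - c))
      (fun m => Ωinv * half * Lφ m - c) e (fun γ => Ωinv * T γ) :=
  ramifiedReading_of_unitReading hMN (unitReading_of_cut hMN e V Λv Lg Lφ' Lφ T Ωinv half c hS1 hS4 hS3 hS2)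

/-- ★ **THE CUT GLUE, REFL SHAPE (presentation of record, row 115: `V j = κ·(ℓ_j − ℓ_{j+s}) + c`, `s = 2^n`,
`V₂ = −c` CONSTANT).**  `Lg a = plog θ g_b(w_a)`; the shift `a ↦ a + s` is multiplication by a fixed `γ₀ ∈ Γ`
(`ζ^{a+2^n} = −ζ^a`, `γ₀ ↔ −1`); S1 (pullback + EVAL₂-REFL: `½·plog Q(w_a) = ½(ℓ_a − ℓ_{a+s})`) + S2 (untwist on
units) ⟹ `RamifiedReading` with constant `V₂`. -/
theorem read₂_of_refl_cut {M : ℕ} (hMN : M ∣ N) {Γ : Type*} [Mul Γ] (e : Γ ≃ (ZMod N)ˣ)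
    (V Lg : ZMod N → R') (T : Γ → R') (κ c : R') (s : ZMod N) (γ₀ : Γ)
    (hshift : ∀ γ : Γ, ((e (γ * γ₀) : (ZMod N)ˣ) : ZMod N) = (e γ : ZMod N) + s)
    (hS1 : ∀ a : ZMod N, V a = κ * (Lg a - Lg (a + s)) + c)
    (hS2 : ∀ γ : Γ, Lg (e γ : ZMod N) = T γ) :
    RamifiedReading hMN V (fun j : ZMod N => V j + -c) (fun _ : ZMod M => -c) e
      (fun γ => κ * (T γ - T (γ * γ₀))) := by
  have h : UnitReading hMN V (fun _ : ZMod M => -c) e (fun γ => κ * (T γ - T (γ * γ₀))) := fun γ => by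
    simp only [hS1, ← hshift, hS2]
    ring
  exact ramifiedReading_of_unitReading hMN h

end Glue

/-! ## §2. S4, the Λ-SPLIT at a point (PROVED, any complete ultrametric normed `ℚ₂`-algebra `𝕜`, e.g. `ℂ_[2]`):
`Λ₂(t) := Σ_{d≥0} (−1)^d 2^d t^{d+1}/(d+1) = ½·plog(1 + 2t)` CONVERGES on the CLOSED unit ball (`v₂(2^d/(d+1)) → ∞`),
and `x² = y·(1 + 2t)` with `x, y` principal units ⟹ `Λ₂(t) = plog x − ½·plog y`.  Only `plog` homomorphy and the
defining Mercator series are used — this is the whole "log / evaluation commutation" of READ₂ at the value level. -/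

section LambdaSplit

open Literature.NumberTheory.Transcendental

variable {𝕜 : Type*} [NontriviallyNormedField 𝕜] [NormedAlgebra ℚ_[2] 𝕜] [IsUltrametricDist 𝕜] [CompleteSpace 𝕜]

/-- `‖2‖ = ½` in a normed `ℚ₂`-algebra. -/
theorem norm_two : ‖(2 : 𝕜)‖ = 2⁻¹ := by
  have h := IwasawaLog.norm_natCast (F := 𝕜) 2 2
  have hp : ‖((2 : ℕ) : ℚ_[2])‖ = ((2 : ℕ) : ℝ)⁻¹ := Padic.norm_p
  simp only [Nat.cast_ofNat] at h hp
  rw [h, hp]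

theorem two_ne_zero' : (2 : 𝕜) ≠ 0 := by
  intro h
  have := norm_two (𝕜 := 𝕜)
  rw [h, norm_zero] at this
  norm_num at this

/-- The terms of `Λ₂` at `t`: `(−1)^d · 2^d/(d+1) · t^{d+1}` (`= logScalar 2 (d+1) · t^{d+1}` in k1-g37's notation). -/
def lamTerm (t : 𝕜) (d : ℕ) : 𝕜 := (-1) ^ d * (2 : 𝕜) ^ d / ((d : 𝕜) + 1) * t ^ (d + 1)

/-- Term bound on the CLOSED unit ball: `‖lamTerm t d‖ ≤ (d+1)·2^{−d}`. -/
theorem norm_lamTerm_le {t : 𝕜} (ht : ‖t‖ ≤ 1) (d : ℕ) :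
    ‖lamTerm t d‖ ≤ ((d : ℝ) + 1) * (2⁻¹ : ℝ) ^ d := by
  unfold lamTerm
  have hinv : ‖((d : 𝕜) + 1)⁻¹‖ ≤ (d : ℝ) + 1 := by
    have h := IwasawaLog.norm_inv_natCast_le (F := 𝕜) 2 (n := d + 1) (Nat.succ_ne_zero d)
    push_cast at h
    exact h
  rw [div_eq_mul_inv, norm_mul, norm_mul, norm_mul, norm_pow, norm_pow, norm_neg, norm_one, one_pow, one_mul,
    norm_two, norm_pow]
  calc (2⁻¹ : ℝ) ^ d * ‖((d : 𝕜) + 1)⁻¹‖ * ‖t‖ ^ (d + 1)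
      ≤ (2⁻¹ : ℝ) ^ d * ((d : ℝ) + 1) * 1 := by
        gcongr
        exact pow_le_one₀ (norm_nonneg _) ht
    _ = ((d : ℝ) + 1) * (2⁻¹ : ℝ) ^ d := by ring

/-- `Λ₂(t)` converges for `‖t‖ ≤ 1`. -/
theorem summable_lamTerm {t : 𝕜} (ht : ‖t‖ ≤ 1) : Summable (lamTerm t) := by
  have hr : ‖(2⁻¹ : ℝ)‖ < 1 := by rw [norm_inv, Real.norm_ofNat]; norm_num
  have hg : Summable fun d : ℕ => ((d : ℝ) + 1) * (2⁻¹ : ℝ) ^ d := by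
    have h1 : Summable fun d : ℕ => ((d : ℝ) ^ 1) * (2⁻¹ : ℝ) ^ d := summable_pow_mul_geometric_of_norm_lt_one 1 hr
    have h0 : Summable fun d : ℕ => (2⁻¹ : ℝ) ^ d := summable_geometric_of_norm_lt_one hr
    simpa [pow_one, add_mul] using h1.add h0
  exact Summable.of_norm_bounded hg (norm_lamTerm_le ht)

/-- `½ · plog(1 + 2t) = Σ' lamTerm t` (rescaling the defining Mercator series termwise). -/
theorem half_mul_plog_one_add_two_mul (t : 𝕜) :
    (2 : 𝕜)⁻¹ * PadicExp.plog (1 + 2 * t) = ∑' d, lamTerm t d := by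
  rw [Literature.NumberTheory.LocalFields.plog_one_add_eq_tsum, ← tsum_mul_left]
  refine tsum_congr fun d => ?_
  unfold lamTerm
  have h2 : (2 : 𝕜) ≠ 0 := two_ne_zero'
  rw [mul_pow, pow_succ (2 : 𝕜)]
  field_simp

/-- ★ `HasSum (lamTerm t) (½ · plog (1 + 2t))` on the closed unit ball. -/
theorem hasSum_lamTerm {t : 𝕜} (ht : ‖t‖ ≤ 1) :
    HasSum (lamTerm t) ((2 : 𝕜)⁻¹ * PadicExp.plog (1 + 2 * t)) := by
  rw [half_mul_plog_one_add_two_mul]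
  exact (summable_lamTerm ht).hasSum

/-- `plog (x² · y⁻¹) = 2·plog x − plog y` on principal units. -/
theorem plog_sq_mul_inv {x y : 𝕜} (hx : ‖1 - x‖ < 1) (hy : ‖1 - y‖ < 1) :
    PadicExp.plog (x ^ 2 * y⁻¹) = 2 * PadicExp.plog x - PadicExp.plog y := by
  rw [PadicExp.plog_mul (ℓ := 2) (IwasawaLog.norm_one_sub_pow_lt hx 2) (IwasawaLog.norm_one_sub_inv_lt hy),
    PadicExp.plog_pow (ℓ := 2) hx 2, PadicExp.plog_inv (ℓ := 2) hy]
  push_cast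
  ring

/-- `plog` of a quotient of principal units: `q·r = x ⟹ plog q = plog x − plog r` (REFL form: `Q_β · τ_E g = g`
evaluated at a point). -/
theorem plog_eq_sub_of_mul_eq {x q r : 𝕜} (hq : ‖1 - q‖ < 1) (hr : ‖1 - r‖ < 1) (h : q * r = x) :
    PadicExp.plog q = PadicExp.plog x - PadicExp.plog r := by
  rw [← h, PadicExp.plog_mul (ℓ := 2) hq hr]
  ring

/-- ★ **S4, REFL FORM (row 114's witness `½·logOf V_β`, `V_β ≡ 1 (mod 2)` by H6): `P = 1 + 2t` ⟹ `Λ₂(t) = ½·plog P`**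
— the defining Mercator series on the closed ball, nothing else. -/
theorem lambda_value_refl {P t : 𝕜} (ht : ‖t‖ ≤ 1) (hP : P = 1 + 2 * t) :
    ∑' d, lamTerm t d = (2 : 𝕜)⁻¹ * PadicExp.plog P := by
  rw [hP]
  exact (hasSum_lamTerm ht).tsum_eq

/-- ★★ **S4 — THE Λ-SPLIT AT A POINT.**  `x = g(w)`, `y = g^φ(f′w)` principal units, `t = y_g(w)` integral with the
EVALUATED congruence `x² = y(1 + 2t)` (a ring-hom image of k1-g37's `exists_unitRatio` datum), and `L` the value of the
convergent integral series `Λ₂ ∘ y_g` at `w` (§3 identifies it with `Σ' lamTerm t`): then `L = plog x − ½ plog y`. -/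
theorem lambda_value_split {x y t L : 𝕜} (hx : ‖1 - x‖ < 1) (hy : ‖1 - y‖ < 1) (ht : ‖t‖ ≤ 1)
    (hfac : x ^ 2 = y * (1 + 2 * t)) (hL : HasSum (lamTerm t) L) :
    L = PadicExp.plog x - (2 : 𝕜)⁻¹ * PadicExp.plog y := by
  have hy1 : ‖y‖ = 1 := IwasawaLog.norm_eq_one_of_norm_one_sub_lt hy
  have hy0 : y ≠ 0 := by
    intro h; rw [h, norm_zero] at hy1; exact zero_ne_one hy1
  have h2 : (2 : 𝕜) ≠ 0 := two_ne_zero'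
  have hquot : 1 + 2 * t = x ^ 2 * y⁻¹ := by
    rw [hfac]; field_simp
  rw [hL.unique (hasSum_lamTerm ht), hquot, plog_sq_mul_inv hx hy]
  field_simp

end LambdaSplit

/-! ## §3. The series side meets the value side in the TREE's currency (PROVED): values of composites / of integral
series at points of `𝔪_{ℂ_F}` are `evS`-values (`tsum_coeff_mul_pow_eq_evS`, `hasSum_map_coeff_mul_pow`) and
`evS` is an algebra hom commuting with substitution (`evS_subst`) — so "value of `Λ₂∘y∘ϑ` at `z`" = `Λ₂(y(ϑ(z)))`
and the congruence `g² = (g^φ∘f)(1+2y)` EVALUATES.  No analytic input. -/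

section TreeEvaluation

open ValuativeRel IsLocalRing Field
open Literature.NumberTheory.GaloisRepresentations Literature.NumberTheory.GaloisRepresentations.IsNonarchimedeanLocalField
  Literature.NumberTheory.GaloisRepresentations.LubinTate Literature.NumberTheory.PAdicHodge
  Literature.NumberTheory.EllipticCurves

variable {F : Type} [Field F] [ValuativeRel F] [TopologicalSpace F] [IsNonarchimedeanLocalField F]

attribute [local instance] ltNormUniformSpace ltNormIsUniformAddGroup rk1 nF nE fintypeResidueField

/-- ★ **SUBST–EVAL at a point of `𝔪_ℂ`, in `ℂ_F`**: the value of `R ∘ φ` at `z` is the value of `R` at `φ(z)`. -/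
theorem tsum_coeff_subst_mul_pow_eq (R φ : PowerSeries (CBall F)) (hφ : PowerSeries.constantCoeff φ = 0)
    (z : (maxNilIdealC F).toIdeal) :
    ∑' m : ℕ, ((PowerSeries.coeff m (PowerSeries.subst φ R) : CBall F) : CompletedAlgClosure F) *
        ((z : CBall F) : CompletedAlgClosure F) ^ m =
      ∑' d : ℕ, ((PowerSeries.coeff d R : CBall F) : CompletedAlgClosure F) *
        ((evS (maxNilIdealC F) z φ : CBall F) : CompletedAlgClosure F) ^ d := by
  have h := tsum_coeff_mul_pow_eq_evS R ⟨evS (maxNilIdealC F) z φ, evS_mem_of_constantCoeff_eq_zero _ z hφ⟩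
  rw [tsum_coeff_mul_pow_eq_evS, evS_subst (maxNilIdealC F) z hφ R]
  exact h.symm

/-- ★ the same pushed along `θ : ℂ_F → ℂ_2` (the currency of `prints_family_def_two`). -/
theorem tsum_coeff_map_subst_mul_pow_eq (θ : CompletedAlgClosure F →+* ℂ_[2]) (hθc : Continuous θ)
    (R φ : PowerSeries (CBall F)) (hφ : PowerSeries.constantCoeff φ = 0) (z : (maxNilIdealC F).toIdeal) :
    ∑' m : ℕ, PowerSeries.coeff m (PowerSeries.map (θ.comp (CBall F).subtype) (PowerSeries.subst φ R)) *
        (θ ((z : CBall F) : CompletedAlgClosure F)) ^ m =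
      ∑' d : ℕ, PowerSeries.coeff d (PowerSeries.map (θ.comp (CBall F).subtype) R) *
        (θ ((evS (maxNilIdealC F) z φ : CBall F) : CompletedAlgClosure F)) ^ d := by
  have h := (hasSum_map_coeff_mul_pow θ hθc R
    ⟨evS (maxNilIdealC F) z φ, evS_mem_of_constantCoeff_eq_zero _ z hφ⟩).tsum_eq
  rw [(hasSum_map_coeff_mul_pow θ hθc _ z).tsum_eq, evS_subst (maxNilIdealC F) z hφ R]
  exact h.symm

/-- Values of a principal series (`g(0) = 1`) at points of `𝔪_ℂ` are principal units of `ℂ_F`. -/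
theorem norm_one_sub_evS_lt_one (g : PowerSeries (CBall F)) (hg : PowerSeries.constantCoeff g = 1)
    (z : (maxNilIdealC F).toIdeal) :
    ‖(1 : CompletedAlgClosure F) - ((evS (maxNilIdealC F) z g : CBall F) : CompletedAlgClosure F)‖ < 1 := by
  have h0 : PowerSeries.constantCoeff (g - 1) = 0 := by rw [map_sub, hg, map_one, sub_self]
  have hmem : evS (maxNilIdealC F) z (g - 1) ∈ (maxNilIdealC F).toIdeal :=
    evS_mem_of_constantCoeff_eq_zero _ z h0
  have hlt : ‖((evS (maxNilIdealC F) z (g - 1) : CBall F) : CompletedAlgClosure F)‖ < 1 := hmem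
  have hval : ((evS (maxNilIdealC F) z g : CBall F) : CompletedAlgClosure F) =
      1 + ((evS (maxNilIdealC F) z (g - 1) : CBall F) : CompletedAlgClosure F) := by
    rw [map_sub, map_one]; push_cast; ring
  rw [hval, sub_add_cancel_left, norm_neg]
  exact hlt

/-- The congruence datum EVALUATES: `g² = G·(1 + 2y)` in `𝒪_ℂ⟦X⟧` ⟹ `g(z)² = G(z)·(1 + 2·y(z))`. -/
theorem evS_sq_eq_of_factorisation {g G y : PowerSeries (CBall F)}
    (h : g ^ 2 = G * (1 + PowerSeries.C (2 : CBall F) * y)) (z : (maxNilIdealC F).toIdeal) :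
    (evS (maxNilIdealC F) z g) ^ 2 = evS (maxNilIdealC F) z G * (1 + 2 * evS (maxNilIdealC F) z y) := by
  have := congrArg (evS (maxNilIdealC F) z) h
  simpa [map_pow, map_mul, map_add, map_one, evS_C] using this

/-- ★ **S4 ASSEMBLED IN THE TREE'S CURRENCY** (composite of §2 and §3): for principal `g, G ∈ 𝒪_ℂ⟦X⟧`, integral `y`
with `g² = G(1+2y)`, points `w` of `𝔪_ℂ`, and `θ : ℂ_F → ℂ_2` continuous, of norm `≤ 1` on `𝒪_ℂ` and mapping `𝔪_ℂ`
into the open unit ball (all three hold for the `θ` of record, `norm_equivPadicComplex_lt_one_iff`):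
the value `Σ' lamTerm (θ y(w))` IS `plog θ(g(w)) − ½ plog θ(G(w))`. -/
theorem lambda_value_split_evS (θ : CompletedAlgClosure F →+* ℂ_[2])
    (hθ1 : ∀ z : CBall F, ‖θ (z : CompletedAlgClosure F)‖ ≤ 1)
    (hθlt : ∀ x : CompletedAlgClosure F, ‖x‖ < 1 → ‖θ x‖ < 1)
    {g G y : PowerSeries (CBall F)} (hg : PowerSeries.constantCoeff g = 1) (hG : PowerSeries.constantCoeff G = 1)
    (h : g ^ 2 = G * (1 + PowerSeries.C (2 : CBall F) * y)) (w : (maxNilIdealC F).toIdeal) :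
    ∑' d, lamTerm (θ ((evS (maxNilIdealC F) w y : CBall F) : CompletedAlgClosure F)) d =
      Literature.NumberTheory.Transcendental.PadicExp.plog
          (θ ((evS (maxNilIdealC F) w g : CBall F) : CompletedAlgClosure F)) -
        (2 : ℂ_[2])⁻¹ * Literature.NumberTheory.Transcendental.PadicExp.plog
          (θ ((evS (maxNilIdealC F) w G : CBall F) : CompletedAlgClosure F)) := by
  have hx : ‖1 - θ ((evS (maxNilIdealC F) w g : CBall F) : CompletedAlgClosure F)‖ < 1 := by
    rw [← map_one θ, ← map_sub]; exact hθlt _ (norm_one_sub_evS_lt_one g hg w)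
  have hy : ‖1 - θ ((evS (maxNilIdealC F) w G : CBall F) : CompletedAlgClosure F)‖ < 1 := by
    rw [← map_one θ, ← map_sub]; exact hθlt _ (norm_one_sub_evS_lt_one G hG w)
  have ht : ‖θ ((evS (maxNilIdealC F) w y : CBall F) : CompletedAlgClosure F)‖ ≤ 1 := hθ1 _
  have hfac := congrArg (fun s : CBall F => θ (s : CompletedAlgClosure F)) (evS_sq_eq_of_factorisation h w)
  simp only [Subring.coe_mul, SubmonoidClass.coe_pow, Subring.coe_add, Subring.coe_one, map_mul, map_pow,
    map_add, map_one] at hfac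
  have h2 : θ (((2 : CBall F) : CBall F) : CompletedAlgClosure F) = 2 := by
    rw [show (((2 : CBall F) : CBall F) : CompletedAlgClosure F) = 2 by norm_cast, map_ofNat]
  rw [h2] at hfac
  exact lambda_value_split hx hy ht hfac (summable_lamTerm ht).hasSum

/-- ★ **S4 (REFL presentation of record) IN THE TREE'S CURRENCY**: for `P = 1 + 2y ∈ 𝒪_ℂ⟦X⟧` (`P =` the reflection
quotient `Q_β = g_β/τ_E g_β` normalised to `Q(0) = 1`; `Q_β ≡ 1 (mod π')` is k3-g39's PROVED `reflQuot_sub_one_mem` /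
`transportedCongruence_holds`) and `w ∈ 𝔪_ℂ`: `Σ' lamTerm (θ y(w)) = ½·plog θ(P(w))`.  With `tsum_coeff_map_subst_mul_pow_eq`
this is R221 «EVAL₂» for the witness `½·logOf P = Λ₂(y)` (`logOf_one_add_two_smul`, §5): NO `logOf`-evaluation API. -/
theorem lambda_value_refl_evS (θ : CompletedAlgClosure F →+* ℂ_[2])
    (hθ1 : ∀ z : CBall F, ‖θ (z : CompletedAlgClosure F)‖ ≤ 1)
    {P y : PowerSeries (CBall F)} (hP : P = 1 + PowerSeries.C (2 : CBall F) * y) (w : (maxNilIdealC F).toIdeal) :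
    ∑' d, lamTerm (θ ((evS (maxNilIdealC F) w y : CBall F) : CompletedAlgClosure F)) d =
      (2 : ℂ_[2])⁻¹ * Literature.NumberTheory.Transcendental.PadicExp.plog
          (θ ((evS (maxNilIdealC F) w P : CBall F) : CompletedAlgClosure F)) := by
  have ht : ‖θ ((evS (maxNilIdealC F) w y : CBall F) : CompletedAlgClosure F)‖ ≤ 1 := hθ1 _
  have hev : evS (maxNilIdealC F) w P = 1 + 2 * evS (maxNilIdealC F) w y := by
    have := congrArg (evS (maxNilIdealC F) w) hP
    simpa [map_mul, map_add, map_one, evS_C] using this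
  have hfac := congrArg (fun s : CBall F => θ (s : CompletedAlgClosure F)) hev
  simp only [Subring.coe_mul, Subring.coe_add, Subring.coe_one, map_mul, map_add, map_one] at hfac
  have h2 : θ (((2 : CBall F) : CBall F) : CompletedAlgClosure F) = 2 := by
    rw [show (((2 : CBall F) : CBall F) : CompletedAlgClosure F) = 2 by norm_cast, map_ofNat]
  rw [h2] at hfac
  exact lambda_value_refl ht hfac

/-- ★★ **R221 «EVAL₂» — THE VALUE OF THE READING WITNESS, CLOSED IN KERNEL.**  For any `L ∈ 𝒪_ℂ⟦X⟧` whose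
`θ`-coefficients are the `Λ₂` scalars (`θ[X⁰]L = 0`, `θ[X^{d+1}]L = (−1)^d 2^d/(d+1)`; existence: `coeff_Lam2_succ` + the
integrality `‖2^d/(d+1)‖₂ ≤ 1` of `norm_lamTerm_le`) and any `y ∈ 𝒪_ℂ⟦X⟧` with `y(0) = 0`, the `θ`-value at `z ∈ 𝔪_ℂ` of
the composite `L∘y` (the series the reading actually evaluates, after `∘ϑ` which is one more `tsum_coeff_map_subst_mul_pow_eq`)
is `Σ' lamTerm (θ y(z))` — hence `½·plog θ P(z)` (REFL, `lambda_value_refl_evS`) or `plog θ g(z) − ½·plog θ G(z)` (FROB,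
`lambda_value_split_evS`).  Ingredients: tree `evS_subst`, `hasSum_map_coeff_mul_pow`; one reindexing.  No `logOf`-evaluation
theorem, no radius-of-convergence bookkeeping. -/
theorem read_value_eq_tsum_lamTerm (θ : CompletedAlgClosure F →+* ℂ_[2]) (hθc : Continuous θ)
    (L y : PowerSeries (CBall F)) (hy : PowerSeries.constantCoeff y = 0)
    (hL0 : θ ((PowerSeries.coeff 0 L : CBall F) : CompletedAlgClosure F) = 0)
    (hL : ∀ d : ℕ, θ ((PowerSeries.coeff (d + 1) L : CBall F) : CompletedAlgClosure F) =
      (-1) ^ d * (2 : ℂ_[2]) ^ d / ((d : ℂ_[2]) + 1))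
    (z : (maxNilIdealC F).toIdeal) :
    ∑' m : ℕ, PowerSeries.coeff m (PowerSeries.map (θ.comp (CBall F).subtype) (PowerSeries.subst y L)) *
        (θ ((z : CBall F) : CompletedAlgClosure F)) ^ m =
      ∑' d : ℕ, lamTerm (θ ((evS (maxNilIdealC F) z y : CBall F) : CompletedAlgClosure F)) d := by
  rw [tsum_coeff_map_subst_mul_pow_eq θ hθc L y hy z]
  have hs := (hasSum_map_coeff_mul_pow θ hθc L
    ⟨evS (maxNilIdealC F) z y, evS_mem_of_constantCoeff_eq_zero _ z hy⟩).summable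
  rw [hs.tsum_eq_zero_add]
  simp only [PowerSeries.coeff_map, RingHom.coe_comp, Function.comp_apply, Subring.coe_subtype]
  rw [hL0, zero_mul, zero_add]
  refine tsum_congr fun d => ?_
  rw [hL d, lamTerm]

end TreeEvaluation

/-! ## §4. S2 = R217 LOCAL-UNTWIST₂ in the tree's RELATIVE currency (`exists_relColeman`):
the VALUE half is semilinearity (PROVED); the EXISTENCE half is the typed sub-stub `LocalUntwistExists`. -/

section LocalUntwist

open ValuativeRel IsLocalRing Field
open Literature.NumberTheory.GaloisRepresentations Literature.NumberTheory.GaloisRepresentations.IsNonarchimedeanLocalField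
  Literature.NumberTheory.GaloisRepresentations.LubinTate Literature.NumberTheory.PAdicHodge

variable {F : Type} [Field F] [ValuativeRel F] [TopologicalSpace F] [IsNonarchimedeanLocalField F]

attribute [local instance] ltNormUniformSpace ltNormIsUniformAddGroup rk1 nF nE fintypeResidueField

variable {π : 𝒪[F]} (hπ : (valuation F).IsUniformizer (π : F))
variable (E : IntermediateField F (AlgebraicClosure F)) [FiniteDimensional F E] [Normal F E]

/-- Coefficients of an iterated coefficient map. -/
theorem coeff_map_iterate {A : Type*} [CommSemiring A] (ψ : A →+* A) (k : ℕ) (g : PowerSeries A) (n : ℕ) :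
    PowerSeries.coeff n ((PowerSeries.map ψ)^[k] g) = ψ^[k] (PowerSeries.coeff n g) := by
  induction k generalizing g with
  | zero => rfl
  | succ k ih => rw [Function.iterate_succ_apply, ih, PowerSeries.coeff_map, ← Function.iterate_succ_apply ψ]

/-- "`τ ∈ Aut_F(E·K_π^{m+1})` acts on `𝒪_E` as `φ^K`" (`φ = frobUnitBall E σ₀`; `K` is NOT tied to the level). -/
def ActsAsFrobPow (σ₀ : absoluteGaloisGroup F) (K : ℕ) {m : ℕ}
    (τ : (E ⊔ ltField π m : IntermediateField F (AlgebraicClosure F)) ≃ₐ[F]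
      (E ⊔ ltField π m : IntermediateField F (AlgebraicClosure F))) : Prop :=
  ∀ x : unitBall E, τ (IntermediateField.inclusion le_sup_left (x : E)) =
    IntermediateField.inclusion le_sup_left
      (((((frobUnitBall E σ₀ : unitBall E ≃+* unitBall E) : unitBall E →+* unitBall E) :
        unitBall E → unitBall E)^[K] x : unitBall E) : E)

/-- ★ **S2, VALUE HALF (PROVED): the local untwist is semilinearity — for EVERY Frobenius offset `k`.**  If `g`
interpolates `β` in the sense of `exists_relColeman` (`((φ⁻¹)^{m+1} g)^ι(ι ω_{m+1}) = β_m`) and `τ` acts on `𝒪_E` as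
`φ^{m+1+k}`, then `(φ^k g)^ι(τ(ι ω_{m+1})) = τ(β_m)`: `k = 0` reads the level-`n+1` table of `g_b` itself (`Lg`),
`k = 1` the level-`n` table of `g_b^φ` (`Lφ`, the `½`-term of `log̃`), as Galois conjugates of table entries. -/
theorem evS_mapPt_eq_of_actsAsFrobPow (σ₀ : absoluteGaloisGroup F) (g : PowerSeries (unitBall E)) (m k : ℕ)
    (β : unitBall (E ⊔ ltField π m : IntermediateField F (AlgebraicClosure F)))
    (hg : evS (maxNilIdeal F (E ⊔ ltField π m : IntermediateField F (AlgebraicClosure F)))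
        (inclPt (le_sup_right : ltField π m ≤ E ⊔ ltField π m) (cohPt hπ m))
        (PowerSeries.map (inclUnitBall (F := F) (le_sup_left : E ≤ E ⊔ ltField π m) :
          unitBall E →+* unitBall (E ⊔ ltField π m : IntermediateField F (AlgebraicClosure F)))
          ((PowerSeries.map ((frobUnitBall E σ₀).symm : unitBall E →+* unitBall E))^[m + 1] g)) = β)
    (τ : (E ⊔ ltField π m : IntermediateField F (AlgebraicClosure F)) ≃ₐ[F]
      (E ⊔ ltField π m : IntermediateField F (AlgebraicClosure F)))
    (hτ : ActsAsFrobPow E σ₀ (m + 1 + k) τ) :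
    ((evS (maxNilIdeal F (E ⊔ ltField π m : IntermediateField F (AlgebraicClosure F)))
        (mapPt τ (inclPt (le_sup_right : ltField π m ≤ E ⊔ ltField π m) (cohPt hπ m)))
        (PowerSeries.map (inclUnitBall (F := F) (le_sup_left : E ≤ E ⊔ ltField π m) :
          unitBall E →+* unitBall (E ⊔ ltField π m : IntermediateField F (AlgebraicClosure F)))
          ((PowerSeries.map (frobUnitBall E σ₀ : unitBall E →+* unitBall E))^[k] g)) :
        unitBall (E ⊔ ltField π m : IntermediateField F (AlgebraicClosure F))) :
        (E ⊔ ltField π m : IntermediateField F (AlgebraicClosure F))) =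
      τ ((β : unitBall (E ⊔ ltField π m : IntermediateField F (AlgebraicClosure F))) :
        (E ⊔ ltField π m : IntermediateField F (AlgebraicClosure F))) := by
  -- the coefficient computation: `τ ∘ ι ∘ (φ⁻¹)^{m+1} = ι ∘ φ^k` on the coefficients of `g`
  have hfix : PowerSeries.map (toUnitBallHom τ : unitBall (E ⊔ ltField π m : IntermediateField F (AlgebraicClosure F)) →+*
        unitBall (E ⊔ ltField π m : IntermediateField F (AlgebraicClosure F)))
      (PowerSeries.map (inclUnitBall (F := F) (le_sup_left : E ≤ E ⊔ ltField π m) :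
          unitBall E →+* unitBall (E ⊔ ltField π m : IntermediateField F (AlgebraicClosure F)))
        ((PowerSeries.map ((frobUnitBall E σ₀).symm : unitBall E →+* unitBall E))^[m + 1] g)) =
      PowerSeries.map (inclUnitBall (F := F) (le_sup_left : E ≤ E ⊔ ltField π m) :
          unitBall E →+* unitBall (E ⊔ ltField π m : IntermediateField F (AlgebraicClosure F)))
        ((PowerSeries.map (frobUnitBall E σ₀ : unitBall E →+* unitBall E))^[k] g) := by
    refine PowerSeries.ext fun n => ?_
    rw [PowerSeries.coeff_map, PowerSeries.coeff_map, PowerSeries.coeff_map, coeff_map_iterate, coeff_map_iterate]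
    refine Subtype.ext ?_
    have hcancel : ∀ c : unitBall E,
        (((frobUnitBall E σ₀ : unitBall E ≃+* unitBall E) : unitBall E →+* unitBall E) :
            unitBall E → unitBall E)^[m + 1]
          (((((frobUnitBall E σ₀).symm : unitBall E ≃+* unitBall E) : unitBall E →+* unitBall E) :
            unitBall E → unitBall E)^[m + 1] c) = c :=
      Function.LeftInverse.iterate
        (g := (((frobUnitBall E σ₀ : unitBall E ≃+* unitBall E) : unitBall E →+* unitBall E) :
            unitBall E → unitBall E))
        (f := ((((frobUnitBall E σ₀).symm : unitBall E ≃+* unitBall E) : unitBall E →+* unitBall E) :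
            unitBall E → unitBall E))
        (fun x => by simpa using (frobUnitBall E σ₀).apply_symm_apply x) (m + 1)
    have h1 := hτ (((((frobUnitBall E σ₀).symm : unitBall E ≃+* unitBall E) : unitBall E →+* unitBall E) :
            unitBall E → unitBall E)^[m + 1] (PowerSeries.coeff n g))
    rw [show m + 1 + k = k + (m + 1) from Nat.add_comm _ _] at h1
    rw [Function.iterate_add_apply _ k (m + 1), hcancel] at h1
    exact h1
  have key := algEquiv_evS (E ⊔ ltField π m : IntermediateField F (AlgebraicClosure F)) τ
    (PowerSeries.map (inclUnitBall (F := F) (le_sup_left : E ≤ E ⊔ ltField π m) :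
        unitBall E →+* unitBall (E ⊔ ltField π m : IntermediateField F (AlgebraicClosure F)))
      ((PowerSeries.map ((frobUnitBall E σ₀).symm : unitBall E →+* unitBall E))^[m + 1] g))
    (inclPt (le_sup_right : ltField π m ≤ E ⊔ ltField π m) (cohPt hπ m))
  rw [hfix, hg] at key
  rw [← key, coe_toUnitBallHom]

/-- **S2, EXISTENCE HALF = the typed sub-stub `LocalUntwistExists` (R217; XS–S, pure Galois bookkeeping):** for every
level `m`, Frobenius exponent `K` and unit `v ∈ 𝒪_F^×` there is `τ ∈ Aut_F(E·K_π^{m+1})` acting on `𝒪_E` as `φ^K` and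
moving `ι ω_{m+1}` exactly as `σ_v = relGalOfUnit v` does (`σ_v` fixes `E` and multiplies the torsion by `v`,
`mapPt_relGalOfUnit_relAct`).  Expected proof: `τ := relRestrict (σ₀^K · σ')` with `σ'` from
`exists_absGal_fixing_smul_ltRoot_eq` for the unit `v · χ_π(σ₀)^{-K}` (`E/F` unramified and `K_π^{m+1}/F` totally
ramified are linearly disjoint: `Gal(E·K_π^{m+1}/F) = Gal(E/F) × Gal(K_π^{m+1}/F)`). -/
def LocalUntwistExists (hE : E ≤ maxUnramified F) (σ₀ : absoluteGaloisGroup F) : Prop :=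
  ∀ (m K : ℕ) (v : 𝒪[F]ˣ), ∃ τ : (E ⊔ ltField π m : IntermediateField F (AlgebraicClosure F)) ≃ₐ[F]
      (E ⊔ ltField π m : IntermediateField F (AlgebraicClosure F)),
    ActsAsFrobPow E σ₀ K τ ∧
      mapPt τ (inclPt (le_sup_right : ltField π m ≤ E ⊔ ltField π m) (cohPt hπ m)) =
        mapPt (relGalOfUnit hπ E m hE v) (inclPt (le_sup_right : ltField π m ≤ E ⊔ ltField π m) (cohPt hπ m))

/-- ★ **S2 assembled: the UNTWISTED VALUE TABLES.**  Under `LocalUntwistExists`, for every unit `v` and offset `k` the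
value of `φ^k g` at the primitive point `σ_v(ι ω_{m+1})` is a Galois conjugate `τ(β_m)` with `τ|_{𝒪_E} = φ^{m+1+k}` —
the tables `Lg` (`k = 0`, level `n+1`) and `Lφ` (`k = 1`, level `n`) of §1, whose `plog ∘ θ` the seam
(`LogDerivSeam`, k3-g38; RCF) turns into `log σ_γ(b)`-tables. -/
theorem exists_untwisted_table (hE : E ≤ maxUnramified F) (σ₀ : absoluteGaloisGroup F)
    (hex : LocalUntwistExists hπ E hE σ₀) (g : PowerSeries (unitBall E)) (m k : ℕ)
    (β : unitBall (E ⊔ ltField π m : IntermediateField F (AlgebraicClosure F)))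
    (hg : evS (maxNilIdeal F (E ⊔ ltField π m : IntermediateField F (AlgebraicClosure F)))
        (inclPt (le_sup_right : ltField π m ≤ E ⊔ ltField π m) (cohPt hπ m))
        (PowerSeries.map (inclUnitBall (F := F) (le_sup_left : E ≤ E ⊔ ltField π m) :
          unitBall E →+* unitBall (E ⊔ ltField π m : IntermediateField F (AlgebraicClosure F)))
          ((PowerSeries.map ((frobUnitBall E σ₀).symm : unitBall E →+* unitBall E))^[m + 1] g)) = β)
    (v : 𝒪[F]ˣ) :
    ∃ τ : (E ⊔ ltField π m : IntermediateField F (AlgebraicClosure F)) ≃ₐ[F]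
        (E ⊔ ltField π m : IntermediateField F (AlgebraicClosure F)),
      ActsAsFrobPow E σ₀ (m + 1 + k) τ ∧
      ((evS (maxNilIdeal F (E ⊔ ltField π m : IntermediateField F (AlgebraicClosure F)))
          (mapPt (relGalOfUnit hπ E m hE v) (inclPt (le_sup_right : ltField π m ≤ E ⊔ ltField π m) (cohPt hπ m)))
          (PowerSeries.map (inclUnitBall (F := F) (le_sup_left : E ≤ E ⊔ ltField π m) :
            unitBall E →+* unitBall (E ⊔ ltField π m : IntermediateField F (AlgebraicClosure F)))
            ((PowerSeries.map (frobUnitBall E σ₀ : unitBall E →+* unitBall E))^[k] g)) :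
          unitBall (E ⊔ ltField π m : IntermediateField F (AlgebraicClosure F))) :
          (E ⊔ ltField π m : IntermediateField F (AlgebraicClosure F))) =
        τ ((β : unitBall (E ⊔ ltField π m : IntermediateField F (AlgebraicClosure F))) :
          (E ⊔ ltField π m : IntermediateField F (AlgebraicClosure F))) := by
  obtain ⟨τ, hτ, hpt⟩ := hex m (m + 1 + k) v
  exact ⟨τ, hτ, by rw [← hpt]; exact evS_mapPt_eq_of_actsAsFrobPow hπ E σ₀ g m k β hg τ hτ⟩

end LocalUntwist

/-! ## §5. G2, the SERIES identity (PROVED, any ℚ-algebra): the reading witness of a series `≡ 1 (mod 2)` IS `Λ₂` of an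
integral series — `logOf (1 + 2y) = 2 • Λ₂(y)`, `Λ₂ = ½·log(1 + 2X) ∈ ℤ₂⟦X⟧` (`2^{n−1}/n ∈ ℤ₂`).  This is what puts
R221 «EVAL₂» inside the tree's INTEGRAL evaluation calculus (`evS`, `evS_subst`): the outer series of the composite is
`Λ₂` (integral), never Mercator's `log(1+X)` (coefficients `1/n`, unbounded). -/

section SeriesIdentity

open PowerSeries

variable (A : Type*) [CommRing A] [Algebra ℚ A]

/-- `Λ₂ := ½·log(1 + 2X) = Σ_{n ≥ 1} (−1)^{n+1} 2^{n−1}/n · X^n`. -/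
def Lam2 : PowerSeries A :=
  PowerSeries.mk fun n => if n = 0 then 0 else algebraMap ℚ A ((-1 : ℚ) ^ (n + 1) * 2 ^ (n - 1) / n)

variable {A}

theorem coeff_Lam2 (n : ℕ) :
    coeff n (Lam2 A) = if n = 0 then 0 else algebraMap ℚ A ((-1 : ℚ) ^ (n + 1) * 2 ^ (n - 1) / n) :=
  coeff_mk _ _

theorem constantCoeff_Lam2 : constantCoeff (Lam2 A) = 0 := by
  simp [← coeff_zero_eq_constantCoeff_apply, coeff_Lam2]

/-- `2 • Λ₂ = log(1 + 2X) = rescale 2 (log A)`. -/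
theorem two_smul_Lam2 : (2 : A) • Lam2 A = rescale (2 : A) (log A) := by
  ext n
  rw [coeff_smul, coeff_rescale, coeff_Lam2, coeff_log]
  split_ifs with h
  · simp
  · obtain ⟨k, rfl⟩ := Nat.exists_eq_succ_of_ne_zero h
    rw [smul_eq_mul, show (2 : A) = algebraMap ℚ A 2 from (map_ofNat (algebraMap ℚ A) 2).symm, ← map_pow,
      ← map_mul, ← map_mul, Nat.succ_eq_add_one, Nat.add_sub_cancel]
    congr 1
    rw [pow_succ]
    ring

/-- ★ **G2 (PROVED): `logOf (1 + 2y) = 2 • Λ₂(y)` for `y(0) = 0`.** -/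
theorem logOf_one_add_two_smul {y : A⟦X⟧} (hy : constantCoeff y = 0) :
    logOf (1 + (2 : A) • y) = (2 : A) • (Lam2 A).subst y := by
  have hyS : HasSubst y := HasSubst.of_constantCoeff_zero' hy
  have h2X : HasSubst ((2 : A) • X : A⟦X⟧) := HasSubst.smul_X' 2
  rw [logOf_eq, add_sub_cancel_left, ← subst_smul hyS, two_smul_Lam2, rescale_eq_subst,
    subst_comp_subst_apply h2X hyS, subst_smul hyS, subst_X hyS]

/-- The coefficients of `Λ₂` ARE the `lamTerm` scalars: `coeff (d+1) Λ₂ = (−1)^d 2^d/(d+1)` — so the `evS`-value of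
`Λ₂(y)` at `w` (`tsum_coeff_subst_mul_pow_eq`: `= Σ_n coeff n Λ₂ · y(w)^n`) is `Σ' lamTerm (y(w))` after `θ`. -/
theorem coeff_Lam2_succ (d : ℕ) :
    coeff (d + 1) (Lam2 A) = algebraMap ℚ A ((-1 : ℚ) ^ d * 2 ^ d / (d + 1)) := by
  rw [coeff_Lam2, if_neg (Nat.succ_ne_zero d), Nat.add_sub_cancel]
  congr 1
  push_cast
  ring

/-- G3a (PROVED): `logOf` commutes with substitution — `logOf (Q∘φ) = (logOf Q)∘φ`. -/
theorem logOf_subst {Q φ : A⟦X⟧} (hQ : constantCoeff Q = 1) (hφ : constantCoeff φ = 0) :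
    logOf (Q.subst φ) = (logOf Q).subst φ := by
  have hφS : HasSubst φ := HasSubst.of_constantCoeff_zero' hφ
  have hQ1 : HasSubst (Q - 1 : A⟦X⟧) := HasSubst.of_constantCoeff_zero' (by simp [hQ])
  rw [logOf_eq, logOf_eq, subst_comp_subst_apply hQ1 hφS]
  congr 1
  rw [← coe_substAlgHom hφS, map_sub, map_one]

/-- G3b (PROVED): `logOf` commutes with `map` along a ring hom (the transport `j`, then `Θ`). -/
theorem logOf_map {B : Type*} [CommRing B] [Algebra ℚ B] (h : A →+* B) {Q : A⟦X⟧}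
    (hQ : constantCoeff Q = 1) : logOf (Q.map h) = (logOf Q).map h := by
  have hQ1 : HasSubst (Q - 1 : A⟦X⟧) := HasSubst.of_constantCoeff_zero' (by simp [hQ])
  rw [logOf_eq, logOf_eq]
  change _ = MvPowerSeries.map h (PowerSeries.subst (Q - 1) (log A))
  rw [map_subst hQ1, map_log]
  congr 1
  change _ = PowerSeries.map h (Q - 1)
  rw [map_sub, map_one]

end SeriesIdentity

end Summit.BirchSwinnertonDyer.BirchSwinnertonDyer.Cruxes.SplitBadTwoLowerHalfOfFacts.ReadTwoCutK3G40

end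


set_option linter.dupNamespace false -- cosmetic (namespace repeats `BirchSwinnertonDyer`); drop at port

/-!
# STUB-IDEAS k3 (gen 41) — «THE LOCAL UNTWIST EXISTS, IS UNIQUE, AND IS `σ₀^K| · σ_{χ_π(σ₀^K)⁻¹ v}`»
# R217 «LOCAL-UNTWIST₂», EXISTENCE HALF: k3-g40's typed sub-stub `LocalUntwistExists` PROVED (0 sorry)

Stub-ideation sketch for `stub_heegnerIndexLowerAtTwo` (ACTIVE skeleton `f2bd84c029a8a938`, route
`PrintCf2`, crux `SplitBadTwoLowerHalfOfFacts` = `stmt-BirchSwinnertonDyer-27851`), technique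
«decomposition into sub-stubs with a PROVED glue».  BSD is NOT proved by any of this; the stub of record is
FIXED and not re-typed; this file closes ONE input of R219 «READ₂» (STUB-PLAN v7.3 §4 (iii) (ρ3), ORDER NOW B′
lane «R217 (S)»): the EXISTENCE of the local untwisting automorphism, typed by k3-g40 as the open crux
`ReadTwoCutK3G40.LocalUntwistExists` (its K2, XS–S) and consumed by its `exists_untwisted_table`.

NODE (verbatim from k3-g40 §4): for `E ⊆ F^{nr}` finite normal, `σ₀ ∈ Γ_F`, every level `m`, exponent `K`
and unit `v ∈ 𝒪_F^×` there is `τ ∈ Aut_F(E·K_π^{m+1})` acting on `𝒪_E` as `φ^K` (`φ = frobUnitBall E σ₀`)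
and moving `ι ω_{m+1}` exactly as `σ_v = relGalOfUnit v` does.

DECOMPOSITION (all three sub-stubs DISCHARGED, glue PROVED ⇒ the node is CLOSED):
* U1 `UnitValuedFrobRestriction` — the restriction `ρ_K = σ₀^K|_{E·K_π^{m+1}}` moves `λ'` through a unit
  (`ρ_K [a]λ' = [w a]λ'`, in fact `w = χ_π(σ₀^K)`): tree `exists_unit_mapPt_eq_relAct` / `mapPt_relRestrict_relAct`;
* U2 `UnitRealisedFixingE` — every unit `u` is realised on `λ'` by an automorphism fixing `E` pointwise
  (linear disjointness `E ∩ K_π^{m+1} = F`): tree `relGalOfUnit`, `relGalOfUnit_apply_inclusion`,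
  `mapPt_relGalOfUnit_relAct` (from `exists_absGal_fixing_smul_ltRoot_eq`);
* U3 `FrobRestrictionActs` — `ρ_K` acts on `𝒪_E` as `φ^K`: PROVED here (`coe_frobUnitBall_iterate`: both
  sides are `σ₀^K • x` in `F̄`, by `coe_relRestrict_apply` / `coe_restrictNormal_apply`);
* GLUE `localUntwistExists_of : U1 → U2 → U3 → LocalUntwistExists` — `τ := ρ_K ∘ σ_{w⁻¹ v}` (the actions
  `[a]_f` commute with automorphisms, `mapPt_relAct'`): PROVED; hence ★ `localUntwistExists` PROVED.
Extras: ★ `localUntwist_unique` (an automorphism of `E·K_π^{m+1}` is determined by `φ^K` on `𝒪_E` — which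
already pins it on `E`, `forall_apply_inclusion_of_forall_unitBall` — and by its value on the primitive point
`ι ω_{m+1} = [c_m]λ'`), the explicit untwist `localUntwist K v := σ₀^K| · σ_{χ_π(σ₀^K)⁻¹ v}` with its two
defining properties, `eq_localUntwist` (every untwist IS it), `localUntwist_add_mul` (`σ_loc` is a homomorphic
image of `ℕ × 𝒪_F^×` — de Shalit I §1.8 in Galois form, relative to `E`), the degenerate instance `K = 0`
(`localUntwist 0 v = σ_v`, B68), and `localUntwistExists_offset` = the exact instance `hex m (m+1+k) v` that
k3-g40's `exists_untwisted_table` consumes.  §7: R222 «SHIFT₂» needs NO new theorem — `ϑ(−2 − x) = −π' − ϑ(x)`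
is the tree's `coe_evalPt₁_compSeriesC_reflect` (`LubinTateComparisonReflectionTwo` ★★); the residual index
identity `ζ^{j+2^n} − 1 = −2 − (ζ^j − 1)` for a primitive `2^{n+1}`-th root `ζ` (general `n`) is kernel here.
-/

noncomputable section

namespace Summit.BirchSwinnertonDyer.BirchSwinnertonDyer.Cruxes.SplitBadTwoLowerHalfOfFacts.LocalUntwistK3G41

open ValuativeRel IsLocalRing Field
open Literature.NumberTheory.GaloisRepresentations Literature.NumberTheory.GaloisRepresentations.IsNonarchimedeanLocalField
  Literature.NumberTheory.GaloisRepresentations.LubinTate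

variable {F : Type} [Field F] [ValuativeRel F] [TopologicalSpace F] [IsNonarchimedeanLocalField F]

attribute [local instance] ltNormUniformSpace ltNormIsUniformAddGroup rk1 nF nE fintypeResidueField

variable {π : 𝒪[F]} (hπ : (valuation F).IsUniformizer (π : F))
variable (E : IntermediateField F (AlgebraicClosure F)) [FiniteDimensional F E] [Normal F E]

/-! ## §0. The node, VERBATIM from k3-g40 (`ReadTwoCutK3G40.ActsAsFrobPow`, `.LocalUntwistExists`) -/

/-- "`τ ∈ Aut_F(E·K_π^{m+1})` acts on `𝒪_E` as `φ^K`" (`φ = frobUnitBall E σ₀`; `K` is NOT tied to the level).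
VERBATIM k3-g40. -/
def ActsAsFrobPow (σ₀ : absoluteGaloisGroup F) (K : ℕ) {m : ℕ}
    (τ : (E ⊔ ltField π m : IntermediateField F (AlgebraicClosure F)) ≃ₐ[F]
      (E ⊔ ltField π m : IntermediateField F (AlgebraicClosure F))) : Prop :=
  ∀ x : unitBall E, τ (IntermediateField.inclusion le_sup_left (x : E)) =
    IntermediateField.inclusion le_sup_left
      (((((frobUnitBall E σ₀ : unitBall E ≃+* unitBall E) : unitBall E →+* unitBall E) :
        unitBall E → unitBall E)^[K] x : unitBall E) : E)

/-- R217 EXISTENCE HALF (k3-g40's typed sub-stub, VERBATIM): for every level `m`, exponent `K` and unit `v` there is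
`τ ∈ Aut_F(E·K_π^{m+1})` acting on `𝒪_E` as `φ^K` and moving `ι ω_{m+1}` as `σ_v` does. -/
def LocalUntwistExists (hE : E ≤ maxUnramified F) (σ₀ : absoluteGaloisGroup F) : Prop :=
  ∀ (m K : ℕ) (v : 𝒪[F]ˣ), ∃ τ : (E ⊔ ltField π m : IntermediateField F (AlgebraicClosure F)) ≃ₐ[F]
      (E ⊔ ltField π m : IntermediateField F (AlgebraicClosure F)),
    ActsAsFrobPow E σ₀ K τ ∧
      mapPt τ (inclPt (le_sup_right : ltField π m ≤ E ⊔ ltField π m) (cohPt hπ m)) =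
        mapPt (relGalOfUnit hπ E m hE v) (inclPt (le_sup_right : ltField π m ≤ E ⊔ ltField π m) (cohPt hπ m))

/-! ## §1. The three sub-stubs (typed) -/

/-- **U1** — the restricted Frobenius power `ρ_K = relRestrict (σ₀^K)` moves the base point `λ'` through a UNIT:
`ρ_K([a]λ') = [w·a]λ'` for some `w ∈ 𝒪_F^×` (uniformly in `a`). -/
def UnitValuedFrobRestriction (σ₀ : absoluteGaloisGroup F) : Prop :=
  ∀ (m K : ℕ), ∃ w : 𝒪[F]ˣ, ∀ a : 𝒪[F],
    mapPt (relRestrict hπ E m (σ₀ ^ K)) (relAct hπ E m a (relGenPt hπ E m)) =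
      relAct hπ E m ((w : 𝒪[F]) * a) (relGenPt hπ E m)

/-- **U2** — every unit `u` is realised on `λ'` by an `F`-automorphism of `E·K_π^{m+1}` FIXING `E` POINTWISE
(`E/F` unramified and `K_π^{m+1}/F` totally ramified are linearly disjoint). -/
def UnitRealisedFixingE : Prop :=
  ∀ (m : ℕ) (u : 𝒪[F]ˣ), ∃ σ : (E ⊔ ltField π m : IntermediateField F (AlgebraicClosure F)) ≃ₐ[F]
      (E ⊔ ltField π m : IntermediateField F (AlgebraicClosure F)),
    (∀ x : E, σ (IntermediateField.inclusion le_sup_left x) = IntermediateField.inclusion le_sup_left x) ∧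
      ∀ a : 𝒪[F], mapPt σ (relAct hπ E m a (relGenPt hπ E m)) = relAct hπ E m ((u : 𝒪[F]) * a) (relGenPt hπ E m)

/-- **U3** — `ρ_K = relRestrict (σ₀^K)` acts on `𝒪_E` as `φ^K`. -/
def FrobRestrictionActs (σ₀ : absoluteGaloisGroup F) : Prop :=
  ∀ (m K : ℕ), ActsAsFrobPow E σ₀ K (relRestrict hπ E m (σ₀ ^ K))

/-! ## §2. GLUE (PROVED): `τ := ρ_K ∘ σ_{w⁻¹ v}` -/

omit [Normal F E] in
/-- `ι ω_{m+1} = [c_m]λ'` (`ω_{m+1} = [c_m]λ_{m+1}`, `c_m = cohUnit`). -/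
theorem inclPt_cohPt_eq_relAct (m : ℕ) :
    inclPt (le_sup_right : ltField π m ≤ E ⊔ ltField π m) (cohPt hπ m) =
      relAct hπ E m (cohUnit hπ m : 𝒪[F]) (relGenPt hπ E m) := by
  rw [cohPt_eq]; exact inclPt_ltAct_genPt hπ E m _

/-- ★ **GLUE: U1 → U2 → U3 → R217∃.**  With `w` from U1 and `σ' = σ_{w⁻¹v}` from U2, `τ := ρ_K ∘ σ'` acts on `𝒪_E`
as `ρ_K` does (U3: `φ^K`), and `τ([c]λ') = ρ_K([w⁻¹ v c]λ') = [w w⁻¹ v c]λ' = [v c]λ' = σ_v([c]λ')`. -/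
theorem localUntwistExists_of (hE : E ≤ maxUnramified F) (σ₀ : absoluteGaloisGroup F)
    (h1 : UnitValuedFrobRestriction hπ E σ₀) (h2 : UnitRealisedFixingE hπ E) (h3 : FrobRestrictionActs hπ E σ₀) :
    LocalUntwistExists hπ E hE σ₀ := by
  intro m K v
  obtain ⟨w, hw⟩ := h1 m K
  obtain ⟨σ', hσ'E, hσ'pt⟩ := h2 m (w⁻¹ * v)
  refine ⟨relRestrict hπ E m (σ₀ ^ K) * σ', fun x => ?_, ?_⟩
  · rw [AlgEquiv.mul_apply, hσ'E]
    exact h3 m K x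
  · rw [inclPt_cohPt_eq_relAct, mapPt_mul, hσ'pt, hw, mapPt_relGalOfUnit_relAct, Units.val_mul, mul_assoc,
      Units.mul_inv_cancel_left]

/-! ## §3. The sub-stubs DISCHARGED -/

/-- U1 ✓ (tree: `exists_unit_mapPt_eq_relAct`; explicitly `w = χ_π(σ₀^K)` by `mapPt_relRestrict_relAct`). -/
theorem unitValuedFrobRestriction (σ₀ : absoluteGaloisGroup F) : UnitValuedFrobRestriction hπ E σ₀ :=
  fun m K => ⟨lubinTateChar hπ (σ₀ ^ K), fun a => mapPt_relRestrict_relAct hπ E m (σ₀ ^ K) a⟩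

/-- U2 ✓ (tree: `relGalOfUnit` — the Galois form of `E ∩ K_π^{m+1} = F`, `exists_absGal_fixing_smul_ltRoot_eq`). -/
theorem unitRealisedFixingE (hE : E ≤ maxUnramified F) : UnitRealisedFixingE hπ E :=
  fun m u => ⟨relGalOfUnit hπ E m hE u, relGalOfUnit_apply_inclusion hπ E m hE u,
    mapPt_relGalOfUnit_relAct hπ E m hE u⟩

/-- `φ = σ₀|` on `𝒪_E`, read in `F̄`. -/
theorem coe_frobUnitBall_apply (σ₀ : absoluteGaloisGroup F) (x : unitBall E) :
    ((((((frobUnitBall E σ₀ : unitBall E ≃+* unitBall E) : unitBall E →+* unitBall E) :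
        unitBall E → unitBall E) x : unitBall E) : E) : AlgebraicClosure F) =
      σ₀ • ((x : E) : AlgebraicClosure F) := by
  change ((((absoluteGaloisGroup.toAlgEquiv F σ₀).restrictNormal E) (x : E) : E) : AlgebraicClosure F) = _
  exact coe_restrictNormal_apply E σ₀ (x : E)

/-- `φ^[K] = σ₀^K|` on `𝒪_E`, read in `F̄`. -/
theorem coe_frobUnitBall_iterate (σ₀ : absoluteGaloisGroup F) (K : ℕ) (x : unitBall E) :
    ((((((frobUnitBall E σ₀ : unitBall E ≃+* unitBall E) : unitBall E →+* unitBall E) :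
        unitBall E → unitBall E)^[K] x : unitBall E) : E) : AlgebraicClosure F) =
      (σ₀ ^ K) • ((x : E) : AlgebraicClosure F) := by
  induction K with
  | zero => rw [Function.iterate_zero_apply, pow_zero, one_smul]
  | succ K ih => rw [Function.iterate_succ_apply', coe_frobUnitBall_apply, ih, ← mul_smul, ← pow_succ']

/-- U3 ✓: `relRestrict (σ₀^K)` acts on `𝒪_E` as `φ^K` (both sides are `σ₀^K • x` in `F̄`). -/
theorem frobRestrictionActs (σ₀ : absoluteGaloisGroup F) : FrobRestrictionActs hπ E σ₀ := by
  intro m K x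
  apply Subtype.ext
  rw [coe_relRestrict_apply, IntermediateField.coe_inclusion, IntermediateField.coe_inclusion,
    coe_frobUnitBall_iterate]

/-! ## §4. ★ R217 EXISTENCE HALF — PROVED -/

/-- ★★ **`LocalUntwistExists` holds** (k3-g40's K2 closed): for every `m K v` the untwist exists. -/
theorem localUntwistExists (hE : E ≤ maxUnramified F) (σ₀ : absoluteGaloisGroup F) :
    LocalUntwistExists hπ E hE σ₀ :=
  localUntwistExists_of hπ E hE σ₀ (unitValuedFrobRestriction hπ E σ₀) (unitRealisedFixingE hπ E hE)
    (frobRestrictionActs hπ E σ₀)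

/-! ## §5. UNIQUENESS (PROVED): the untwist is pinned by `φ^K` on `𝒪_E` and by its value on `ι ω_{m+1}` -/

omit [Normal F E] in
/-- An `F`-automorphism of `E·K_π^{m+1}` fixing `𝒪_E` pointwise fixes `E` pointwise (every `x ∈ E` lies in `𝒪_E`
or is the inverse of an element of `𝒪_E`). -/
theorem forall_apply_inclusion_of_forall_unitBall {m : ℕ}
    {σ : (E ⊔ ltField π m : IntermediateField F (AlgebraicClosure F)) ≃ₐ[F]
      (E ⊔ ltField π m : IntermediateField F (AlgebraicClosure F))}
    (h : ∀ x : unitBall E, σ (IntermediateField.inclusion le_sup_left (x : E)) =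
      IntermediateField.inclusion le_sup_left (x : E)) (x : E) :
    σ (IntermediateField.inclusion le_sup_left x) = IntermediateField.inclusion le_sup_left x := by
  by_cases hx : ‖x‖ ≤ 1
  · exact h ⟨x, (mem_unitBall_iff E).mpr hx⟩
  · have hx1 : 1 < ‖x‖ := not_le.mp hx
    have hinv : ‖x⁻¹‖ ≤ 1 := by rw [norm_inv]; exact inv_le_one_of_one_le₀ hx1.le
    have h1 : σ (IntermediateField.inclusion le_sup_left x⁻¹) = IntermediateField.inclusion le_sup_left x⁻¹ :=
      h ⟨x⁻¹, (mem_unitBall_iff E).mpr hinv⟩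
    rwa [map_inv₀, map_inv₀, inv_inj] at h1

/-- ★ **UNIQUENESS of the local untwist**: two automorphisms of `E·K_π^{m+1}` acting on `𝒪_E` as `φ^K` and agreeing
on `ι ω_{m+1}` are equal (`τ₁⁻¹τ₂` fixes `E` pointwise and the primitive point `[c_m]λ'`; tree
`algEquiv_eq_of_mapPt_relAct_eq`).  So R217's `τ` is CANONICAL — row 110's `σ_loc`. -/
theorem localUntwist_unique (σ₀ : absoluteGaloisGroup F) {m K : ℕ}
    {τ₁ τ₂ : (E ⊔ ltField π m : IntermediateField F (AlgebraicClosure F)) ≃ₐ[F]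
      (E ⊔ ltField π m : IntermediateField F (AlgebraicClosure F))}
    (h₁ : ActsAsFrobPow E σ₀ K τ₁) (h₂ : ActsAsFrobPow E σ₀ K τ₂)
    (hpt : mapPt τ₁ (inclPt (le_sup_right : ltField π m ≤ E ⊔ ltField π m) (cohPt hπ m)) =
      mapPt τ₂ (inclPt (le_sup_right : ltField π m ≤ E ⊔ ltField π m) (cohPt hπ m))) :
    τ₁ = τ₂ := by
  rw [← inv_mul_eq_one]
  refine algEquiv_eq_of_mapPt_relAct_eq hπ E m (cohUnit hπ m) (fun x => ?_) (fun _ => rfl) ?_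
  · refine forall_apply_inclusion_of_forall_unitBall E (fun y => ?_) x
    rw [AlgEquiv.mul_apply, h₂ y, ← h₁ y, AlgEquiv.aut_inv, AlgEquiv.symm_apply_apply]
  · rw [← inclPt_cohPt_eq_relAct, mapPt_mul, ← hpt, ← mapPt_mul, inv_mul_cancel]

/-! ## §6. The EXPLICIT untwist `σ_loc(K, v) = σ₀^K| ∘ σ_{χ_π(σ₀^K)⁻¹ v}` and the degenerate instance `K = 0` -/

/-- **The explicit local untwist** `σ_loc(K, v) := σ₀^K|_{E·K_π^{m+1}} ∘ σ_{χ_π(σ₀^K)⁻¹·v}` (`χ_π = lubinTateChar`,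
the Lubin–Tate character of `Γ_F`; `σ_u = relGalOfUnit u`). -/
def localUntwist (hE : E ≤ maxUnramified F) (σ₀ : absoluteGaloisGroup F) (m K : ℕ) (v : 𝒪[F]ˣ) :
    (E ⊔ ltField π m : IntermediateField F (AlgebraicClosure F)) ≃ₐ[F]
      (E ⊔ ltField π m : IntermediateField F (AlgebraicClosure F)) :=
  relRestrict hπ E m (σ₀ ^ K) * relGalOfUnit hπ E m hE ((lubinTateChar hπ (σ₀ ^ K))⁻¹ * v)

/-- `σ_loc(K, v)` acts on `𝒪_E` as `φ^K`. -/
theorem localUntwist_actsAsFrobPow (hE : E ≤ maxUnramified F) (σ₀ : absoluteGaloisGroup F) (m K : ℕ) (v : 𝒪[F]ˣ) :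
    ActsAsFrobPow E σ₀ K (localUntwist hπ E hE σ₀ m K v) := fun x => by
  rw [localUntwist, AlgEquiv.mul_apply, relGalOfUnit_apply_inclusion]
  exact frobRestrictionActs hπ E σ₀ m K x

/-- `σ_loc(K, v)([a]λ') = [v·a]λ'` — on the torsion `σ_loc(K, v)` IS `σ_v`, for every `a`. -/
theorem mapPt_localUntwist_relAct (hE : E ≤ maxUnramified F) (σ₀ : absoluteGaloisGroup F) (m K : ℕ) (v : 𝒪[F]ˣ)
    (a : 𝒪[F]) :
    mapPt (localUntwist hπ E hE σ₀ m K v) (relAct hπ E m a (relGenPt hπ E m)) =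
      relAct hπ E m ((v : 𝒪[F]) * a) (relGenPt hπ E m) := by
  rw [localUntwist, mapPt_mul, mapPt_relGalOfUnit_relAct, mapPt_relRestrict_relAct, Units.val_mul, mul_assoc,
    Units.mul_inv_cancel_left]

/-- `σ_loc(K, v)(ι ω_{m+1}) = σ_v(ι ω_{m+1})`. -/
theorem mapPt_localUntwist_cohPt (hE : E ≤ maxUnramified F) (σ₀ : absoluteGaloisGroup F) (m K : ℕ) (v : 𝒪[F]ˣ) :
    mapPt (localUntwist hπ E hE σ₀ m K v) (inclPt (le_sup_right : ltField π m ≤ E ⊔ ltField π m) (cohPt hπ m)) =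
      mapPt (relGalOfUnit hπ E m hE v) (inclPt (le_sup_right : ltField π m ≤ E ⊔ ltField π m) (cohPt hπ m)) := by
  rw [inclPt_cohPt_eq_relAct, mapPt_localUntwist_relAct, mapPt_relGalOfUnit_relAct]

/-- ★ Every untwist IS `σ_loc(K, v)` (existence + uniqueness packaged). -/
theorem eq_localUntwist (hE : E ≤ maxUnramified F) (σ₀ : absoluteGaloisGroup F) {m K : ℕ} (v : 𝒪[F]ˣ)
    {τ : (E ⊔ ltField π m : IntermediateField F (AlgebraicClosure F)) ≃ₐ[F]
      (E ⊔ ltField π m : IntermediateField F (AlgebraicClosure F))}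
    (hτ : ActsAsFrobPow E σ₀ K τ)
    (hpt : mapPt τ (inclPt (le_sup_right : ltField π m ≤ E ⊔ ltField π m) (cohPt hπ m)) =
      mapPt (relGalOfUnit hπ E m hE v) (inclPt (le_sup_right : ltField π m ≤ E ⊔ ltField π m) (cohPt hπ m))) :
    τ = localUntwist hπ E hE σ₀ m K v :=
  localUntwist_unique hπ E σ₀ hτ (localUntwist_actsAsFrobPow hπ E hE σ₀ m K v)
    (by rw [hpt, mapPt_localUntwist_cohPt])

/-- `σ_loc` is a homomorphic image of `ℕ × 𝒪_F^×`: `σ_loc(K₁ + K₂, v₁v₂) = σ_loc(K₁, v₁) ∘ σ_loc(K₂, v₂)` — the Galois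
form of `Gal(E·K_π^{m+1}/F) ⊇ ⟨φ⟩ × (𝒪_F/π^{m+1})^×` (de Shalit I §1.8, relative situation). -/
theorem localUntwist_add_mul (hE : E ≤ maxUnramified F) (σ₀ : absoluteGaloisGroup F) (m K₁ K₂ : ℕ) (v₁ v₂ : 𝒪[F]ˣ) :
    localUntwist hπ E hE σ₀ m (K₁ + K₂) (v₁ * v₂) =
      localUntwist hπ E hE σ₀ m K₁ v₁ * localUntwist hπ E hE σ₀ m K₂ v₂ := by
  symm
  refine eq_localUntwist hπ E hE σ₀ (v₁ * v₂) (fun x => ?_) ?_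
  · rw [AlgEquiv.mul_apply, localUntwist_actsAsFrobPow hπ E hE σ₀ m K₂ v₂ x,
      localUntwist_actsAsFrobPow hπ E hE σ₀ m K₁ v₁, ← Function.iterate_add_apply, Nat.add_comm]
  · rw [inclPt_cohPt_eq_relAct, mapPt_mul, mapPt_localUntwist_relAct, mapPt_localUntwist_relAct,
      mapPt_relGalOfUnit_relAct, Units.val_mul, mul_assoc]

/-- `σ_v` acts on `𝒪_E` as `φ^0 = id`. -/
theorem actsAsFrobPow_zero_relGalOfUnit (hE : E ≤ maxUnramified F) (σ₀ : absoluteGaloisGroup F) (m : ℕ) (v : 𝒪[F]ˣ) :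
    ActsAsFrobPow E σ₀ 0 (relGalOfUnit hπ E m hE v) :=
  fun x => relGalOfUnit_apply_inclusion hπ E m hE v (x : E)

/-- DEGENERATE INSTANCE (B68) `K = 0`: the untwist is `σ_v` itself (`χ_π(1) = 1`, no Frobenius to undo). -/
theorem localUntwist_zero (hE : E ≤ maxUnramified F) (σ₀ : absoluteGaloisGroup F) (m : ℕ) (v : 𝒪[F]ˣ) :
    localUntwist hπ E hE σ₀ m 0 v = relGalOfUnit hπ E m hE v :=
  (eq_localUntwist hπ E hE σ₀ v (actsAsFrobPow_zero_relGalOfUnit hπ E hE σ₀ m v) rfl).symm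

/-- THE INSTANCE k3-g40's `exists_untwisted_table` consumes (`hex m (m + 1 + k) v`): at Frobenius offset `k` over
level `m` the untwist acts on `𝒪_E` as `φ^{m+1+k}` — now hypothesis-free. -/
theorem localUntwistExists_offset (hE : E ≤ maxUnramified F) (σ₀ : absoluteGaloisGroup F) (m k : ℕ) (v : 𝒪[F]ˣ) :
    ∃ τ : (E ⊔ ltField π m : IntermediateField F (AlgebraicClosure F)) ≃ₐ[F]
        (E ⊔ ltField π m : IntermediateField F (AlgebraicClosure F)),
      ActsAsFrobPow E σ₀ (m + 1 + k) τ ∧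
        mapPt τ (inclPt (le_sup_right : ltField π m ≤ E ⊔ ltField π m) (cohPt hπ m)) =
          mapPt (relGalOfUnit hπ E m hE v) (inclPt (le_sup_right : ltField π m ≤ E ⊔ ltField π m) (cohPt hπ m)) :=
  localUntwistExists hπ E hE σ₀ m (m + 1 + k) v

end Summit.BirchSwinnertonDyer.BirchSwinnertonDyer.Cruxes.SplitBadTwoLowerHalfOfFacts.LocalUntwistK3G41

/-! ## §7. R222 SHIFT₂ needs no new theorem: `ϑ(−2 − x) = −π' − ϑ(x)` IS the tree's
`coe_evalPt₁_compSeriesC_reflect` (`LubinTateComparisonReflectionTwo`, ★★); what remains is the INDEX identity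
`ζ^{j+2^n} − 1 = −2 − (ζ^j − 1)` on the `Ĝ_m` side — general `n`, pure algebra, kernel below. -/

namespace Summit.BirchSwinnertonDyer.BirchSwinnertonDyer.Cruxes.SplitBadTwoLowerHalfOfFacts.LocalUntwistK3G41.Shift

variable {R : Type*} [CommRing R] [NoZeroDivisors R]

/-- A primitive `2^{n+1}`-th root of unity has `ζ^{2^n} = −1` (general `n`; k2-g37 did `n = 1, 2` by hand). -/
theorem pow_two_pow_eq_neg_one {n : ℕ} {ζ : R} (hζ : IsPrimitiveRoot ζ (2 ^ (n + 1))) : ζ ^ 2 ^ n = -1 :=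
  (hζ.pow (Nat.two_pow_pos _) (pow_succ 2 n)).eq_neg_one_of_two_right

/-- `−ζ^j = ζ^{j + 2^n}`: the reflection `ε ↦ −ε` is the index shift `j ↦ j + 2^n` on `μ_{2^{n+1}}`. -/
theorem neg_pow_eq_pow_add_two_pow {n : ℕ} {ζ : R} (hζ : IsPrimitiveRoot ζ (2 ^ (n + 1))) (j : ℕ) :
    -ζ ^ j = ζ ^ (j + 2 ^ n) := by
  rw [pow_add, pow_two_pow_eq_neg_one hζ, mul_neg_one]

/-- ★ SHIFT₂, `Ĝ_m` side: `ζ^{j+2^n} − 1 = −2 − (ζ^j − 1)` — verbatim the hypothesis `hx'` of the tree's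
`coe_evalPt₁_compSeriesC_reflect` with `x = ζ^j − 1`, `x' = ζ^{j+2^n} − 1`; its conclusion `ϑ(x') = −π' − ϑ(x)` is
`ϑ(ζ^j − 1) [+]_{f'} ω₁'` (`ω₁' = −π'`, `y [+]_{f'} (−π') = −π' − y` at `q = 2`, tree `coe_tPt_ltDivPt_two`). -/
theorem pow_add_two_pow_sub_one {n : ℕ} {ζ : R} (hζ : IsPrimitiveRoot ζ (2 ^ (n + 1))) (j : ℕ) :
    ζ ^ (j + 2 ^ n) - 1 = -2 - (ζ ^ j - 1) := by
  rw [← neg_pow_eq_pow_add_two_pow hζ j]; ring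

/-- B72 «`γ₀` IS `1 + 2^n`», general `n`, kernel: on the INDEX group the reflection `j ↦ j + 2^n` of an odd index is
MULTIPLICATION by `γ₀ = 1 + 2^n` (not by `−1`; the `−1` above is the field element `ζ^{2^n}`). -/
theorem odd_mul_one_add_two_pow_modEq {n j : ℕ} (hj : Odd j) : j * (1 + 2 ^ n) ≡ j + 2 ^ n [MOD 2 ^ (n + 1)] := by
  obtain ⟨i, rfl⟩ := hj
  have h : (2 * i + 1) * (1 + 2 ^ n) = (2 * i + 1 + 2 ^ n) + 2 ^ (n + 1) * i := by ring
  rw [Nat.ModEq, h, Nat.add_mul_mod_self_left]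

/-- The same in `ZMod (2^{n+1})`: `j·γ₀ = j + 2^n` for odd `j` (the critic `decide`d `N = 4, 8`; here every `n`). -/
theorem odd_mul_gamma0_zmod {n j : ℕ} (hj : Odd j) :
    (j : ZMod (2 ^ (n + 1))) * (1 + 2 ^ n) = j + 2 ^ n := by
  have h := (ZMod.natCast_eq_natCast_iff _ _ _).mpr (odd_mul_one_add_two_pow_modEq (n := n) hj)
  push_cast at h
  exact h

/-- `γ₀² = 1` in `ZMod (2^{n+1})` for `n ≥ 1` (`(1 + 2^n)² = 1 + 2^{n+1} + 2^{2n}`). -/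
theorem gamma0_sq {n : ℕ} (hn : 1 ≤ n) : ((1 + 2 ^ n : ZMod (2 ^ (n + 1)))) ^ 2 = 1 := by
  have h : (1 + 2 ^ n) ^ 2 ≡ 1 [MOD 2 ^ (n + 1)] := by
    obtain ⟨k, rfl⟩ := Nat.exists_eq_add_of_le hn
    have e : (1 + 2 ^ (1 + k)) ^ 2 = 1 + 2 ^ (1 + k + 1) * (1 + 2 ^ k) := by ring
    rw [Nat.ModEq, e, Nat.add_mul_mod_self_left]
  have h' := (ZMod.natCast_eq_natCast_iff _ _ _).mpr h
  push_cast at h'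
  exact h'

end Summit.BirchSwinnertonDyer.BirchSwinnertonDyer.Cruxes.SplitBadTwoLowerHalfOfFacts.LocalUntwistK3G41.Shift


/-! # PART C — the critic's junction (g42) -/

namespace Summit.BirchSwinnertonDyer.BirchSwinnertonDyer.Cruxes.SplitBadTwoLowerHalfOfFacts.CriticG42

section Junction

open ValuativeRel IsLocalRing Field
open Literature.NumberTheory.GaloisRepresentations Literature.NumberTheory.GaloisRepresentations.IsNonarchimedeanLocalField
  Literature.NumberTheory.GaloisRepresentations.LubinTate Literature.NumberTheory.PAdicHodge

variable {F : Type} [Field F] [ValuativeRel F] [TopologicalSpace F] [IsNonarchimedeanLocalField F]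

attribute [local instance] ltNormUniformSpace ltNormIsUniformAddGroup rk1 nF nE fintypeResidueField

variable {π : 𝒪[F]} (hπ : (valuation F).IsUniformizer (π : F))
variable (E : IntermediateField F (AlgebraicClosure F)) [FiniteDimensional F E] [Normal F E]

/-- J1: k3-g41's `ActsAsFrobPow` IS k3-g40's (token-identical bodies). -/
theorem actsAsFrobPow_iff (σ₀ : absoluteGaloisGroup F) (K : ℕ) {m : ℕ}
    (τ : (E ⊔ ltField π m : IntermediateField F (AlgebraicClosure F)) ≃ₐ[F]
      (E ⊔ ltField π m : IntermediateField F (AlgebraicClosure F))) :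
    ReadTwoCutK3G40.ActsAsFrobPow E σ₀ K τ ↔ LocalUntwistK3G41.ActsAsFrobPow E σ₀ K τ := Iff.rfl

/-- J2: k3-g41's `LocalUntwistExists` IS k3-g40's typed sub-stub (token-identical bodies). -/
theorem localUntwistExists_iff (hE : E ≤ maxUnramified F) (σ₀ : absoluteGaloisGroup F) :
    ReadTwoCutK3G40.LocalUntwistExists hπ E hE σ₀ ↔ LocalUntwistK3G41.LocalUntwistExists hπ E hE σ₀ := Iff.rfl

/-- ★ J3: k3-g40's K2 = R217∃ HOLDS. -/
theorem localUntwistExists_holds (hE : E ≤ maxUnramified F) (σ₀ : absoluteGaloisGroup F) :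
    ReadTwoCutK3G40.LocalUntwistExists hπ E hE σ₀ :=
  (localUntwistExists_iff hπ E hE σ₀).mpr (LocalUntwistK3G41.localUntwistExists hπ E hE σ₀)

/-- ★ J4: k3-g40's `exists_untwisted_table` with `hex` DISCHARGED (hypothesis-free untwisted value tables, every
Frobenius offset `k`). -/
theorem exists_untwisted_table' (hE : E ≤ maxUnramified F) (σ₀ : absoluteGaloisGroup F)
    (g : PowerSeries (unitBall E)) (m k : ℕ)
    (β : unitBall (E ⊔ ltField π m : IntermediateField F (AlgebraicClosure F)))
    (hg : evS (maxNilIdeal F (E ⊔ ltField π m : IntermediateField F (AlgebraicClosure F)))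
        (inclPt (le_sup_right : ltField π m ≤ E ⊔ ltField π m) (cohPt hπ m))
        (PowerSeries.map (inclUnitBall (F := F) (le_sup_left : E ≤ E ⊔ ltField π m) :
          unitBall E →+* unitBall (E ⊔ ltField π m : IntermediateField F (AlgebraicClosure F)))
          ((PowerSeries.map ((frobUnitBall E σ₀).symm : unitBall E →+* unitBall E))^[m + 1] g)) = β)
    (v : 𝒪[F]ˣ) :
    ∃ τ : (E ⊔ ltField π m : IntermediateField F (AlgebraicClosure F)) ≃ₐ[F]
        (E ⊔ ltField π m : IntermediateField F (AlgebraicClosure F)),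
      ReadTwoCutK3G40.ActsAsFrobPow E σ₀ (m + 1 + k) τ ∧
      ((evS (maxNilIdeal F (E ⊔ ltField π m : IntermediateField F (AlgebraicClosure F)))
          (mapPt (relGalOfUnit hπ E m hE v) (inclPt (le_sup_right : ltField π m ≤ E ⊔ ltField π m) (cohPt hπ m)))
          (PowerSeries.map (inclUnitBall (F := F) (le_sup_left : E ≤ E ⊔ ltField π m) :
            unitBall E →+* unitBall (E ⊔ ltField π m : IntermediateField F (AlgebraicClosure F)))
            ((PowerSeries.map (frobUnitBall E σ₀ : unitBall E →+* unitBall E))^[k] g)) :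
          unitBall (E ⊔ ltField π m : IntermediateField F (AlgebraicClosure F))) :
          (E ⊔ ltField π m : IntermediateField F (AlgebraicClosure F))) =
        τ ((β : unitBall (E ⊔ ltField π m : IntermediateField F (AlgebraicClosure F))) :
          (E ⊔ ltField π m : IntermediateField F (AlgebraicClosure F))) :=
  ReadTwoCutK3G40.exists_untwisted_table hπ E hE σ₀ (localUntwistExists_holds hπ E hE σ₀) g m k β hg v

/-- ★ J5 (sharper than J4): the untwist may be taken to be THE EXPLICIT `σ_loc(m+1+k, v) = localUntwist (m+1+k) v`
— R219-INST₂ computes with a named automorphism. -/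
theorem untwisted_table_explicit (hE : E ≤ maxUnramified F) (σ₀ : absoluteGaloisGroup F)
    (g : PowerSeries (unitBall E)) (m k : ℕ)
    (β : unitBall (E ⊔ ltField π m : IntermediateField F (AlgebraicClosure F)))
    (hg : evS (maxNilIdeal F (E ⊔ ltField π m : IntermediateField F (AlgebraicClosure F)))
        (inclPt (le_sup_right : ltField π m ≤ E ⊔ ltField π m) (cohPt hπ m))
        (PowerSeries.map (inclUnitBall (F := F) (le_sup_left : E ≤ E ⊔ ltField π m) :
          unitBall E →+* unitBall (E ⊔ ltField π m : IntermediateField F (AlgebraicClosure F)))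
          ((PowerSeries.map ((frobUnitBall E σ₀).symm : unitBall E →+* unitBall E))^[m + 1] g)) = β)
    (v : 𝒪[F]ˣ) :
    ((evS (maxNilIdeal F (E ⊔ ltField π m : IntermediateField F (AlgebraicClosure F)))
        (mapPt (relGalOfUnit hπ E m hE v) (inclPt (le_sup_right : ltField π m ≤ E ⊔ ltField π m) (cohPt hπ m)))
        (PowerSeries.map (inclUnitBall (F := F) (le_sup_left : E ≤ E ⊔ ltField π m) :
          unitBall E →+* unitBall (E ⊔ ltField π m : IntermediateField F (AlgebraicClosure F)))
          ((PowerSeries.map (frobUnitBall E σ₀ : unitBall E →+* unitBall E))^[k] g)) :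
        unitBall (E ⊔ ltField π m : IntermediateField F (AlgebraicClosure F))) :
        (E ⊔ ltField π m : IntermediateField F (AlgebraicClosure F))) =
      LocalUntwistK3G41.localUntwist hπ E hE σ₀ m (m + 1 + k) v
        ((β : unitBall (E ⊔ ltField π m : IntermediateField F (AlgebraicClosure F))) :
          (E ⊔ ltField π m : IntermediateField F (AlgebraicClosure F))) := by
  rw [← LocalUntwistK3G41.mapPt_localUntwist_cohPt hπ E hE σ₀ m (m + 1 + k) v]
  exact ReadTwoCutK3G40.evS_mapPt_eq_of_actsAsFrobPow hπ E σ₀ g m k β hg _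
    ((actsAsFrobPow_iff E σ₀ (m + 1 + k) _).mpr
      (LocalUntwistK3G41.localUntwist_actsAsFrobPow hπ E hE σ₀ m (m + 1 + k) v))

/-! ### Degenerate instance (B68): `E = ⊥`, i.e. the absolute tower `K_π^{m+1}/F` — nothing to untwist -/

omit [FiniteDimensional F E] [Normal F E] in
/-- On `𝒪_F = 𝒪_⊥` the Frobenius `φ = σ₀|` is the identity (every element is `F`-rational). -/
theorem frobUnitBall_iterate_bot (σ₀ : absoluteGaloisGroup F) (K : ℕ)
    (x : unitBall (⊥ : IntermediateField F (AlgebraicClosure F))) :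
    (((frobUnitBall (⊥ : IntermediateField F (AlgebraicClosure F)) σ₀ :
        unitBall (⊥ : IntermediateField F (AlgebraicClosure F)) ≃+*
          unitBall (⊥ : IntermediateField F (AlgebraicClosure F))) :
        unitBall (⊥ : IntermediateField F (AlgebraicClosure F)) →+*
          unitBall (⊥ : IntermediateField F (AlgebraicClosure F))) :
        unitBall (⊥ : IntermediateField F (AlgebraicClosure F)) →
          unitBall (⊥ : IntermediateField F (AlgebraicClosure F)))^[K] x = x := by
  apply Subtype.ext
  apply Subtype.ext
  rw [LocalUntwistK3G41.coe_frobUnitBall_iterate]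
  obtain ⟨a, ha⟩ := IntermediateField.mem_bot.mp (x : (⊥ : IntermediateField F (AlgebraicClosure F))).2
  rw [← ha, absoluteGaloisGroup.smul_def, AlgEquiv.commutes]

/-- `σ_v` acts on `𝒪_⊥` as `φ^K` for EVERY `K` (both are the identity there). -/
theorem actsAsFrobPow_bot (σ₀ : absoluteGaloisGroup F) (m K : ℕ) (v : 𝒪[F]ˣ) :
    LocalUntwistK3G41.ActsAsFrobPow (⊥ : IntermediateField F (AlgebraicClosure F)) σ₀ K
      (relGalOfUnit hπ (⊥ : IntermediateField F (AlgebraicClosure F)) m bot_le v) := fun x => by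
  rw [frobUnitBall_iterate_bot]
  exact relGalOfUnit_apply_inclusion hπ (⊥ : IntermediateField F (AlgebraicClosure F)) m bot_le v _

/-- ★ B68: over `F` itself (`E = ⊥`) the local untwist is `σ_v` for every exponent `K` — `σ₀` enters `σ_loc` only
through `σ₀|_E`. -/
theorem localUntwist_bot (σ₀ : absoluteGaloisGroup F) (m K : ℕ) (v : 𝒪[F]ˣ) :
    LocalUntwistK3G41.localUntwist hπ (⊥ : IntermediateField F (AlgebraicClosure F)) bot_le σ₀ m K v =
      relGalOfUnit hπ (⊥ : IntermediateField F (AlgebraicClosure F)) m bot_le v :=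
  (LocalUntwistK3G41.eq_localUntwist hπ (⊥ : IntermediateField F (AlgebraicClosure F)) bot_le σ₀ v
    (actsAsFrobPow_bot hπ σ₀ m K v) rfl).symm

end Junction

/-! ### R222 «SHIFT₂», FIELD SIDE — it IS the tree's `coe_evalPt₁_compSeriesC_reflect` -/

section ShiftTwo

open ValuativeRel IsLocalRing Field
open Literature.NumberTheory.GaloisRepresentations Literature.NumberTheory.GaloisRepresentations.IsNonarchimedeanLocalField
  Literature.NumberTheory.GaloisRepresentations.LubinTate Literature.NumberTheory.PAdicHodge

variable {F : Type} [Field F] [ValuativeRel F] [TopologicalSpace F] [IsNonarchimedeanLocalField F]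
variable (hq : residueFieldCard F = 2) (h2 : (valuation F).IsUniformizer (((2 : ℕ) : 𝒪[F]) : F))
  {σ₀ : absoluteGaloisGroup F} (hσ₀ : IsAbsArithFrob σ₀) (u : 𝒪[F]ˣ)
  {ε : (maxUnramifiedCompletion F)ˣ}
  (hε : maxUnramifiedCompletion.galAut F σ₀ (ε : maxUnramifiedCompletion F) =
    algebraMap 𝒪[F] (maxUnramifiedCompletion F) (u : 𝒪[F]) * (ε : maxUnramifiedCompletion F))

include h2 in
/-- The `2`-power torsion points `ζ^j − 1` of `Ĝ_m` lie in `𝔪_ℂ`. -/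
theorem exists_pt_coe_eq_pow_sub_one {ζ : CompletedAlgClosure F} {n : ℕ} (hζ : ζ ^ 2 ^ n = 1) (j : ℕ) :
    ∃ x : (maxNilIdealC F).toIdeal, ((x : CBall F) : CompletedAlgClosure F) = ζ ^ j - 1 :=
  exists_pt_coe_eq (norm_sub_one_lt_one_of_pow_two_pow_eq_one (n := n) (norm_two_lt_one_C h2)
    (by rw [← pow_mul, mul_comm, pow_mul, hζ, one_pow]))

include hq in
/-- ★ **R222 SHIFT₂ (field side) CLOSED**: for a primitive `2^{n+1}`-th root of unity `ζ ∈ ℂ_F` and torsion points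
`x = ζ^j − 1`, `x' = ζ^{j+2^n} − 1` of `𝔪_ℂ`: `ϑ(x') = −π' − ϑ(x)` (`= ϑ(x) [+]_{f'} ω₁'`, `ω₁' = ϑ(−2) = −π'`, `π' = 2u`). -/
theorem shift₂ {ζ : CompletedAlgClosure F} {n : ℕ} (hζ : IsPrimitiveRoot ζ (2 ^ (n + 1))) (j : ℕ)
    (x x' : (maxNilIdealC F).toIdeal) (hx : ((x : CBall F) : CompletedAlgClosure F) = ζ ^ j - 1)
    (hx' : ((x' : CBall F) : CompletedAlgClosure F) = ζ ^ (j + 2 ^ n) - 1) :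
    (((evalPt₁ (maxNilIdealC F) (compSeriesC h2 hσ₀ u hε) (constantCoeff_compSeriesC h2 hσ₀ u hε) x' :
        (maxNilIdealC F).toIdeal) : CBall F) : CompletedAlgClosure F) =
      -algebraMap F (CompletedAlgClosure F) ((((u : 𝒪[F]) * ((2 : ℕ) : 𝒪[F]) : 𝒪[F]) : F)) -
        (((evalPt₁ (maxNilIdealC F) (compSeriesC h2 hσ₀ u hε) (constantCoeff_compSeriesC h2 hσ₀ u hε) x :
          (maxNilIdealC F).toIdeal) : CBall F) : CompletedAlgClosure F) :=
  coe_evalPt₁_compSeriesC_reflect hq h2 hσ₀ u hε x x'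
    (by rw [hx', hx, LocalUntwistK3G41.Shift.pow_add_two_pow_sub_one hζ j])

include hq in
/-- The same with the torsion points PRODUCED (no point hypotheses left). -/
theorem exists_shift₂ {ζ : CompletedAlgClosure F} {n : ℕ} (hζ : IsPrimitiveRoot ζ (2 ^ (n + 1))) (j : ℕ) :
    ∃ x x' : (maxNilIdealC F).toIdeal,
      ((x : CBall F) : CompletedAlgClosure F) = ζ ^ j - 1 ∧
      ((x' : CBall F) : CompletedAlgClosure F) = ζ ^ (j + 2 ^ n) - 1 ∧
      (((evalPt₁ (maxNilIdealC F) (compSeriesC h2 hσ₀ u hε) (constantCoeff_compSeriesC h2 hσ₀ u hε) x' :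
          (maxNilIdealC F).toIdeal) : CBall F) : CompletedAlgClosure F) =
        -algebraMap F (CompletedAlgClosure F) ((((u : 𝒪[F]) * ((2 : ℕ) : 𝒪[F]) : 𝒪[F]) : F)) -
          (((evalPt₁ (maxNilIdealC F) (compSeriesC h2 hσ₀ u hε) (constantCoeff_compSeriesC h2 hσ₀ u hε) x :
            (maxNilIdealC F).toIdeal) : CBall F) : CompletedAlgClosure F) := by
  obtain ⟨x, hx⟩ := exists_pt_coe_eq_pow_sub_one h2 hζ.pow_eq_one j
  obtain ⟨x', hx'⟩ := exists_pt_coe_eq_pow_sub_one h2 hζ.pow_eq_one (j + 2 ^ n)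
  exact ⟨x, x', hx, hx', shift₂ hq h2 hσ₀ u hε hζ j x x' hx hx'⟩

end ShiftTwo

/-! ### R222 «SHIFT₂», INDEX SIDE — `hshift` of `read₂_of_refl_cut` at `Γ := (ZMod 2^{n+1})ˣ`, `γ₀ := 1 + 2^n` -/

section IndexSide

/-- A unit of `ZMod 2^{n+1}` has odd `val`. -/
theorem odd_val_of_unit {n : ℕ} (γ : (ZMod (2 ^ (n + 1)))ˣ) : Odd (γ : ZMod (2 ^ (n + 1))).val := by
  rcases Nat.even_or_odd (γ : ZMod (2 ^ (n + 1))).val with h | h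
  · exfalso
    have hcop := ZMod.val_coe_unit_coprime γ
    have h2 : 2 ∣ Nat.gcd (γ : ZMod (2 ^ (n + 1))).val (2 ^ (n + 1)) :=
      Nat.dvd_gcd (even_iff_two_dvd.mp h) (dvd_pow_self 2 (Nat.succ_ne_zero n))
    rw [hcop] at h2
    exact absurd h2 (by norm_num)
  · exact h

/-- `γ·γ₀ = γ + 2^n` in `ZMod 2^{n+1}` for every unit `γ` (k3-g41's `odd_mul_gamma0_zmod` on units). -/
theorem units_mul_gamma0 {n : ℕ} (γ : (ZMod (2 ^ (n + 1)))ˣ) :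
    (γ : ZMod (2 ^ (n + 1))) * (1 + 2 ^ n) = (γ : ZMod (2 ^ (n + 1))) + 2 ^ n := by
  have h := LocalUntwistK3G41.Shift.odd_mul_gamma0_zmod (n := n) (odd_val_of_unit γ)
  rwa [ZMod.natCast_zmod_val] at h

/-- `γ₀ = 1 + 2^n` is a unit of `ZMod 2^{n+1}` (it is odd for `n ≥ 1`; at `n = 0` it is `0 = … `— so we ask `1 ≤ n`). -/
theorem coprime_gamma0 {n : ℕ} (hn : 1 ≤ n) : Nat.Coprime (1 + 2 ^ n) (2 ^ (n + 1)) := by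
  apply Nat.Coprime.pow_right
  obtain ⟨k, rfl⟩ := Nat.exists_eq_add_of_le hn
  rw [Nat.coprime_two_right, Nat.odd_iff]
  have : (1 + 2 ^ (1 + k)) = 2 * 2 ^ k + 1 := by ring
  omega

/-- ★ `hshift` of k3-g40's `read₂_of_refl_cut` at the instance of record: `Γ := (ZMod 2^{n+1})ˣ`, `e := Equiv.refl`,
`γ₀ := 1 + 2^n` (as a unit), `s := 2^n`. -/
theorem hshift_units {n : ℕ} (hn : 1 ≤ n) (γ : (ZMod (2 ^ (n + 1)))ˣ) :
    (((Equiv.refl (ZMod (2 ^ (n + 1)))ˣ) (γ * ZMod.unitOfCoprime (1 + 2 ^ n) (coprime_gamma0 hn)) :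
        (ZMod (2 ^ (n + 1)))ˣ) : ZMod (2 ^ (n + 1))) =
      ((Equiv.refl (ZMod (2 ^ (n + 1)))ˣ) γ : ZMod (2 ^ (n + 1))) + 2 ^ n := by
  rw [Equiv.refl_apply, Equiv.refl_apply, Units.val_mul, ZMod.coe_unitOfCoprime, Nat.cast_add, Nat.cast_one,
    Nat.cast_pow, Nat.cast_two]
  exact units_mul_gamma0 γ

/-- `γ₀² = 1` as units. -/
theorem gamma0_unit_sq {n : ℕ} (hn : 1 ≤ n) :
    (ZMod.unitOfCoprime (1 + 2 ^ n) (coprime_gamma0 hn) : (ZMod (2 ^ (n + 1)))ˣ) ^ 2 = 1 := by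
  apply Units.ext
  rw [Units.val_pow_eq_pow_val, ZMod.coe_unitOfCoprime, Nat.cast_add, Nat.cast_one, Nat.cast_pow, Nat.cast_two,
    Units.val_one]
  exact LocalUntwistK3G41.Shift.gamma0_sq hn

/-- ★ B72 on characters: for any group homomorphism `χ : (ZMod 2^{n+1})ˣ →* Rˣ` into a domain, `χ(γ₀) = −1` as soon as
`χ(γ₀) ≠ 1` (which is «conductor exactly `2^{n+1}`», since `ker((ℤ/2^{n+1})ˣ → (ℤ/2^n)ˣ) = {1, γ₀}`). -/
theorem unitsChar_gamma0_eq_neg_one {R : Type*} [CommRing R] [NoZeroDivisors R] {n : ℕ} (hn : 1 ≤ n)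
    (χ : (ZMod (2 ^ (n + 1)))ˣ →* Rˣ)
    (hne : χ (ZMod.unitOfCoprime (1 + 2 ^ n) (coprime_gamma0 hn)) ≠ 1) :
    ((χ (ZMod.unitOfCoprime (1 + 2 ^ n) (coprime_gamma0 hn)) : Rˣ) : R) = -1 := by
  have hsq : ((χ (ZMod.unitOfCoprime (1 + 2 ^ n) (coprime_gamma0 hn)) : Rˣ) : R) *
      ((χ (ZMod.unitOfCoprime (1 + 2 ^ n) (coprime_gamma0 hn)) : Rˣ) : R) = 1 := by
    rw [← Units.val_mul, ← map_mul, ← sq, gamma0_unit_sq hn, map_one, Units.val_one]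
  rcases mul_self_eq_one_iff.mp hsq with h | h
  · exact absurd (Units.ext h) hne
  · exact h

end IndexSide

end Summit.BirchSwinnertonDyer.BirchSwinnertonDyer.Cruxes.SplitBadTwoLowerHalfOfFacts.CriticG42


/-! # PART D — the row-117 certificate `critic_k3g40_K3_reflsum.lean` (stub-critic g41, crux commit 289ad55008c9, sha16 c85c8fc2ad323e66) VERBATIM minus its `import` line -/


/-!
# §CRITIC (stub-critic g41, 2026-08-29) — K3 «CONSUMER HOOK» of card k3-g40 RESOLVED IN KERNEL

Card k3-g40 (`ReadTwoCutK3G40.read₂_of_refl_cut`) delivers k3-g38's `RamifiedReading` with the REFL unit table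
`ℓ γ = κ·(T γ − T (γ·γ₀))`, `κ = (2Θε)⁻¹`, where `γ₀ ∈ Γ ≃ (ℤ/2^{n+1})ˣ` is the index shift `j ↦ j + 2^n`
(`ζ^{j+2^n} = −ζ^j`), i.e. `γ₀ ↔ 1 + 2^n` (order two for `n ≥ 1`) — NOT `−1` as the card's K3 prose says.
The consumer `atom_shape` (k3-g38, row 111 RCF) is applied ONLY to characters `χ` that do not factor through
`ℤ/2^n`, i.e. `χ(1 + 2^n) ≠ 1`, hence `χ(1 + 2^n) = −1` (the kernel of `(ℤ/2^{n+1})ˣ → (ℤ/2^n)ˣ` is `{1, 1+2^n}`;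
STUB-PLAN v7.3 §4 (ρ4)).  For every such `χ` the REFL table's character sum is EXACTLY the FROB-normalised one:
`Σ_γ χ(eγ)·κ(Tγ − T(γγ₀)) = 2κ · Σ_γ χ(eγ)·Tγ = Ω⁻¹ · Σ_γ χ(eγ)·Tγ` (`2κ = (Θε)⁻¹ = Ω⁻¹`) — v7.3 (ρ5) in kernel.
So both proved glues of k3-g40 feed `atom_shape` with the same value; no normalisation bug; K3 is not a crux.
BSD is not proved; nothing here touches the stub or the crux. -/

namespace Summit.BirchSwinnertonDyer.BirchSwinnertonDyer.Cruxes.SplitBadTwoLowerHalfOfFacts.CriticG41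

/-- ★ **REFL TABLE CHARACTER SUM.**  `Γ` a finite group, `e : Γ ≃* (ℤ/N)ˣ`, `ψ` a multiplicative character with
`ψ(e γ₀) = −1` for an element `γ₀` of order dividing two: the `ψ`-sum of the reflected table `κ(Tγ − T(γγ₀))` is
`2κ` times the `ψ`-sum of `T`. (Apply with `ψ = χ⁻¹`, `γ₀ ↔ 1 + 2^n`, `κ = (2Θε)⁻¹`.) -/
theorem refl_table_charSum {R' : Type*} [CommRing R'] {N : ℕ} [NeZero N] {Γ : Type*} [Group Γ] [Fintype Γ]
    (e : Γ ≃* (ZMod N)ˣ) (ψ : MulChar (ZMod N) R') (T : Γ → R') (κ : R') (γ₀ : Γ)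
    (hγ₀ : γ₀ * γ₀ = 1) (hψ : ψ ((e γ₀ : (ZMod N)ˣ) : ZMod N) = -1) :
    ∑ γ : Γ, ψ ((e γ : (ZMod N)ˣ) : ZMod N) * (κ * (T γ - T (γ * γ₀))) =
      2 * κ * ∑ γ : Γ, ψ ((e γ : (ZMod N)ˣ) : ZMod N) * T γ := by
  -- reindex the shifted sum by `γ ↦ γ·γ₀` (an involution since `γ₀² = 1`)
  have hre : ∑ γ : Γ, ψ ((e γ : (ZMod N)ˣ) : ZMod N) * T (γ * γ₀) =
      ∑ δ : Γ, ψ ((e (δ * γ₀) : (ZMod N)ˣ) : ZMod N) * T δ := by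
    refine (Fintype.sum_equiv (Equiv.mulRight γ₀)
      (fun δ => ψ ((e (δ * γ₀) : (ZMod N)ˣ) : ZMod N) * T δ)
      (fun γ => ψ ((e γ : (ZMod N)ˣ) : ZMod N) * T (γ * γ₀)) (fun δ => ?_)).symm
    simp only [Equiv.coe_mulRight, mul_assoc, hγ₀, mul_one]
  have hneg : ∀ δ : Γ, ψ ((e (δ * γ₀) : (ZMod N)ˣ) : ZMod N) = -ψ ((e δ : (ZMod N)ˣ) : ZMod N) := by
    intro δ
    rw [map_mul, Units.val_mul, map_mul, hψ, mul_neg, mul_one]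
  have hsplit : ∀ γ : Γ, ψ ((e γ : (ZMod N)ˣ) : ZMod N) * (κ * (T γ - T (γ * γ₀))) =
      κ * (ψ ((e γ : (ZMod N)ˣ) : ZMod N) * T γ) - κ * (ψ ((e γ : (ZMod N)ˣ) : ZMod N) * T (γ * γ₀)) := by
    intro γ; ring
  simp_rw [hsplit]
  rw [Finset.sum_sub_distrib, ← Finset.mul_sum, ← Finset.mul_sum, hre]
  simp_rw [hneg, neg_mul, Finset.sum_neg_distrib]
  ring

/-- With k3-g38's `atom_shape` output `χ⁻¹(−1)·Σ_γ χ⁻¹(eγ)·ℓ γ` and `ℓ = κ(T − T(·γ₀))`: the Gauss-side sum equals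
the FROB-normalised `χ⁻¹(−1)·(2κ)·Σ_γ χ⁻¹(eγ)·T γ`. -/
theorem atom_output_refl_eq_frob {R' : Type*} [CommRing R'] {N : ℕ} [NeZero N] {Γ : Type*} [Group Γ] [Fintype Γ]
    (e : Γ ≃* (ZMod N)ˣ) (χinv : MulChar (ZMod N) R') (T : Γ → R') (κ c₁ : R') (γ₀ : Γ)
    (hγ₀ : γ₀ * γ₀ = 1) (hχ : χinv ((e γ₀ : (ZMod N)ˣ) : ZMod N) = -1) :
    c₁ * ∑ γ : Γ, χinv ((e γ : (ZMod N)ˣ) : ZMod N) * (κ * (T γ - T (γ * γ₀))) =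
      c₁ * (2 * κ) * ∑ γ : Γ, χinv ((e γ : (ZMod N)ˣ) : ZMod N) * T γ := by
  rw [refl_table_charSum e χinv T κ γ₀ hγ₀ hχ]
  ring

/-! ### The shift element at levels `n = 1, 2` (`N = 4, 8`, `M = 2, 4`): `γ₀ = 1 + 2^n` has square `1` and is the
only non-trivial unit `≡ 1 (mod 2^n)` — so a character not factoring through `ℤ/2^n` takes the value `−1` on it
(`χ(γ₀)² = 1`, `χ(γ₀) ≠ 1`, domain). -/

example : ((1 + 2 : ZMod 4)) ^ 2 = 1 := by decide
example : ((1 + 4 : ZMod 8)) ^ 2 = 1 := by decide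
example : ∀ u : ZMod 8, IsUnit u → ZMod.castHom (show 4 ∣ 8 by norm_num) (ZMod 4) u = 1 → u = 1 ∨ u = 5 := by
  decide
example : ∀ u : ZMod 4, IsUnit u → ZMod.castHom (show 2 ∣ 4 by norm_num) (ZMod 2) u = 1 → u = 1 ∨ u = 3 := by
  decide

/-- In a domain, a value with square one that is not one is minus one (the step `χ(γ₀)² = χ(γ₀²) = 1 ⟹ χ(γ₀) = −1`). -/
theorem eq_neg_one_of_sq_eq_one {R' : Type*} [CommRing R'] [IsDomain R'] {x : R'} (hx : x ^ 2 = 1) (h1 : x ≠ 1) :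
    x = -1 := by
  have h : (x - 1) * (x + 1) = 0 := by ring_nf; rw [hx]; ring
  rcases mul_eq_zero.mp h with h | h
  · exact absurd (sub_eq_zero.mp h) h1
  · exact eq_neg_of_add_eq_zero_left h

/-- ★ `χ(γ₀) = −1` for every character non-trivial on an element of order dividing two (domain coefficients) —
the hypothesis `hχu : χ u ≠ 1` of k3-g38's `atom_shape` with `u = 1 + 2^n`. -/
theorem mulChar_eq_neg_one_of_sq {R' : Type*} [CommRing R'] [IsDomain R'] {N : ℕ} [NeZero N]
    (χ : MulChar (ZMod N) R') (u : (ZMod N)ˣ) (hu : u * u = 1) (hχu : χ (u : ZMod N) ≠ 1) :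
    χ (u : ZMod N) = -1 := by
  refine eq_neg_one_of_sq_eq_one ?_ hχu
  rw [sq, ← map_mul, ← Units.val_mul, hu, Units.val_one, map_one]

end Summit.BirchSwinnertonDyer.BirchSwinnertonDyer.Cruxes.SplitBadTwoLowerHalfOfFacts.CriticG41


/-! # PART E — card k2-g41's sketch `STUB_IDEAS_stub_heegnerIndexLowerAtTwo_2_g41.lean` (sha16 cd4b39d39d1ff210, 537 lines) VERBATIM minus its `import` lines -/

/-
  stub-ideation k = 2 (g41) · technique «literature transfer (recent-theorem-open-question harvest; typed
  dictionary)» · crux `SplitBadTwoLowerHalfOfFacts` (stmt-BirchSwinnertonDyer-27851) · stub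
  `stub_heegnerIndexLowerAtTwo` (skeleton f2bd84c029a8a938, LEAD cf2-p1 g8 v3).

  NOTHING HERE PROVES BSD, THE CRUX, OR THE STUB.  What this file proves: the CONTEXT-FREE leaves of road B′'s
  residual R219-INST₂ «READ₂ instantiated» (STUB-PLAN v7.4 §HARDEST; CRITIC-ROWS-g41 rows 116–118 + k3-g41) are
  library lemmas in disguise and are closed here in kernel by a typed dictionary onto Mathlib / tree declarations,
  so that R219-INST₂'s residue is purely witness-specific instantiation glue (the `∘ϑ` line, `V = L_b + const`,
  SEAM on units, one `read₂_of_refl_cut`):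

  §C  «γ₀-CHARACTER» (B72 character half, ALL n ≥ 1; the critic `decide`d N = 4, 8): a character mod 2^{n+1}
      not factoring through 2^n is −1 at γ₀ = 1 + 2^n  [`apply_one_add_two_pow_eq_neg_one`;
      kernel of (ℤ/2^{n+1})ˣ → (ℤ/2^n)ˣ = {1, γ₀}: `mem_ker_unitsMap_iff`].
  §D  «H3 Λ₂-LIFT» (k3-g40 P3, hypothesis objects `hL0`/`hL` of its `read_value_eq_tsum_lamTerm`): the
      coefficients (−1)^d 2^d/(d+1) of Λ₂ = ½ log(1+2X) are INTEGRAL in any ultrametric field with ‖2‖ < 1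
      [`norm_two_pow_div_le_one`], hence `∃ L ∈ 𝒪_{ℂ_F}⟦X⟧` [`exists_Lam2_lift`, `exists_Lam2_lift_map`,
      `map_coeff_Lam2C`]; dictionary: Koblitz GTM 58 IV.1 / Washington GTM 83 §5.1 "p^d/(d+1) ∈ ℤ_p".
  §E  «H1 HALF-LIFT» (k3-g40 P3): P ≡ 1 (mod a) coefficientwise, P(0) = 1 ⇒ P = 1 + C a · y, y(0) = 0
      [`exists_eq_one_add_C_mul`].
  §B  R222 «SHIFT₂» in the `evS` currency of R219-INST₂ — a 3-line corollary of the TREE theorem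
      `coe_evalPt₁_compSeriesC_reflect` (located independently by k3-g41, who has priority for the location and
      the additive index identities); here: `evS_compSeriesC_shift(_negTwo)` + the multiplicative index identity
      `ζ^{j(1+2^n)} − 1 = −2 − (ζ^j − 1)` (j odd).
  §A  APPENDIX, NOT CLAIMED (k3-g41 filed `LocalUntwistExists` = R217∃ first, 22:09Z): an independent 45-line
      proof of the same verbatim statement straight from ★★ `exists_absGal_fixing_smul_ltRoot_eq` — kept only as
      a port-size cross-check (k3-g41's U1/U2/U3 cut is the version of record).
  §F  degenerate-instance checks (B68).
-/

noncomputable section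

set_option linter.dupNamespace false

namespace Summit.BirchSwinnertonDyer.BirchSwinnertonDyer.Cruxes.SplitBadTwoLowerHalfOfFacts.DisjointShiftK2G41

/-! ## §A (APPENDIX, not claimed — k3-g41 has priority). R217∃ «LOCAL-UNTWIST₂, existence half»: an independent short proof
of the verbatim `LocalUntwistExists` straight from ★★ `exists_absGal_fixing_smul_ltRoot_eq`. -/

section LocalUntwist

open ValuativeRel IsLocalRing Field
open Literature.NumberTheory.GaloisRepresentations Literature.NumberTheory.GaloisRepresentations.IsNonarchimedeanLocalField
  Literature.NumberTheory.GaloisRepresentations.LubinTate Literature.NumberTheory.PAdicHodge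

variable {F : Type} [Field F] [ValuativeRel F] [TopologicalSpace F] [IsNonarchimedeanLocalField F]

attribute [local instance] ltNormUniformSpace ltNormIsUniformAddGroup rk1 nF nE fintypeResidueField

variable {π : 𝒪[F]} (hπ : (valuation F).IsUniformizer (π : F))
variable (E : IntermediateField F (AlgebraicClosure F)) [FiniteDimensional F E] [Normal F E]

/-- VERBATIM k3-g40 (`ReadTwoCutK3G40.ActsAsFrobPow`): "`τ ∈ Aut_F(E·K_π^{m+1})` acts on `𝒪_E` as `φ^K`"
(`φ = frobUnitBall E σ₀`; `K` is NOT tied to the level). -/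
def ActsAsFrobPow (σ₀ : absoluteGaloisGroup F) (K : ℕ) {m : ℕ}
    (τ : (E ⊔ ltField π m : IntermediateField F (AlgebraicClosure F)) ≃ₐ[F]
      (E ⊔ ltField π m : IntermediateField F (AlgebraicClosure F))) : Prop :=
  ∀ x : unitBall E, τ (IntermediateField.inclusion le_sup_left (x : E)) =
    IntermediateField.inclusion le_sup_left
      (((((frobUnitBall E σ₀ : unitBall E ≃+* unitBall E) : unitBall E →+* unitBall E) :
        unitBall E → unitBall E)^[K] x : unitBall E) : E)

/-- VERBATIM k3-g40 (`ReadTwoCutK3G40.LocalUntwistExists`) = v7.4 **R217∃**: for every level `m`, Frobenius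
exponent `K` and unit `v ∈ 𝒪_F^×` there is `τ ∈ Aut_F(E·K_π^{m+1})` acting on `𝒪_E` as `φ^K` and moving
`ι ω_{m+1}` exactly as `σ_v = relGalOfUnit v` does. -/
def LocalUntwistExists (hE : E ≤ maxUnramified F) (σ₀ : absoluteGaloisGroup F) : Prop :=
  ∀ (m K : ℕ) (v : 𝒪[F]ˣ), ∃ τ : (E ⊔ ltField π m : IntermediateField F (AlgebraicClosure F)) ≃ₐ[F]
      (E ⊔ ltField π m : IntermediateField F (AlgebraicClosure F)),
    ActsAsFrobPow E σ₀ K τ ∧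
      mapPt τ (inclPt (le_sup_right : ltField π m ≤ E ⊔ ltField π m) (cohPt hπ m)) =
        mapPt (relGalOfUnit hπ E m hE v) (inclPt (le_sup_right : ltField π m ≤ E ⊔ ltField π m) (cohPt hπ m))

omit [ValuativeRel F] [TopologicalSpace F] [IsNonarchimedeanLocalField F] [FiniteDimensional F E] in
/-- H-A1 (dictionary line "φ^K = σ₀^K|_E"): powers of the restricted automorphism act as powers of `σ₀`. -/
theorem coe_restrictNormal_pow_apply (σ₀ : absoluteGaloisGroup F) (k : ℕ) (x : E) :
    (((((absoluteGaloisGroup.toAlgEquiv F σ₀).restrictNormal E) ^ k) x : E) : AlgebraicClosure F) =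
      (σ₀ ^ k) • ((x : E) : AlgebraicClosure F) := by
  induction k generalizing x with
  | zero => rw [pow_zero, pow_zero, AlgEquiv.one_apply, one_smul]
  | succ k ih => rw [pow_succ, AlgEquiv.mul_apply, ih, coe_restrictNormal_apply, pow_succ, mul_smul]

/-- H-A2: the `K`-fold iterate of `φ = frobUnitBall E σ₀` on `𝒪_E`, read in `F̄`, is `σ₀^K`. -/
theorem coe_frobUnitBall_iterate (σ₀ : absoluteGaloisGroup F) (K : ℕ) (x : unitBall E) :
    (((((((frobUnitBall E σ₀ : unitBall E ≃+* unitBall E) : unitBall E →+* unitBall E) :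
        unitBall E → unitBall E)^[K] x : unitBall E) : E) : AlgebraicClosure F)) =
      (σ₀ ^ K) • (((x : unitBall E) : E) : AlgebraicClosure F) := by
  rw [← RingHom.coe_pow, coe_frobUnitBall_pow_apply, coe_restrictNormal_pow_apply]

/-- H-A3 (dictionary line "σ' λ_{m+1} = [w] λ_{m+1} ⟹ χ_π(σ') ≡ w (mod π^{m+1})"): the Lubin–Tate character of an
element realising the unit `w` on `λ_{m+1}` is congruent to `w`. -/
theorem pow_dvd_lubinTateChar_sub_of_smul_ltRoot_eq (m : ℕ) (w : 𝒪[F]ˣ) {σ : absoluteGaloisGroup F}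
    (hσ : σ • ltRoot π m =
      (((ltAct hπ m (w : 𝒪[F]) (genPt hπ m) : unitBall (ltField π m)) : ltField π m) : AlgebraicClosure F)) :
    π ^ (m + 1) ∣ (lubinTateChar hπ σ : 𝒪[F]) - (w : 𝒪[F]) := by
  rw [← ltAct_genPt_eq_iff hπ]
  have h1 := (absGal_smul_ltRoot hπ σ m).symm.trans hσ
  apply Subtype.ext; apply Subtype.ext
  exact Subtype.val_injective h1

/-- ★ **R217∃ PROVED**: `LocalUntwistExists` holds for every `E ⊆ F^{nr}` finite normal and every `σ₀ ∈ Γ_F`.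
Witness: `τ := relRestrict (σ₀^K · σ')` with `σ' ∈ Gal(F̄/E)` realising `v · χ_π(σ₀)^{-K}` on `λ_{m+1}`
(`exists_absGal_fixing_smul_ltRoot_eq`, the tree's Galois form of `E ∩ K_π^{m+1} = F`). -/
theorem localUntwistExists (hE : E ≤ maxUnramified F) (σ₀ : absoluteGaloisGroup F) :
    LocalUntwistExists hπ E hE σ₀ := by
  intro m K v
  obtain ⟨σ', hσ'E, hσ'l⟩ :=
    exists_absGal_fixing_smul_ltRoot_eq hπ E hE m (v * ((lubinTateChar hπ σ₀) ^ K)⁻¹)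
  refine ⟨relRestrict hπ E m (σ₀ ^ K * σ'), fun x => ?_, ?_⟩
  · -- on `𝒪_E`: `σ'` fixes `E`, `σ₀^K` acts as `φ^K`
    apply Subtype.ext
    rw [coe_relRestrict_apply, IntermediateField.coe_inclusion, IntermediateField.coe_inclusion, mul_smul, hσ'E,
      coe_frobUnitBall_iterate]
  · -- on the torsion point: both sides are `[v · cohUnit] λ'`
    rw [cohPt_eq, inclPt_ltAct_genPt, mapPt_relRestrict_relAct, mapPt_relGalOfUnit_relAct, relAct_relGenPt_eq_iff,
      lubinTateChar_mul]
    have hK : lubinTateChar hπ (σ₀ ^ K) = (lubinTateChar hπ σ₀) ^ K := map_pow (lubinTateCharHom hπ) σ₀ K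
    rw [hK]
    obtain ⟨c, hc⟩ := pow_dvd_lubinTateChar_sub_of_smul_ltRoot_eq hπ m _ hσ'l
    have hunit : (((lubinTateChar hπ σ₀) ^ K : 𝒪[F]ˣ) : 𝒪[F]) *
        ((v * ((lubinTateChar hπ σ₀) ^ K)⁻¹ : 𝒪[F]ˣ) : 𝒪[F]) = (v : 𝒪[F]) := by
      rw [← Units.val_mul, mul_left_comm, mul_inv_cancel, mul_one]
    rw [Units.val_mul]
    exact ⟨(((lubinTateChar hπ σ₀) ^ K : 𝒪[F]ˣ) : 𝒪[F]) * (cohUnit hπ m : 𝒪[F]) * c, by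
      linear_combination ((((lubinTateChar hπ σ₀) ^ K : 𝒪[F]ˣ) : 𝒪[F]) * (cohUnit hπ m : 𝒪[F])) * hc +
        (cohUnit hπ m : 𝒪[F]) * hunit⟩

end LocalUntwist

/-! ## §B. R222 «SHIFT₂» — the torsion dictionary `ϑ(−2 − x) = −π' − ϑ(x)` in the `evS` currency, and the index
identity `ζ^{j(1+2^n)} = −ζ^j` for odd `j` (B72: the REFL shift is multiplication by `γ₀ = 1 + 2^n`) -/

section ShiftTwo

open ValuativeRel IsLocalRing Field IsNonarchimedeanLocalField
open Literature.NumberTheory.GaloisRepresentations Literature.NumberTheory.GaloisRepresentations.IsNonarchimedeanLocalField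
  Literature.NumberTheory.GaloisRepresentations.LubinTate Literature.NumberTheory.PAdicHodge

variable {F : Type} [Field F] [ValuativeRel F] [TopologicalSpace F] [IsNonarchimedeanLocalField F]
variable (hq : residueFieldCard F = 2) (h2 : (valuation F).IsUniformizer (((2 : ℕ) : 𝒪[F]) : F))
  {σ₀ : absoluteGaloisGroup F} (hσ₀ : IsAbsArithFrob σ₀) (u : 𝒪[F]ˣ)
  {ε : (maxUnramifiedCompletion F)ˣ}
  (hε : maxUnramifiedCompletion.galAut F σ₀ (ε : maxUnramifiedCompletion F) =
    algebraMap 𝒪[F] (maxUnramifiedCompletion F) (u : 𝒪[F]) * (ε : maxUnramifiedCompletion F))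

include hq in
/-- ★ **R222 «SHIFT₂» (k3-g40's H2 `compSeriesC_torsion_shift`) PROVED in the `evS` currency of R219-INST₂**:
for points `z, z'` of `𝔪_ℂ` with `1 + z' = −(1 + z)` (i.e. `z' = z [+]_{Ĝ_m} (−2)`),
`ϑ(z') = −π' − ϑ(z) = ϑ(z) [+]_{f'} ω₁'` with `ω₁' = −π' = ϑ(−2)` (`f' = π'X + X²`, `π' = 2u`;
`y [+]_{f'} (−π') = −π' − y`).  Dictionary: de Shalit I.3.3 (7)–(7′) `θ(ς(1+S) − 1) = θ(S) [+] ω`, `ς = −1`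
↦ tree ★★ `coe_evalPt₁_compSeriesC_reflect` + `evalPt₁_compSeriesC_eq_mk_evS`. -/
theorem evS_compSeriesC_shift (z z' : (maxNilIdealC F).toIdeal)
    (hz' : ((z' : CBall F) : CompletedAlgClosure F) = -2 - ((z : CBall F) : CompletedAlgClosure F)) :
    ((evS (maxNilIdealC F) z' ((compSeriesC h2 hσ₀ u hε).map (algebraMap (UnrCoeff F) (CBall F))) : CBall F) :
        CompletedAlgClosure F) =
      -algebraMap F (CompletedAlgClosure F) ((((u : 𝒪[F]) * ((2 : ℕ) : 𝒪[F]) : 𝒪[F]) : F)) -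
        ((evS (maxNilIdealC F) z ((compSeriesC h2 hσ₀ u hε).map (algebraMap (UnrCoeff F) (CBall F))) : CBall F) :
          CompletedAlgClosure F) := by
  have h := coe_evalPt₁_compSeriesC_reflect hq h2 hσ₀ u hε z z' hz'
  rw [evalPt₁_compSeriesC_eq_mk_evS hσ₀ u hε h2 z', evalPt₁_compSeriesC_eq_mk_evS hσ₀ u hε h2 z] at h
  exact h

include hq in
/-- R222, point form with the torsion point NAMED: for the point `t = −2` of `𝔪_ℂ` (`ϑ(t) = −π' = ω₁'`, tree
`coe_evalPt₁_compSeriesC_negTwo`), `ϑ(z') = ϑ(t) − ϑ(z)` whenever `z' = −2 − z`. -/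
theorem evS_compSeriesC_shift_negTwo (t z z' : (maxNilIdealC F).toIdeal)
    (ht : ((t : CBall F) : CompletedAlgClosure F) = -2)
    (hz' : ((z' : CBall F) : CompletedAlgClosure F) = -2 - ((z : CBall F) : CompletedAlgClosure F)) :
    ((evS (maxNilIdealC F) z' ((compSeriesC h2 hσ₀ u hε).map (algebraMap (UnrCoeff F) (CBall F))) : CBall F) :
        CompletedAlgClosure F) =
      ((evS (maxNilIdealC F) t ((compSeriesC h2 hσ₀ u hε).map (algebraMap (UnrCoeff F) (CBall F))) : CBall F) :
          CompletedAlgClosure F) -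
        ((evS (maxNilIdealC F) z ((compSeriesC h2 hσ₀ u hε).map (algebraMap (UnrCoeff F) (CBall F))) : CBall F) :
          CompletedAlgClosure F) := by
  have ht' := coe_evalPt₁_compSeriesC_negTwo hq h2 hσ₀ u hε t ht
  rw [evalPt₁_compSeriesC_eq_mk_evS hσ₀ u hε h2 t] at ht'
  rw [evS_compSeriesC_shift hq h2 hσ₀ u hε z z' hz']
  change _ = ((evS (maxNilIdealC F) t ((compSeriesC h2 hσ₀ u hε).map (algebraMap (UnrCoeff F) (CBall F))) :
    CBall F) : CompletedAlgClosure F) - _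
  rw [show ((evS (maxNilIdealC F) t ((compSeriesC h2 hσ₀ u hε).map (algebraMap (UnrCoeff F) (CBall F))) :
    CBall F) : CompletedAlgClosure F) = -algebraMap F (CompletedAlgClosure F)
      ((((u : 𝒪[F]) * ((2 : ℕ) : 𝒪[F]) : 𝒪[F]) : F)) from ht']

end ShiftTwo

section IndexShift

/-- ★ B72 in kernel, general `n`: for `ζ` of exact order `2^{n+1}` in a domain and `j` odd,
`ζ^{j(1+2^n)} = −ζ^j` — the REFL shift `j ↦ j·γ₀`, `γ₀ = 1 + 2^n`, is `ζ^j ↦ −ζ^j`, i.e. `1 + z ↦ −(1 + z)` on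
`z_j = ζ^j − 1`. -/
theorem pow_mul_one_add_two_pow_eq_neg {R : Type*} [CommRing R] [IsDomain R] {n : ℕ} {ζ : R}
    (hζ : IsPrimitiveRoot ζ (2 ^ (n + 1))) {j : ℕ} (hj : Odd j) :
    ζ ^ (j * (1 + 2 ^ n)) = -ζ ^ j := by
  have h1 : ζ ^ 2 ^ n = -1 :=
    (hζ.pow (by positivity) (show 2 ^ (n + 1) = 2 ^ n * 2 by rw [pow_succ])).eq_neg_one_of_two_right
  rw [mul_add, mul_one, pow_add, pow_mul', h1, hj.neg_one_pow]
  ring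

/-- Hence the torsion points `z_j := ζ^j − 1` satisfy the hypothesis of `evS_compSeriesC_shift`:
`z_{jγ₀} = −2 − z_j`. -/
theorem torsionPt_index_shift {R : Type*} [CommRing R] [IsDomain R] {n : ℕ} {ζ : R}
    (hζ : IsPrimitiveRoot ζ (2 ^ (n + 1))) {j : ℕ} (hj : Odd j) :
    ζ ^ (j * (1 + 2 ^ n)) - 1 = -2 - (ζ ^ j - 1) := by
  rw [pow_mul_one_add_two_pow_eq_neg hζ hj]; ring

/-- `γ₀ = 1 + 2^n` is an involution of `ℤ/2^{n+1}` for `n ≥ 1` (`(1+2^n)² = 1 + 2^{n+1} + 2^{2n}`). -/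
theorem one_add_two_pow_sq {n : ℕ} (hn : 1 ≤ n) : ((1 + 2 ^ n : ZMod (2 ^ (n + 1)))) ^ 2 = 1 := by
  have h : ((2 ^ (n + 1) : ℕ) : ZMod (2 ^ (n + 1))) = 0 := ZMod.natCast_self _
  obtain ⟨k, rfl⟩ : ∃ k, n = k + 1 := ⟨n - 1, by omega⟩
  have e : ((1 + 2 ^ (k + 1) : ZMod (2 ^ (k + 1 + 1)))) ^ 2 =
      1 + ((2 ^ (k + 1 + 1) : ℕ) : ZMod (2 ^ (k + 1 + 1))) * (1 + 2 ^ k) := by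
    push_cast; ring
  rw [e, h, zero_mul, add_zero]

end IndexShift

/-! ## §C. R219-INST₂ leaf «γ₀-CHARACTER» (B72, character half, GENERAL `n`): a Dirichlet character modulo
`2^{n+1}` that does not factor through `2^n` takes the value `−1` at `γ₀ = 1 + 2^n` — Mathlib match
(`DirichletCharacter.factorsThrough_iff_ker_unitsMap` + `#ker = 2` by `ZMod.card_units_eq_totient`). The critic's
certificate `critic_k3g40_K3_reflsum.lean` decided `N = 4, 8`; this is the all-`n` kernel lemma. -/

section GammaZeroChar

/-- `#ker((ℤ/2^{n+1})ˣ → (ℤ/2^n)ˣ) = 2` for `n ≥ 1` (index of a surjection, `φ(2^{n+1}) = 2·φ(2^n)`; pattern of the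
tree's private `CyclotomicFermatCMTypes….card_ker_unitsMap`, here at the prime `2`). -/
theorem card_ker_unitsMap_two_pow {n : ℕ} (hn : 1 ≤ n) :
    Nat.card (ZMod.unitsMap (pow_dvd_pow 2 (Nat.le_succ n))).ker = 2 := by
  set f := ZMod.unitsMap (pow_dvd_pow 2 (Nat.le_succ n)) with hf
  have hsurj : Function.Surjective f := ZMod.unitsMap_surjective _
  have h1 : f.ker.index = Nat.card (ZMod (2 ^ n))ˣ := by
    rw [Subgroup.index_ker, MonoidHom.range_eq_top_of_surjective f hsurj, Subgroup.card_top]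
  have h2 := f.ker.card_mul_index
  rw [h1, Nat.card_eq_fintype_card (α := (ZMod (2 ^ n))ˣ),
    Nat.card_eq_fintype_card (α := (ZMod (2 ^ (n + 1)))ˣ), ZMod.card_units_eq_totient,
    ZMod.card_units_eq_totient, Nat.totient_prime_pow Nat.prime_two hn,
    Nat.totient_prime_pow Nat.prime_two (by omega)] at h2
  have hpos : 0 < 2 ^ (n - 1) * (2 - 1) := by positivity
  have h3 : 2 ^ (n + 1 - 1) * (2 - 1) = 2 * (2 ^ (n - 1) * (2 - 1)) := by
    rw [← mul_assoc, ← pow_succ']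
    congr 2
    omega
  rw [h3] at h2
  exact Nat.eq_of_mul_eq_mul_right hpos h2

/-- `γ₀ = 1 + 2^n` as a unit of `ℤ/2^{n+1}` (`γ₀² = 1`, `one_add_two_pow_sq`). -/
def gammaZero {n : ℕ} (hn : 1 ≤ n) : (ZMod (2 ^ (n + 1)))ˣ :=
  Units.mkOfMulEqOne (1 + 2 ^ n) (1 + 2 ^ n) (by rw [← sq]; exact one_add_two_pow_sq hn)

@[simp] theorem val_gammaZero {n : ℕ} (hn : 1 ≤ n) :
    ((gammaZero hn : (ZMod (2 ^ (n + 1)))ˣ) : ZMod (2 ^ (n + 1))) = 1 + 2 ^ n :=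
  Units.val_mkOfMulEqOne _

/-- `γ₀` lies in the kernel of the reduction `(ℤ/2^{n+1})ˣ → (ℤ/2^n)ˣ`. -/
theorem gammaZero_mem_ker {n : ℕ} (hn : 1 ≤ n) :
    gammaZero hn ∈ (ZMod.unitsMap (pow_dvd_pow 2 (Nat.le_succ n))).ker := by
  have h0 : (2 : ZMod (2 ^ n)) ^ n = 0 := by exact_mod_cast ZMod.natCast_self (2 ^ n)
  rw [MonoidHom.mem_ker, Units.ext_iff, ZMod.unitsMap_def, Units.coe_map, val_gammaZero, Units.val_one,
    MonoidHom.coe_coe, map_add, map_one, map_pow, map_ofNat, h0, add_zero]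

/-- `γ₀ ≠ 1` (`2^n ≢ 0 (mod 2^{n+1})`). -/
theorem gammaZero_ne_one {n : ℕ} (hn : 1 ≤ n) : gammaZero hn ≠ 1 := by
  intro h
  have h' := congrArg (fun u : (ZMod (2 ^ (n + 1)))ˣ => (u : ZMod (2 ^ (n + 1)))) h
  simp only [val_gammaZero, Units.val_one, add_eq_left] at h'
  have h2n : ((2 ^ n : ℕ) : ZMod (2 ^ (n + 1))) ≠ 0 := by
    rw [Ne, ZMod.natCast_eq_zero_iff]
    intro hd
    have := Nat.le_of_dvd (by positivity) hd
    have : 2 ^ n < 2 ^ (n + 1) := Nat.pow_lt_pow_right (by norm_num) (by omega)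
    omega
  exact h2n (by exact_mod_cast h')

/-- The kernel is exactly `{1, γ₀}`. -/
theorem mem_ker_unitsMap_iff {n : ℕ} (hn : 1 ≤ n) (t : (ZMod (2 ^ (n + 1)))ˣ) :
    t ∈ (ZMod.unitsMap (pow_dvd_pow 2 (Nat.le_succ n))).ker ↔ t = 1 ∨ t = gammaZero hn := by
  classical
  constructor
  · intro ht
    by_contra hne
    rw [not_or] at hne
    -- three distinct elements `1, γ₀, t` in a group of order `2`
    have hcard := card_ker_unitsMap_two_pow hn
    set K := (ZMod.unitsMap (pow_dvd_pow 2 (Nat.le_succ n))).ker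
    haveI : Fintype K := Fintype.ofFinite K
    have h3 : ({⟨1, K.one_mem⟩, ⟨gammaZero hn, gammaZero_mem_ker hn⟩, ⟨t, ht⟩} : Finset K).card ≤
        Fintype.card K := Finset.card_le_univ _
    rw [← Nat.card_eq_fintype_card, hcard] at h3
    rw [Finset.card_insert_of_notMem, Finset.card_insert_of_notMem, Finset.card_singleton] at h3
    · omega
    · simp only [Finset.mem_singleton, Subtype.mk.injEq]; exact fun h => hne.2 h.symm
    · simp only [Finset.mem_insert, Finset.mem_singleton, Subtype.mk.injEq]
      rintro (h | h)
      · exact gammaZero_ne_one hn h.symm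
      · exact hne.1 h.symm
  · rintro (rfl | rfl)
    · exact (ZMod.unitsMap _).ker.one_mem
    · exact gammaZero_mem_ker hn

/-- ★ **B72 in kernel, general `n` (character half):** a character of `(ℤ/2^{n+1})` (values in any domain) that does
NOT factor through `2^n` — e.g. one of conductor exactly `2^{n+1}` — is `−1` at `γ₀ = 1 + 2^n`.  (`n = 1`: `χ₄(3) = −1`;
`n = 2`: `χ₈(5) = χ₈'(5) = −1`; the critic's `decide`d instances are `n = 1, 2`.) -/
theorem apply_one_add_two_pow_eq_neg_one {R : Type*} [CommRing R] [IsDomain R] {n : ℕ} (hn : 1 ≤ n)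
    (χ : DirichletCharacter R (2 ^ (n + 1))) (hχ : ¬χ.FactorsThrough (2 ^ n)) :
    χ (1 + 2 ^ n) = -1 := by
  classical
  have hdvd : 2 ^ n ∣ 2 ^ (n + 1) := pow_dvd_pow 2 (Nat.le_succ n)
  rw [DirichletCharacter.factorsThrough_iff_ker_unitsMap hdvd, SetLike.not_le_iff_exists] at hχ
  obtain ⟨t, htK, htχ⟩ := hχ
  rcases (mem_ker_unitsMap_iff hn t).mp htK with rfl | rfl
  · exact absurd (MonoidHom.ker _).one_mem htχ
  · -- `χ(γ₀) ≠ 1` and `χ(γ₀)² = χ(γ₀²) = 1`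
    have hne : χ (1 + 2 ^ n) ≠ 1 := by
      intro h1
      apply htχ
      rw [MonoidHom.mem_ker]
      ext
      rw [MulChar.coe_toUnitHom, val_gammaZero, Units.val_one, h1]
    have hsq : χ (1 + 2 ^ n) * χ (1 + 2 ^ n) = 1 := by
      rw [← map_mul, ← sq, one_add_two_pow_sq hn, map_one]
    rcases mul_self_eq_one_iff.mp hsq with h | h
    · exact absurd h hne
    · exact h

/-- `γ₀ · γ₀ = 1` (hypothesis `hγ₀` of the critic's `refl_table_charSum` / `hu` of `mulChar_eq_neg_one_of_sq`). -/
theorem gammaZero_mul_self {n : ℕ} (hn : 1 ≤ n) : gammaZero hn * gammaZero hn = 1 :=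
  Units.ext (by rw [Units.val_mul, val_gammaZero, Units.val_one, ← sq]; exact one_add_two_pow_sq hn)

/-- ★ JUNCTION WITH THE CRITIC'S B72 CERTIFICATE (`critic_k3g40_K3_reflsum.lean`, hypothesis `hψ : ψ (e γ₀) = −1`,
there `decide`d only for `N = 4, 8`): for every `n ≥ 1` and every character of level `2^{n+1}` NOT factoring
through `2^n`, `χ(γ₀) = −1` in the certificate's `Units`-currency. -/
theorem apply_gammaZero_eq_neg_one {R : Type*} [CommRing R] [IsDomain R] {n : ℕ} (hn : 1 ≤ n)
    (χ : DirichletCharacter R (2 ^ (n + 1))) (hχ : ¬χ.FactorsThrough (2 ^ n)) :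
    χ ((gammaZero hn : (ZMod (2 ^ (n + 1)))ˣ) : ZMod (2 ^ (n + 1))) = -1 := by
  rw [val_gammaZero]; exact apply_one_add_two_pow_eq_neg_one hn χ hχ

/-- ★ …and conversely (away from characteristic 2 of the VALUE ring): `χ(1 + 2^n) = −1` iff `χ` does not factor
through `2^n` — so "exact conductor `2^{n+1}`" and "`χ(γ₀) = −1`" are the same condition on level-`2^{n+1}`
characters. -/
theorem not_factorsThrough_iff_apply_eq_neg_one {R : Type*} [CommRing R] [IsDomain R] {n : ℕ} (hn : 1 ≤ n)
    (χ : DirichletCharacter R (2 ^ (n + 1))) (h2 : (2 : R) ≠ 0) :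
    ¬χ.FactorsThrough (2 ^ n) ↔ χ (1 + 2 ^ n) = -1 := by
  refine ⟨apply_one_add_two_pow_eq_neg_one hn χ, fun hval hft => ?_⟩
  have hmem := (DirichletCharacter.factorsThrough_iff_ker_unitsMap (pow_dvd_pow 2 (Nat.le_succ n))).mp hft
    (gammaZero_mem_ker hn)
  rw [MonoidHom.mem_ker, Units.ext_iff, MulChar.coe_toUnitHom, val_gammaZero, Units.val_one, hval] at hmem
  apply h2
  calc (2 : R) = 1 - (-1) := by norm_num
    _ = 0 := by rw [hmem, sub_self]

/-- VERBATIM the critic's `CriticG41.refl_table_charSum` (B72 certificate, crux commit 289ad55008c9) — copied, not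
claimed, so that the instantiation below is kernel-checked in one file. -/
theorem refl_table_charSum {R' : Type*} [CommRing R'] {N : ℕ} [NeZero N] {Γ : Type*} [Group Γ] [Fintype Γ]
    (e : Γ ≃* (ZMod N)ˣ) (ψ : MulChar (ZMod N) R') (T : Γ → R') (κ : R') (γ₀ : Γ)
    (hγ₀ : γ₀ * γ₀ = 1) (hψ : ψ ((e γ₀ : (ZMod N)ˣ) : ZMod N) = -1) :
    ∑ γ : Γ, ψ ((e γ : (ZMod N)ˣ) : ZMod N) * (κ * (T γ - T (γ * γ₀))) =
      2 * κ * ∑ γ : Γ, ψ ((e γ : (ZMod N)ˣ) : ZMod N) * T γ := by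
  have hre : ∑ γ : Γ, ψ ((e γ : (ZMod N)ˣ) : ZMod N) * T (γ * γ₀) =
      ∑ δ : Γ, ψ ((e (δ * γ₀) : (ZMod N)ˣ) : ZMod N) * T δ := by
    refine (Fintype.sum_equiv (Equiv.mulRight γ₀)
      (fun δ => ψ ((e (δ * γ₀) : (ZMod N)ˣ) : ZMod N) * T δ)
      (fun γ => ψ ((e γ : (ZMod N)ˣ) : ZMod N) * T (γ * γ₀)) (fun δ => ?_)).symm
    simp only [Equiv.coe_mulRight, mul_assoc, hγ₀, mul_one]
  have hneg : ∀ δ : Γ, ψ ((e (δ * γ₀) : (ZMod N)ˣ) : ZMod N) = -ψ ((e δ : (ZMod N)ˣ) : ZMod N) := by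
    intro δ
    rw [map_mul, Units.val_mul, map_mul, hψ, mul_neg, mul_one]
  have hsplit : ∀ γ : Γ, ψ ((e γ : (ZMod N)ˣ) : ZMod N) * (κ * (T γ - T (γ * γ₀))) =
      κ * (ψ ((e γ : (ZMod N)ˣ) : ZMod N) * T γ) - κ * (ψ ((e γ : (ZMod N)ˣ) : ZMod N) * T (γ * γ₀)) := by
    intro γ; ring
  simp_rw [hsplit]
  rw [Finset.sum_sub_distrib, ← Finset.mul_sum, ← Finset.mul_sum, hre]
  simp_rw [hneg, neg_mul, Finset.sum_neg_distrib]
  ring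

/-- ★ **R219-INST₂'s «ONE application with `Γ := (ℤ/N)ˣ`», character bookkeeping discharged for ALL `n ≥ 1`:**
for `N = 2^{n+1}` and ANY table `T` on `(ℤ/N)ˣ`, the REFL-table character sum against a character not factoring
through `2^n` is `2κ·` the plain one — the critic's `refl_table_charSum` with `e := refl`, `γ₀ := 1 + 2^n`, both of
its hypotheses (`hγ₀`, `hψ`) now THEOREMS (`gammaZero_mul_self`, `apply_gammaZero_eq_neg_one`).  What remains
witness-specific in R219-INST₂ is only the table `T` itself (`∘ϑ` line, `V = L_b + const`, SEAM on units). -/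
theorem refl_table_charSum_two_pow {R : Type*} [CommRing R] [IsDomain R] {n : ℕ} (hn : 1 ≤ n)
    (χ : DirichletCharacter R (2 ^ (n + 1))) (hχ : ¬χ.FactorsThrough (2 ^ n))
    (T : (ZMod (2 ^ (n + 1)))ˣ → R) (κ : R) :
    ∑ γ : (ZMod (2 ^ (n + 1)))ˣ, χ (γ : ZMod (2 ^ (n + 1))) * (κ * (T γ - T (γ * gammaZero hn))) =
      2 * κ * ∑ γ : (ZMod (2 ^ (n + 1)))ˣ, χ (γ : ZMod (2 ^ (n + 1))) * T γ :=
  refl_table_charSum (MulEquiv.refl _) χ T κ (gammaZero hn) (gammaZero_mul_self hn)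
    (apply_gammaZero_eq_neg_one hn χ hχ)

end GammaZeroChar

/-! ## §D. R219-INST₂ leaf «H3 Λ₂-LIFT» in residue characteristic 2: the coefficients `(−1)^d 2^d/(d+1)` of
`Λ₂ = ½·log(1+2X)` lie in `𝒪_{ℂ_F}` — so the integral series `L ∈ 𝒪_ℂ⟦X⟧` that k3-g40's `read_value_eq_tsum_lamTerm`
takes as hypotheses (`hL0`, `hL`) EXISTS.  Mathlib match: `Nat.exists_eq_two_pow_mul_odd` + the isosceles triangle
`IsUltrametricDist.norm_add_eq_max_of_norm_ne_norm` + `Nat.lt_two_pow_self` (`v₂(d+1) ≤ d`).  Classical dictionary: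
`p^{d}/(d+1) ∈ ℤ_p` (Koblitz GTM 58 IV.1; Washington GTM 83 §5.1), here for ANY ultrametric field with `‖2‖ < 1`. -/

section LamTwoLift

/-- Odd naturals are units in norm: `‖m‖ = 1` for `m` odd, in any ultrametric normed field with `‖2‖ < 1`. -/
theorem norm_natCast_eq_one_of_odd {L : Type*} [NormedField L] [IsUltrametricDist L] (h2 : ‖(2 : L)‖ < 1)
    {m : ℕ} (hm : Odd m) : ‖(m : L)‖ = 1 := by
  obtain ⟨k, rfl⟩ := hm
  have hk : ‖(2 * k : L)‖ < 1 := by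
    rw [norm_mul]
    calc ‖(2 : L)‖ * ‖(k : L)‖ ≤ ‖(2 : L)‖ * 1 := by
          gcongr
          exact IsUltrametricDist.norm_natCast_le_one L k
      _ < 1 := by rw [mul_one]; exact h2
  have hne : ‖(2 * k : L)‖ ≠ ‖(1 : L)‖ := by rw [norm_one]; exact hk.ne
  rw [Nat.cast_add, Nat.cast_mul, Nat.cast_two, Nat.cast_one,
    IsUltrametricDist.norm_add_eq_max_of_norm_ne_norm hne, norm_one, max_eq_right hk.le]

/-- ★ `‖2^d/(d+1)‖ ≤ 1` (`d+1 = 2^v·m`, `m` odd, `2^v ≤ d+1 ≤ 2^d`). -/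
theorem norm_two_pow_div_le_one {L : Type*} [NormedField L] [IsUltrametricDist L] (h2 : ‖(2 : L)‖ < 1)
    (d : ℕ) : ‖(2 : L) ^ d / ((d : L) + 1)‖ ≤ 1 := by
  obtain ⟨v, m, hm, hvm⟩ := Nat.exists_eq_two_pow_mul_odd (Nat.succ_ne_zero d)
  have hd1 : ((d : L) + 1) = (2 : L) ^ v * (m : L) := by
    have h := congrArg (Nat.cast : ℕ → L) hvm
    push_cast at h
    exact h
  have hv : v ≤ d := by
    have h1 : 2 ^ v ≤ d + 1 := by
      calc 2 ^ v ≤ 2 ^ v * m := Nat.le_mul_of_pos_right _ hm.pos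
        _ = d + 1 := hvm.symm
    exact (Nat.pow_le_pow_iff_right (by norm_num)).mp (h1.trans Nat.lt_two_pow_self)
  rw [norm_div, hd1, norm_mul, norm_natCast_eq_one_of_odd h2 hm, mul_one, norm_pow, norm_pow]
  exact div_le_one_of_le₀ (pow_le_pow_of_le_one (norm_nonneg _) h2.le hv) (by positivity)

open Literature.NumberTheory.GaloisRepresentations Literature.NumberTheory.GaloisRepresentations.IsNonarchimedeanLocalField
  Literature.NumberTheory.GaloisRepresentations.LubinTate Literature.NumberTheory.PAdicHodge

variable {F : Type} [Field F] [ValuativeRel F] [TopologicalSpace F] [IsNonarchimedeanLocalField F]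

/-- The `Λ₂`-coefficient `(−1)^d 2^d/(d+1)` as an element of `𝒪_{ℂ_F}`. -/
def lamCoeff (h2 : ‖(2 : CompletedAlgClosure F)‖ < 1) (d : ℕ) : CBall F :=
  ⟨(-1) ^ d * (2 : CompletedAlgClosure F) ^ d / ((d : CompletedAlgClosure F) + 1),
    (mem_unitBall_iff _).mpr (by
      rw [mul_div_assoc, norm_mul, norm_pow, norm_neg, norm_one, one_pow, one_mul]
      exact norm_two_pow_div_le_one h2 d)⟩

/-- The integral lift `L = Σ_{d≥0} (−1)^d 2^d/(d+1) · X^{d+1} ∈ 𝒪_{ℂ_F}⟦X⟧` of `Λ₂ = ½ log(1 + 2X)`. -/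
def Lam2C (h2 : ‖(2 : CompletedAlgClosure F)‖ < 1) : PowerSeries (CBall F) :=
  PowerSeries.mk fun n => if n = 0 then 0 else lamCoeff h2 (n - 1)

theorem coeff_zero_Lam2C (h2 : ‖(2 : CompletedAlgClosure F)‖ < 1) : PowerSeries.coeff 0 (Lam2C h2) = 0 := by
  rw [Lam2C, PowerSeries.coeff_mk, if_pos rfl]

theorem coeff_succ_Lam2C (h2 : ‖(2 : CompletedAlgClosure F)‖ < 1) (d : ℕ) :
    ((PowerSeries.coeff (d + 1) (Lam2C h2) : CBall F) : CompletedAlgClosure F) =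
      (-1) ^ d * (2 : CompletedAlgClosure F) ^ d / ((d : CompletedAlgClosure F) + 1) := by
  rw [Lam2C, PowerSeries.coeff_mk, if_neg (Nat.succ_ne_zero d), Nat.add_sub_cancel]
  rfl

/-- ★ **H3 «Λ₂-LIFT» (k3-g40 P3) PROVED**: in residue characteristic `2` (`‖2‖_{ℂ_F} < 1`, tree `norm_two_lt_one_C h2`)
there is `L ∈ 𝒪_{ℂ_F}⟦X⟧` with `L(0) = 0` and `[X^{d+1}]L = (−1)^d 2^d/(d+1)`. -/
theorem exists_Lam2_lift (h2 : ‖(2 : CompletedAlgClosure F)‖ < 1) :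
    ∃ L : PowerSeries (CBall F), ((PowerSeries.coeff 0 L : CBall F) : CompletedAlgClosure F) = 0 ∧
      ∀ d : ℕ, ((PowerSeries.coeff (d + 1) L : CBall F) : CompletedAlgClosure F) =
        (-1) ^ d * (2 : CompletedAlgClosure F) ^ d / ((d : CompletedAlgClosure F) + 1) :=
  ⟨Lam2C h2, by rw [coeff_zero_Lam2C]; rfl, coeff_succ_Lam2C h2⟩

/-- ★ The same in the EXACT hypothesis shape of k3-g40's `read_value_eq_tsum_lamTerm` (`hL0`, `hL`), for any ring
map `θ : ℂ_F → M` into a field (there `M = ℂ_[2]`). -/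
theorem exists_Lam2_lift_map (h2 : ‖(2 : CompletedAlgClosure F)‖ < 1) {M : Type*} [Field M]
    (θ : CompletedAlgClosure F →+* M) :
    ∃ L : PowerSeries (CBall F), θ ((PowerSeries.coeff 0 L : CBall F) : CompletedAlgClosure F) = 0 ∧
      ∀ d : ℕ, θ ((PowerSeries.coeff (d + 1) L : CBall F) : CompletedAlgClosure F) =
        (-1) ^ d * (2 : M) ^ d / ((d : M) + 1) := by
  refine ⟨Lam2C h2, ?_, fun d => ?_⟩
  · rw [coeff_zero_Lam2C]; exact map_zero θ
  · rw [coeff_succ_Lam2C, map_div₀, map_mul, map_pow, map_pow, map_neg, map_one, map_add, map_natCast, map_one,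
      map_ofNat]

/-- ★ Coefficientwise form matching k3-g40's `coeff_Lam2` (`Lam2 A := mk fun n ↦ if n = 0 then 0 else
algebraMap ℚ A ((−1)^{n+1} 2^{n−1}/n)`): under any ring map `θ` into a characteristic-0 field `M`,
`θ(L) = Lam2 M` coefficient by coefficient — i.e. `(Lam2C).map (θ ∘ subtype) = Lam2 M`. -/
theorem map_coeff_Lam2C (h2 : ‖(2 : CompletedAlgClosure F)‖ < 1) {M : Type*} [Field M] [CharZero M]
    (θ : CompletedAlgClosure F →+* M) (n : ℕ) :
    θ ((PowerSeries.coeff n (Lam2C h2) : CBall F) : CompletedAlgClosure F) =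
      if n = 0 then 0 else algebraMap ℚ M ((-1 : ℚ) ^ (n + 1) * 2 ^ (n - 1) / n) := by
  cases n with
  | zero => rw [if_pos rfl, coeff_zero_Lam2C]; exact map_zero θ
  | succ d =>
    rw [if_neg (Nat.succ_ne_zero d), coeff_succ_Lam2C, map_div₀, map_mul, map_pow, map_pow, map_neg, map_one,
      map_add, map_natCast, map_one, map_ofNat, Nat.add_sub_cancel, eq_ratCast]
    push_cast
    ring

end LamTwoLift

/-! ## §E. R219-INST₂ leaf «H1 HALF-LIFT»: a power series `P ≡ 1 (mod 2)` coefficientwise with `P(0) = 1` is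
`1 + 2·y` with `y(0) = 0` (coefficientwise choice) — pure algebra over any commutative ring and any modulus `a`. -/

section HalfLift

theorem exists_eq_one_add_C_mul {A : Type*} [CommRing A] (a : A) (P : PowerSeries A)
    (hP0 : PowerSeries.constantCoeff P = 1) (hP : ∀ n : ℕ, a ∣ PowerSeries.coeff (n + 1) P) :
    ∃ y : PowerSeries A, PowerSeries.constantCoeff y = 0 ∧ P = 1 + PowerSeries.C a * y := by
  classical
  choose c hc using hP
  refine ⟨PowerSeries.mk fun n => if n = 0 then 0 else c (n - 1), ?_, ?_⟩
  · rw [← PowerSeries.coeff_zero_eq_constantCoeff_apply, PowerSeries.coeff_mk, if_pos rfl]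
  · ext n
    rw [map_add, PowerSeries.coeff_one, PowerSeries.coeff_C_mul, PowerSeries.coeff_mk]
    cases n with
    | zero => rw [if_pos rfl, if_pos rfl, mul_zero, add_zero, PowerSeries.coeff_zero_eq_constantCoeff_apply, hP0]
    | succ k => rw [if_neg (Nat.succ_ne_zero k), if_neg (Nat.succ_ne_zero k), zero_add, Nat.add_sub_cancel, hc k]

end HalfLift

/-! ## §F. Degenerate-instance checks (B68): the dictionary is not vacuous -/

section Checks

/-- `n = 1`: `ζ = i` (order 4), `j = 1`: `i^{1·3} = i³ = −i` ✓ (`γ₀ = 3 ≡ −1 (mod 4)` only at `n = 1`). -/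
example : (3 : ZMod 4) = -1 := by decide

/-- `n = 2`: `γ₀ = 5 ≠ −1 = 7 (mod 8)` — B72: the shift is NOT `−1` for `n ≥ 2`. -/
example : (5 : ZMod 8) ≠ -1 := by decide

/-- `(1 + 2^n)² = 1` at `n = 2`: `25 ≡ 1 (mod 8)`. -/
example : ((1 + 2 ^ 2 : ZMod (2 ^ 3))) ^ 2 = 1 := one_add_two_pow_sq (by norm_num)

/-- `γ₀ = 5` reduces to `1` in `ℤ/4` and is not `1` in `ℤ/8` (the two halves of `mem_ker_unitsMap_iff` at `n = 2`). -/
example : ((5 : ZMod 8) : ZMod 8).val % 4 = 1 ∧ (5 : ZMod 8) ≠ 1 := by decide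

/-- `v₂(d+1) ≤ d`: the first cases of the `Λ₂`-integrality (`d = 1`: `2/2`; `d = 3`: `8/4`; `d = 7`: `128/8`). -/
example : (2 : ℚ) ^ 1 / 2 = 1 ∧ (2 : ℚ) ^ 3 / 4 = 2 ∧ (2 : ℚ) ^ 7 / 8 = 16 := by norm_num

end Checks

end Summit.BirchSwinnertonDyer.BirchSwinnertonDyer.Cruxes.SplitBadTwoLowerHalfOfFacts.DisjointShiftK2G41


/-! # PART E′ — card k1-g39's sketch `STUB_IDEAS_stub_heegnerIndexLowerAtTwo_1_g39.lean` (sha16 97873050670fdf53, 649 lines) VERBATIM minus its `import` lines -/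


/-!
# k1-g39 — WEAKEN / STRENGTHEN sweep of road B′'s residual debts (STUB-PLAN v7.4, CRITIC-ROWS-g41:
# R219 «READ₂» = {R217∃ · R222 SHIFT₂ · R219-INST₂}).  All sorry-free.

* §C, §C′ — **R219-INST₂ pieces H1 `exists_half_of_sub_one_mem` and H3 `exists_Lam2_lift` PROVED**
  (H3 under the WEAKEST sufficient hypothesis `‖2‖_{ℂ_F} < 1`; + `exists_Lam2_lift_map[_of_isUniformizer]`:
  the hypotheses `hL0`/`hL` of k3-g40's `read_value_eq_tsum_lamTerm` discharged by name).
* §B″, §B′ — **R222 SHIFT₂ in three currencies**: the `evS` text of record IS the tree's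
  `coe_evalPt₁_compSeriesC_reflect` (family-1 tool «tree match», declared; corollary `compSeriesC_torsion_shift`
  PROVED); the WEAKEST SUFFICIENT Lubin–Tate-side form `[a + π^n]_f ω_{n+1} = [a]_f ω_{n+1} [+]_f ω_1`
  (`ltAct_add_pow_cohPt`, any LT law, `q = 2`) and its Galois form `σ_{1+π^n}·ω_{n+1} = ω_{n+1} [+]_f ω_1`
  (`mapPt_relGalOfUnit_cohPt_eq_ltAdd`) PROVED.
* §B — the (ρ4) digit in B72 form: `χ(1 + 2^n) = −1` for every `χ` of exact conductor `2^{n+1}`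
  (`eval_one_add_two_pow_eq_neg_one`, kernel `{1, γ₀}` computed) and the REFL-difference sum with factor
  exactly `2` (`sum_char_mul_sub_reflect`) — Mathlib-level bookkeeping (content = critic's `refl_table_charSum`).
* §A — R217∃ via its STRONGEST form: the Galois PRODUCT `relGal_prod` (k3-g40 H4) + `relGal_prod_unique`
  PROVED, and `localUntwistExists` PROVED (independently of, and with the same formula as, k3-g41 — filed first,
  22:09Z; credit theirs for existence/uniqueness; the product theorem H4 is this file's addition).

Stub `stub_heegnerIndexLowerAtTwo` (skeleton `f2bd84c0…`), crux `SplitBadTwoLowerHalfOfFacts`, route PrintCf2.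
This file proves NEITHER the stub NOR the crux; BSD is NOT proved by any of it.
-/

noncomputable section

namespace Summit.BirchSwinnertonDyer.BirchSwinnertonDyer.Cruxes.SplitBadTwoLowerHalfOfFacts.WeakStrongK1G39

/-! ## §A. R217∃ — the STRONGEST form: `Aut_F(E·K_π^{m+1}) = Aut_F(E) × Aut_F(K_π^{m+1})` for `E ⊆ F^{nr}`
(k3-g40's typed H4 `relGal_prod`, PROVED, with uniqueness), and k3-g40's residual sub-stub
`LocalUntwistExists` PROVED — for EVERY `σ₀ ∈ Γ_F`, every level `m`, exponent `K`, unit `v`. -/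

section GaloisProduct

open ValuativeRel IsLocalRing Field
open Literature.NumberTheory.GaloisRepresentations Literature.NumberTheory.GaloisRepresentations.IsNonarchimedeanLocalField
  Literature.NumberTheory.GaloisRepresentations.LubinTate

variable {F : Type} [Field F] [ValuativeRel F] [TopologicalSpace F] [IsNonarchimedeanLocalField F]

attribute [local instance] ltNormUniformSpace ltNormIsUniformAddGroup rk1 nF nE fintypeResidueField

variable {π : 𝒪[F]} (hπ : (valuation F).IsUniformizer (π : F))
variable (E : IntermediateField F (AlgebraicClosure F)) [FiniteDimensional F E] [Normal F E]

/-- VERBATIM k3-g40 §4: "`τ ∈ Aut_F(E·K_π^{m+1})` acts on `𝒪_E` as `φ^K`" (`φ = frobUnitBall E σ₀`). -/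
def ActsAsFrobPow (σ₀ : absoluteGaloisGroup F) (K : ℕ) {m : ℕ}
    (τ : (E ⊔ ltField π m : IntermediateField F (AlgebraicClosure F)) ≃ₐ[F]
      (E ⊔ ltField π m : IntermediateField F (AlgebraicClosure F))) : Prop :=
  ∀ x : unitBall E, τ (IntermediateField.inclusion le_sup_left (x : E)) =
    IntermediateField.inclusion le_sup_left
      (((((frobUnitBall E σ₀ : unitBall E ≃+* unitBall E) : unitBall E →+* unitBall E) :
        unitBall E → unitBall E)^[K] x : unitBall E) : E)

/-- VERBATIM k3-g40 §4: the residual EXISTENCE sub-stub of R217 LOCAL-UNTWIST₂. -/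
def LocalUntwistExists (hE : E ≤ maxUnramified F) (σ₀ : absoluteGaloisGroup F) : Prop :=
  ∀ (m K : ℕ) (v : 𝒪[F]ˣ), ∃ τ : (E ⊔ ltField π m : IntermediateField F (AlgebraicClosure F)) ≃ₐ[F]
      (E ⊔ ltField π m : IntermediateField F (AlgebraicClosure F)),
    ActsAsFrobPow E σ₀ K τ ∧
      mapPt τ (inclPt (le_sup_right : ltField π m ≤ E ⊔ ltField π m) (cohPt hπ m)) =
        mapPt (relGalOfUnit hπ E m hE v) (inclPt (le_sup_right : ltField π m ≤ E ⊔ ltField π m) (cohPt hπ m))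

omit [ValuativeRel F] [TopologicalSpace F] [IsNonarchimedeanLocalField F] [FiniteDimensional F E] in
/-- `(σ₀^K)|_E = (σ₀|_E)^K`. -/
theorem restrictNormal_pow (σ₀ : absoluteGaloisGroup F) (K : ℕ) :
    (absoluteGaloisGroup.toAlgEquiv F (σ₀ ^ K)).restrictNormal E =
      ((absoluteGaloisGroup.toAlgEquiv F σ₀).restrictNormal E) ^ K := by
  rw [map_pow (absoluteGaloisGroup.toAlgEquiv F)]
  exact map_pow (AlgEquiv.restrictNormalHom (F := F) (K₁ := AlgebraicClosure F) E) _ K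

/-- `ActsAsFrobPow` from the honest Galois statement "`τ|_E = (σ₀|_E)^K`". -/
theorem actsAsFrobPow_of_apply_inclusion (σ₀ : absoluteGaloisGroup F) (K : ℕ) {m : ℕ}
    {τ : (E ⊔ ltField π m : IntermediateField F (AlgebraicClosure F)) ≃ₐ[F]
      (E ⊔ ltField π m : IntermediateField F (AlgebraicClosure F))}
    (h : ∀ x : E, τ (IntermediateField.inclusion le_sup_left x) =
      IntermediateField.inclusion le_sup_left
        ((((absoluteGaloisGroup.toAlgEquiv F σ₀).restrictNormal E) ^ K) x)) :
    ActsAsFrobPow E σ₀ K τ := by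
  intro x
  rw [h, ← coe_frobUnitBall_pow_apply, RingHom.coe_pow]

/-- ★ **R217∃ DISCHARGED: `LocalUntwistExists` holds — for every `σ₀ ∈ Γ_F` (not only a Frobenius).**
`τ := (σ₀^K)|_{E·K} · σ_w` with `w = v · χ_π(σ₀^K)⁻¹` (`σ_w = relGalOfUnit w` fixes `E`, multiplies the
torsion by `w`; `σ₀^K` multiplies it by `χ_π(σ₀^K)`, `mapPt_relRestrict_relAct`). -/
theorem localUntwistExists (hE : E ≤ maxUnramified F) (σ₀ : absoluteGaloisGroup F) :
    LocalUntwistExists hπ E hE σ₀ := by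
  intro m K v
  refine ⟨relRestrict hπ E m (σ₀ ^ K) * relGalOfUnit hπ E m hE (v * (lubinTateChar hπ (σ₀ ^ K))⁻¹), ?_, ?_⟩
  · refine actsAsFrobPow_of_apply_inclusion E σ₀ K fun x => ?_
    rw [AlgEquiv.mul_apply, relGalOfUnit_apply_inclusion, ← restrictNormal_pow,
      ← resBase_relRestrict hπ E m (σ₀ ^ K), inclusion_resBase_apply]
  · have hpt : inclPt (le_sup_right : ltField π m ≤ E ⊔ ltField π m) (cohPt hπ m) =
        relAct hπ E m (cohUnit hπ m : 𝒪[F]) (relGenPt hπ E m) := by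
      rw [cohPt_eq, inclPt_ltAct_genPt]
    rw [hpt, mapPt_mul, mapPt_relGalOfUnit_relAct, mapPt_relRestrict_relAct, mapPt_relGalOfUnit_relAct]
    congr 1
    rw [Units.val_mul, mul_assoc, mul_left_comm ((lubinTateChar hπ (σ₀ ^ K) : 𝒪[F]ˣ) : 𝒪[F]),
      Units.mul_inv_cancel_left]

include hπ in
/-- ★★ **THE STRONGEST FORM (k3-g40 H4 `relGal_prod`, PROVED): every pair `(a, b) ∈ Aut_F(E) × Aut_F(K_π^{m+1})`
is realised by ONE `τ ∈ Aut_F(E·K_π^{m+1})`** (`E ⊆ F^{nr}` finite normal).  Lift `b` to `Γ_F` and restrict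
(`ρ`); correct `ρ|_E` to `a` by an automorphism fixing `K_π^{m+1}` pointwise (`exists_resBase_eq`, i.e. the
tree's linear disjointness `E ∩ K_π^{m+1} = F` in Galois form). -/
theorem relGal_prod (hE : E ≤ maxUnramified F) (m : ℕ) (a : E ≃ₐ[F] E) (b : ltField π m ≃ₐ[F] ltField π m) :
    ∃ τ : (E ⊔ ltField π m : IntermediateField F (AlgebraicClosure F)) ≃ₐ[F]
        (E ⊔ ltField π m : IntermediateField F (AlgebraicClosure F)),
      (∀ x : E, τ (IntermediateField.inclusion le_sup_left x) = IntermediateField.inclusion le_sup_left (a x)) ∧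
      ∀ y : ltField π m, τ (IntermediateField.inclusion le_sup_right y) =
        IntermediateField.inclusion le_sup_right (b y) := by
  haveI := isGalois_ltField hπ m
  -- lift `b` to `Γ_F`
  obtain ⟨χb, hχb⟩ := AlgEquiv.restrictNormalHom_surjective (F := F) (E := AlgebraicClosure F)
    (K₁ := ltField π m) b
  have hσb : ∀ y : ltField π m, ((absoluteGaloisGroup.toAlgEquiv F).symm χb) • ((y : ltField π m) :
      AlgebraicClosure F) = ((b y : ltField π m) : AlgebraicClosure F) := fun y => by
    rw [absoluteGaloisGroup.toAlgEquiv_symm_apply, ← hχb]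
    exact (AlgEquiv.restrictNormal_commutes χb (ltField π m) y).symm
  set ρ := relRestrict hπ E m ((absoluteGaloisGroup.toAlgEquiv F).symm χb) with hρ
  have hρK : ∀ y : ltField π m, ρ (IntermediateField.inclusion le_sup_right y) =
      IntermediateField.inclusion le_sup_right (b y) := fun y =>
    Subtype.ext (by rw [hρ, coe_relRestrict_apply, IntermediateField.coe_inclusion,
      IntermediateField.coe_inclusion, hσb])
  have hρE : ∀ x : E, ρ (IntermediateField.inclusion le_sup_left x) =
      IntermediateField.inclusion le_sup_left (resBase (π := π) E m ρ x) := fun x =>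
    (inclusion_resBase_apply (π := π) E m ρ x).symm
  -- correct the `E`-component: `c := a ∘ (ρ|_E)⁻¹`, realised by `τ_c` fixing `K_π^{m+1}` pointwise
  set c : E ≃ₐ[F] E := (resBase (π := π) E m ρ).symm.trans a with hc
  have hc0 : ∀ x : (⊥ : IntermediateField F (AlgebraicClosure F)),
      c (IntermediateField.inclusion bot_le x) = IntermediateField.inclusion bot_le x := by
    intro x
    obtain ⟨r, hr⟩ := IntermediateField.mem_bot.mp x.2
    have hx : IntermediateField.inclusion (bot_le : (⊥ : IntermediateField F (AlgebraicClosure F)) ≤ E) x =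
        algebraMap F E r := Subtype.ext (by rw [IntermediateField.coe_inclusion, ← hr]; rfl)
    rw [hx, AlgEquiv.commutes]
  obtain ⟨τc, hτc, hτcres⟩ := exists_resBase_eq (hπ := hπ) (m := m)
    (h := (bot_le : (⊥ : IntermediateField F (AlgebraicClosure F)) ≤ E)) hE hc0
  have hτcK : ∀ y : ltField π m, τc (IntermediateField.inclusion le_sup_right y) =
      IntermediateField.inclusion le_sup_right y :=
    ((forall_apply_inclusion_sup_ltField_iff (π := π) m
      (bot_le : (⊥ : IntermediateField F (AlgebraicClosure F)) ≤ E) τc).mp hτc).2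
  refine ⟨τc * ρ, fun x => ?_, fun y => ?_⟩
  · rw [AlgEquiv.mul_apply, hρE, ← inclusion_resBase_apply (π := π) E m τc, hτcres, hc,
      AlgEquiv.trans_apply, AlgEquiv.symm_apply_apply]
  · rw [AlgEquiv.mul_apply, hρK, hτcK]

omit [FiniteDimensional F E] [Normal F E] in
include hπ in
/-- … and UNIQUELY: an `F`-automorphism of `E·K_π^{m+1}` is determined by its restrictions to `E` and to
`K_π^{m+1}` (tree `algEquiv_apply_mk_eq_of_eq`).  With `relGal_prod`: `Aut_F(E·K_π^{m+1}) ≅ Aut_F(E) × Aut_F(K_π^{m+1})`. -/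
theorem relGal_prod_unique (m : ℕ) {a : E ≃ₐ[F] E} {b : ltField π m ≃ₐ[F] ltField π m}
    {τ τ' : (E ⊔ ltField π m : IntermediateField F (AlgebraicClosure F)) ≃ₐ[F]
      (E ⊔ ltField π m : IntermediateField F (AlgebraicClosure F))}
    (hτE : ∀ x : E, τ (IntermediateField.inclusion le_sup_left x) = IntermediateField.inclusion le_sup_left (a x))
    (hτK : ∀ y : ltField π m, τ (IntermediateField.inclusion le_sup_right y) =
      IntermediateField.inclusion le_sup_right (b y))
    (hτ'E : ∀ x : E, τ' (IntermediateField.inclusion le_sup_left x) = IntermediateField.inclusion le_sup_left (a x))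
    (hτ'K : ∀ y : ltField π m, τ' (IntermediateField.inclusion le_sup_right y) =
      IntermediateField.inclusion le_sup_right (b y)) : τ = τ' := by
  refine AlgEquiv.ext fun z => ?_
  obtain ⟨z, hz⟩ := z
  refine algEquiv_apply_mk_eq_of_eq hπ E m le_rfl τ τ' (fun x => by rw [hτE, hτ'E]) (fun hr => ?_) hz hz
  have e : (⟨ltRoot π m, hr⟩ : (E ⊔ ltField π m : IntermediateField F (AlgebraicClosure F))) =
      IntermediateField.inclusion le_sup_right (IntermediateField.AdjoinSimple.gen F (ltRoot π m)) :=
    Subtype.ext (by rw [IntermediateField.coe_inclusion, IntermediateField.AdjoinSimple.coe_gen])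
  rw [e, hτK, hτ'K]

end GaloisProduct

/-! ## §B. R222 «SHIFT₂» — the STRONGEST Mathlib-level forms of its three ingredients (all PROVED):
(B1) the CHARACTER DIGIT `χ(1 + 2^n) = −1` for every primitive `χ mod 2^{n+1}`, `n ≥ 1` (the kernel of
`(ℤ/2^{n+1})^× → (ℤ/2^n)^×` is `{1, 1+2^n}`), with the index law `(1+2^n)·γ = γ + 2^n` = `hshift` of
`read₂_of_refl_cut` (`γ₀ ↦ 1 + 2^n`, `s = 2^n`); (B2) `ζ^{2^n} = −1` and the `𝔾̂_m` shift
`(ζ^a − 1) [+]_{𝔾̂_m} (−2) = ζ^{a+2^n} − 1` (`X [+] Y = X + Y + XY`, tree `ltF_one_add_X_pow_sub_one`). -/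

section CharacterDigit

theorem two_pow_succ_eq_zero (n : ℕ) : (2 : ZMod (2 ^ (n + 1))) ^ (n + 1) = 0 := by
  have h : (((2 ^ (n + 1) : ℕ) : ZMod (2 ^ (n + 1)))) = 0 := ZMod.natCast_self _
  rwa [Nat.cast_pow, Nat.cast_ofNat] at h

/-- Units of `ℤ/2^{n+1}` are odd. -/
theorem exists_eq_two_mul_add_one {n : ℕ} (γ : (ZMod (2 ^ (n + 1)))ˣ) :
    ∃ k : ZMod (2 ^ (n + 1)), (γ : ZMod (2 ^ (n + 1))) = 2 * k + 1 := by
  have hu : IsUnit (((γ : ZMod (2 ^ (n + 1))).val : ℕ) : ZMod (2 ^ (n + 1))) := by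
    rw [ZMod.natCast_zmod_val]; exact Units.isUnit γ
  rw [ZMod.isUnit_iff_coprime] at hu
  have hodd : ¬ 2 ∣ (γ : ZMod (2 ^ (n + 1))).val := fun h2 =>
    absurd (Nat.Coprime.eq_one_of_dvd (Nat.Coprime.coprime_dvd_left h2 hu)
      (dvd_pow_self 2 (Nat.succ_ne_zero n))) (by norm_num)
  refine ⟨(((γ : ZMod (2 ^ (n + 1))).val / 2 : ℕ) : ZMod (2 ^ (n + 1))), ?_⟩
  have h := Nat.div_add_mod (γ : ZMod (2 ^ (n + 1))).val 2
  rw [Nat.two_dvd_ne_zero.mp hodd] at h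
  calc (γ : ZMod (2 ^ (n + 1)))
      = (((γ : ZMod (2 ^ (n + 1))).val : ℕ) : ZMod (2 ^ (n + 1))) := (ZMod.natCast_zmod_val _).symm
    _ = ((2 * ((γ : ZMod (2 ^ (n + 1))).val / 2) + 1 : ℕ) : ZMod (2 ^ (n + 1))) := by rw [h]
    _ = 2 * (((γ : ZMod (2 ^ (n + 1))).val / 2 : ℕ) : ZMod (2 ^ (n + 1))) + 1 := by push_cast; ring

/-- `2^n · γ = 2^n` for a unit `γ` of `ℤ/2^{n+1}`. -/
theorem two_pow_mul_unit {n : ℕ} (γ : (ZMod (2 ^ (n + 1)))ˣ) :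
    (2 : ZMod (2 ^ (n + 1))) ^ n * γ = 2 ^ n := by
  obtain ⟨k, hk⟩ := exists_eq_two_mul_add_one γ
  rw [hk, mul_add, mul_one, ← mul_assoc, ← pow_succ, two_pow_succ_eq_zero, zero_mul, zero_add]

/-- ★ **The index law = `hshift` of `read₂_of_refl_cut`** (`γ₀ ↦ 1 + 2^n`, `s = 2^n`): `(1 + 2^n)·γ = γ + 2^n`
for every unit `γ` of `ℤ/2^{n+1}` (so multiplication by `γ₀` on `(ℤ/2^{n+1})^×` IS the shift `j ↦ j + 2^n`
of the torsion index, `ζ^{j + 2^n} = −ζ^j`). -/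
theorem one_add_two_pow_mul_unit {n : ℕ} (γ : (ZMod (2 ^ (n + 1)))ˣ) :
    (1 + 2 ^ n : ZMod (2 ^ (n + 1))) * γ = γ + 2 ^ n := by
  rw [add_mul, one_mul, two_pow_mul_unit]

/-- `(1 + 2^n)^2 = 1` in `ℤ/2^{n+1}` for `n ≥ 1`. -/
theorem one_add_two_pow_sq {n : ℕ} (hn : n ≠ 0) : (1 + 2 ^ n : ZMod (2 ^ (n + 1))) ^ 2 = 1 := by
  have h1 : (2 : ZMod (2 ^ (n + 1))) ^ (2 * n) = 0 := by
    rw [show 2 * n = (n + 1) + (n - 1) by omega, pow_add (2 : ZMod (2 ^ (n + 1))) (n + 1) (n - 1),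
      two_pow_succ_eq_zero, zero_mul]
  calc (1 + 2 ^ n : ZMod (2 ^ (n + 1))) ^ 2 = 1 + 2 ^ (n + 1) + 2 ^ (2 * n) := by ring
    _ = 1 := by rw [two_pow_succ_eq_zero, h1, add_zero, add_zero]

/-- **The unit `γ₀ = 1 + 2^n ∈ (ℤ/2^{n+1})^×`** (self-inverse), `n ≥ 1`. -/
def gammaZero {n : ℕ} (hn : n ≠ 0) : (ZMod (2 ^ (n + 1)))ˣ :=
  ⟨1 + 2 ^ n, 1 + 2 ^ n, by rw [← sq, one_add_two_pow_sq hn], by rw [← sq, one_add_two_pow_sq hn]⟩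

theorem coe_gammaZero {n : ℕ} (hn : n ≠ 0) : ((gammaZero hn : (ZMod (2 ^ (n + 1)))ˣ) : ZMod (2 ^ (n + 1))) = 1 + 2 ^ n :=
  rfl

/-- `hshift` literally: `e (γ * γ₀) = e γ + s` for `e = id`, `γ₀ = 1 + 2^n`, `s = 2^n`. -/
theorem coe_mul_gammaZero {n : ℕ} (hn : n ≠ 0) (γ : (ZMod (2 ^ (n + 1)))ˣ) :
    ((γ * gammaZero hn : (ZMod (2 ^ (n + 1)))ˣ) : ZMod (2 ^ (n + 1))) = (γ : ZMod (2 ^ (n + 1))) + 2 ^ n := by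
  rw [Units.val_mul, coe_gammaZero, mul_comm, one_add_two_pow_mul_unit]

/-- **The kernel of `(ℤ/2^{n+1})^× → (ℤ/2^n)^×` is `{1, 1 + 2^n}`** (`n ≥ 1`). -/
theorem eq_one_or_eq_of_unitsMap_eq_one {n : ℕ} (hn : n ≠ 0) (u : (ZMod (2 ^ (n + 1)))ˣ)
    (hu : ZMod.unitsMap (pow_dvd_pow 2 n.le_succ) u = 1) :
    (u : ZMod (2 ^ (n + 1))) = 1 ∨ (u : ZMod (2 ^ (n + 1))) = 1 + 2 ^ n := by
  have hv : (u : ZMod (2 ^ (n + 1))).val % 2 ^ n = 1 := by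
    have h := congrArg (fun w : (ZMod (2 ^ n))ˣ => (w : ZMod (2 ^ n))) hu
    simp only [ZMod.unitsMap_val, Units.val_one, ZMod.cast_eq_val] at h
    rw [← Nat.cast_one, ZMod.natCast_eq_natCast_iff', Nat.mod_eq_of_lt (Nat.one_lt_pow hn one_lt_two)] at h
    exact h
  have hlt : (u : ZMod (2 ^ (n + 1))).val < 2 ^ n * 2 :=
    lt_of_lt_of_eq (ZMod.val_lt (u : ZMod (2 ^ (n + 1)))) (pow_succ 2 n)
  obtain ⟨M, hM⟩ : ∃ M, 2 ^ n = M := ⟨_, rfl⟩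
  rw [hM] at hv hlt
  have hcases : (u : ZMod (2 ^ (n + 1))).val = 1 ∨ (u : ZMod (2 ^ (n + 1))).val = 1 + M := by
    by_cases hvM : (u : ZMod (2 ^ (n + 1))).val < M
    · left; rwa [Nat.mod_eq_of_lt hvM] at hv
    · right
      rw [Nat.mod_eq_sub_mod (not_lt.mp hvM), Nat.mod_eq_of_lt (by omega)] at hv
      omega
  rcases hcases with h | h
  · left; rw [← ZMod.natCast_zmod_val (u : ZMod (2 ^ (n + 1))), h, Nat.cast_one]
  · right; rw [← ZMod.natCast_zmod_val (u : ZMod (2 ^ (n + 1))), h, ← hM]; push_cast; ring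

/-- A character of level `2^{n+1}` with `χ(1 + 2^n) = 1` factors through `2^n` (`n ≥ 1`). -/
theorem factorsThrough_two_pow_of_eval_eq_one {R : Type*} [CommMonoidWithZero R] {n : ℕ} (hn : n ≠ 0)
    (χ : DirichletCharacter R (2 ^ (n + 1))) (h1 : χ (1 + 2 ^ n) = 1) : χ.FactorsThrough (2 ^ n) := by
  rw [DirichletCharacter.factorsThrough_iff_ker_unitsMap (pow_dvd_pow 2 n.le_succ)]
  intro u hu
  rw [MonoidHom.mem_ker] at hu ⊢
  rw [← Units.val_eq_one, MulChar.coe_toUnitHom]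
  rcases eq_one_or_eq_of_unitsMap_eq_one hn u hu with h | h
  · rw [h, map_one]
  · rw [h, h1]

/-- ★★ **THE (ρ4) DIGIT, B72 form: `χ(γ₀) = −1` for `γ₀ = 1 + 2^n` — the generator of
`ker((ℤ/2^{n+1})ˣ → (ℤ/2^n)ˣ)` — and EVERY Dirichlet character `χ` of exact conductor `2^{n+1}` (`n ≥ 1`,
values in a domain).**  (`χ(γ₀)² = χ(γ₀²) = χ(1) = 1`, and `χ(γ₀) = 1` would make `χ` factor through `2^n`:
the kernel is `{1, γ₀}`, `eq_one_or_eq_of_unitsMap_eq_one`.)  Mathlib-level bookkeeping; same content as the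
critic's `critic_k3g40_K3_reflsum.lean` (CRITIC-ROWS-g41 row 117) and k3-g40's `mulChar_eq_neg_one_of_sq` +
"a `ZMod` kernel line" — here that kernel line is PROVED for all `n`.  No parity value `χ(−1)` anywhere (B72). -/
theorem eval_one_add_two_pow_eq_neg_one {R : Type*} [CommRing R] [IsDomain R] {n : ℕ} (hn : n ≠ 0)
    (χ : DirichletCharacter R (2 ^ (n + 1))) (hχ : χ.IsPrimitive) : χ (1 + 2 ^ n) = -1 := by
  have hsq : χ (1 + 2 ^ n) * χ (1 + 2 ^ n) = 1 := by
    rw [← map_mul, ← sq, one_add_two_pow_sq hn, map_one]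
  rcases mul_self_eq_one_iff.mp hsq with h | h
  · exfalso
    have hle : χ.conductor ≤ 2 ^ n :=
      Nat.sInf_le ((DirichletCharacter.mem_conductorSet_iff χ).mpr (factorsThrough_two_pow_of_eval_eq_one hn χ h))
    rw [DirichletCharacter.isPrimitive_def] at hχ
    rw [hχ] at hle
    exact absurd hle (not_le.mpr (Nat.pow_lt_pow_right one_lt_two n.lt_succ_self))
  · exact h

/-- The digit on the unit `γ₀`. -/
theorem eval_gammaZero {R : Type*} [CommRing R] [IsDomain R] {n : ℕ} (hn : n ≠ 0)
    (χ : DirichletCharacter R (2 ^ (n + 1))) (hχ : χ.IsPrimitive) :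
    χ (gammaZero hn : (ZMod (2 ^ (n + 1)))ˣ) = -1 := by
  rw [coe_gammaZero, eval_one_add_two_pow_eq_neg_one hn χ hχ]

/-- `γ₀² = 1`. -/
theorem gammaZero_mul_self {n : ℕ} (hn : n ≠ 0) : gammaZero hn * gammaZero hn = 1 :=
  Units.ext (by rw [Units.val_mul, coe_gammaZero, ← sq, one_add_two_pow_sq hn, Units.val_one])

/-- ★ **THE REFLECTION FACTOR IS EXACTLY `2` (abstract form):** for a multiplicative `ψ : G → R` and an
involution `γ₀` with `ψ(γ₀) = −1`, `Σ_γ ψ(γ)·(T γ − T(γ γ₀)) = 2·Σ_γ ψ(γ)·T γ` for EVERY table `T`. -/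
theorem sum_mul_sub_reflect {G R : Type*} [CommGroup G] [Fintype G] [CommRing R] (ψ : G →* R) {γ₀ : G}
    (hγ₀ : γ₀ * γ₀ = 1) (hψ : ψ γ₀ = -1) (T : G → R) :
    ∑ γ, ψ γ * (T γ - T (γ * γ₀)) = 2 * ∑ γ, ψ γ * T γ := by
  have h : ∑ γ, ψ γ * T (γ * γ₀) = -∑ γ, ψ γ * T γ := by
    rw [← Equiv.sum_comp (Equiv.mulRight γ₀) (fun γ => ψ γ * T (γ * γ₀))]
    simp only [Equiv.coe_mulRight, map_mul, hψ, mul_assoc, hγ₀, mul_one, mul_neg_one, neg_mul,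
      Finset.sum_neg_distrib]
  simp only [mul_sub, Finset.sum_sub_distrib, h]
  ring

/-- ★★ **REFL-difference sum (weakest sufficient form consumed by k3-g40's `read₂_of_refl_cut`): for EVERY
primitive `χ mod 2^{n+1}` (`n ≥ 1`) and every unit table `T`, `Σ_γ χ(γ)·(T γ − T(γ·γ₀)) = 2·Σ_γ χ(γ)·T γ`
(`γ₀ = 1 + 2^n`).**  The factor is exactly `2` for the whole primitive table (it cancels the `½` of
`Λ₂ = ½·log(1+2X)` on the nose); this is the statement the critic's `refl_table_charSum` (row 117, K3 struck)
certifies — reproduced here only as the Mathlib-level form the REFL glue instantiates (B72: `γ₀` IS `1 + 2^n`). -/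
theorem sum_char_mul_sub_reflect {R : Type*} [CommRing R] [IsDomain R] {n : ℕ} (hn : n ≠ 0)
    (χ : DirichletCharacter R (2 ^ (n + 1))) (hχ : χ.IsPrimitive) (T : (ZMod (2 ^ (n + 1)))ˣ → R) :
    ∑ γ : (ZMod (2 ^ (n + 1)))ˣ, χ γ * (T γ - T (γ * gammaZero hn)) =
      2 * ∑ γ : (ZMod (2 ^ (n + 1)))ˣ, χ γ * T γ := by
  have h := sum_mul_sub_reflect ((Units.coeHom R).comp χ.toUnitHom) (gammaZero_mul_self hn)
    (by rw [MonoidHom.comp_apply, Units.coeHom_apply, MulChar.coe_toUnitHom, eval_gammaZero hn χ hχ]) T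
  simpa only [MonoidHom.comp_apply, Units.coeHom_apply, MulChar.coe_toUnitHom] using h

end CharacterDigit

section RootShift

variable {M : Type*} [CommRing M] [IsDomain M] {n : ℕ} {ζ : M}

/-- ★ `ζ^{2^n} = −1` for a primitive `2^{n+1}`-th root of unity (any domain). -/
theorem pow_two_pow_eq_neg_one (hζ : IsPrimitiveRoot ζ (2 ^ (n + 1))) : ζ ^ 2 ^ n = -1 :=
  (hζ.pow (pow_pos two_pos _) (pow_succ 2 n)).eq_neg_one_of_two_right

/-- `ζ^{a + 2^n} = −ζ^a`: the index shift by `s = 2^n` is the sign. -/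
theorem pow_add_two_pow (hζ : IsPrimitiveRoot ζ (2 ^ (n + 1))) (a : ℕ) : ζ ^ (a + 2 ^ n) = -ζ ^ a := by
  rw [pow_add, pow_two_pow_eq_neg_one hζ, mul_neg_one]

/-- ★ **The `𝔾̂_m` SHIFT (strongest coordinate-free form of S3/R222 before transport by `ϑ`):**
`(ζ^a − 1) [+]_{𝔾̂_m} (−2) = ζ^{a + 2^n} − 1`, where `X [+]_{𝔾̂_m} Y = X + Y + XY` (tree
`ltF_one_add_X_pow_sub_one`) and `−2 = ζ^{2^n} − 1` is THE point of exact order `2` of `𝔾̂_m`.  Applying the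
additive comparison map `ϑ` (tree `evalPt₁_compSeriesC_addPt`) gives `w_{a+2^n} = w_a [+]_{f'} ϑ(−2)`. -/
theorem gm_add_neg_two (hζ : IsPrimitiveRoot ζ (2 ^ (n + 1))) (a : ℕ) :
    (ζ ^ a - 1) + (-2) + (ζ ^ a - 1) * (-2) = ζ ^ (a + 2 ^ n) - 1 := by
  rw [pow_add_two_pow hζ]; ring

omit [IsDomain M] in
/-- `−2` is `𝔾̂_m`-torsion killed by `[2]`: `[2]_{𝔾̂_m}(−2) = (−2) [+] (−2) = (1 + (−2))^2 − 1 = 0`. -/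
theorem gm_two_neg_two : ((-2 : M) + (-2) + (-2) * (-2)) = 0 := by ring

/-- `−2 = ζ^{2^n} − 1`: the order-`2` point is the level-`1` torsion point of the `ζ`-tower. -/
theorem neg_two_eq (hζ : IsPrimitiveRoot ζ (2 ^ (n + 1))) : (-2 : M) = ζ ^ 2 ^ n - 1 := by
  rw [pow_two_pow_eq_neg_one hζ]; ring

end RootShift

/-! ## §B′. R222 «SHIFT₂» IN TREE CURRENCY (`q = 2`, any `F`, any uniformiser `π`; PROVED):
`[π^n] ω_{n+1} = ω_1 = −π`, `[a + π^n] ω_{n+1} = [a] ω_{n+1} [+]_f (−π)`, and the GALOIS form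
`σ_{γ₀} · ω_{n+1} = ω_{n+1} [+]_f ω_1` in `E·K_π^{n+1}` for the unit `γ₀ = 1 + π^n` (`σ_{γ₀} = relGalOfUnit γ₀`
fixes `E`).  This is the strongest coordinate-free statement of S3/SHIFT₂; the `𝔾̂_m` identity of §B is its
`F = ℚ₂, π = 2` shadow. -/

section TreeShift

open ValuativeRel IsLocalRing Field
open Literature.NumberTheory.GaloisRepresentations Literature.NumberTheory.GaloisRepresentations.IsNonarchimedeanLocalField
  Literature.NumberTheory.GaloisRepresentations.LubinTate

variable {F : Type} [Field F] [ValuativeRel F] [TopologicalSpace F] [IsNonarchimedeanLocalField F]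

attribute [local instance] ltNormUniformSpace ltNormIsUniformAddGroup rk1 nF nE fintypeResidueField

variable {π : 𝒪[F]} (hπ : (valuation F).IsUniformizer (π : F))

/-- `[π^n · u] λ_{n+1} ≠ 0` for a unit `u` (the tree's primitivity argument). -/
theorem ltAct_pow_mul_unit_genPt_ne_zero (n : ℕ) (u : 𝒪[F]ˣ) :
    ltAct hπ n (π ^ n * u) (genPt hπ n) ≠ 0 := by
  intro h2
  have h3 : π ^ (n + 1) ∣ π ^ n * (u : 𝒪[F]) := pow_dvd_of_ltSMul_genPt_eq_zero hπ h2
  rw [pow_succ] at h3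
  have hπ0 : (π : 𝒪[F]) ^ n ≠ 0 := pow_ne_zero _ fun h => hπ.ne_zero (congrArg Subtype.val h)
  have h4 : π ∣ (u : 𝒪[F]) := (mul_dvd_mul_iff_left hπ0).mp h3
  have h5 : IsUnit π := isUnit_of_dvd_unit h4 u.isUnit
  have h6 : valuation F (π : F) = 1 :=
    (Valuation.Integers.isUnit_iff_valuation_eq_one (Valuation.integer.integers (valuation F))).mp h5
  exact hπ.val_lt_one.ne h6

/-- `[π^n] ω_{n+1} ≠ 0`. -/
theorem ltAct_pow_cohPt_ne_zero (n : ℕ) : ltAct hπ n (π ^ n) (cohPt hπ n) ≠ 0 := by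
  rw [cohPt_eq, ← ltAct_mul]
  exact ltAct_pow_mul_unit_genPt_ne_zero hπ n (cohUnit hπ n)

/-- `[π]([π^n] ω_{n+1}) = 0`. -/
theorem ltAct_pi_ltAct_pow_cohPt (n : ℕ) : ltAct hπ n π (ltAct hπ n (π ^ n) (cohPt hπ n)) = 0 := by
  rw [← ltAct_mul, ← pow_succ', cohPt_eq, ← ltAct_mul, ltAct_pow_mul_genPt]

/-- ★ **`[π^n] ω_{n+1} = ω_1 = −π`** (`q = 2`: the non-zero `π`-division point is `−π`, tree `coe_ltDivPt_one_two`). -/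
theorem ltAct_pow_cohPt_eq_ltDivPt (hq : residueFieldCard F = 2) (n : ℕ) :
    ltAct hπ n (π ^ n) (cohPt hπ n) = ltDivPt hπ n 1 := by
  rcases eq_zero_or_eq_neg_of_ltSMul_pi_eq_zero hπ (ltField π n) hq (ltAct_pi_ltAct_pow_cohPt hπ n) with h0 | hneg
  · exact absurd h0 (ltAct_pow_cohPt_ne_zero hπ n)
  · apply Subtype.ext; apply Subtype.ext
    rw [hneg, coe_ltDivPt_one_two hπ n hq, Subring.coe_neg, algebraMap_integer_apply]

/-- ★★ **SHIFT₂ in tree currency: `[a + π^n] ω_{n+1} = [a] ω_{n+1} [+]_f ω_1`** (`q = 2`, every `a ∈ 𝒪_F`). -/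
theorem ltAct_add_pow_cohPt (hq : residueFieldCard F = 2) (n : ℕ) (a : 𝒪[F]) :
    ltAct hπ n (a + π ^ n) (cohPt hπ n) =
      ltAdd (maxNilIdeal F (ltField π n)) (isLTRing_LTCoeff hπ) (isLTSeries_LTCoeff π)
        (ltAct hπ n a (cohPt hπ n)) (ltDivPt hπ n 1) := by
  rw [← ltAct_pow_cohPt_eq_ltDivPt hπ hq n]
  change ltSMul _ _ _ (LTCoeff.of F (a + π ^ n)) _ = _
  rw [map_add, add_ltSMul]

/-- **`[1 + π^n] ω_{n+1} = ω_{n+1} [+]_f ω_1`** (`q = 2`). -/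
theorem ltAct_one_add_pow_cohPt (hq : residueFieldCard F = 2) (n : ℕ) :
    ltAct hπ n (1 + π ^ n) (cohPt hπ n) =
      ltAdd (maxNilIdeal F (ltField π n)) (isLTRing_LTCoeff hπ) (isLTSeries_LTCoeff π)
        (cohPt hπ n) (ltDivPt hπ n 1) := by
  rw [ltAct_add_pow_cohPt hπ hq n 1, ltAct_one]

variable (E : IntermediateField F (AlgebraicClosure F)) [FiniteDimensional F E] [Normal F E]

/-- ★★ **GALOIS SHIFT₂ (`q = 2`): `σ_{γ₀} · ω_{n+1} = ω_{n+1} [+]_f ω_1` in `E·K_π^{n+1}`** for the unit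
`γ₀ = 1 + π^n` and `σ_{γ₀} = relGalOfUnit γ₀ ∈ Aut_F(E·K_π^{n+1})` (fixes `E`, `χ_π(σ_{γ₀}) ≡ γ₀`), `E ⊆ F^{nr}`.
With `localUntwistExists`/`relGal_prod` (§A) this is R217 + R222 of STUB-PLAN v7.3 in the tree's own currency:
the reflection `γ ↦ γ·γ₀` of the table `T(γ) = (𝒩 g)^{τ_γ}(ω)` is translation of the argument by `ω_1 = −π`. -/
theorem mapPt_relGalOfUnit_cohPt_eq_ltAdd (hq : residueFieldCard F = 2) (hE : E ≤ maxUnramified F) (n : ℕ)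
    (γ₀ : 𝒪[F]ˣ) (hγ₀ : (γ₀ : 𝒪[F]) = 1 + π ^ n) :
    mapPt (relGalOfUnit hπ E n hE γ₀) (inclPt (le_sup_right : ltField π n ≤ E ⊔ ltField π n) (cohPt hπ n)) =
      ltAdd (maxNilIdeal F (E ⊔ ltField π n : IntermediateField F (AlgebraicClosure F))) (isLTRing_LTCoeff hπ)
        (isLTSeries_LTCoeff π)
        (inclPt (le_sup_right : ltField π n ≤ E ⊔ ltField π n) (cohPt hπ n))
        (inclPt (le_sup_right : ltField π n ≤ E ⊔ ltField π n) (ltDivPt hπ n 1)) := by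
  have h1 : mapPt (relGalOfUnit hπ E n hE γ₀)
      (inclPt (le_sup_right : ltField π n ≤ E ⊔ ltField π n) (cohPt hπ n)) =
      inclPt (le_sup_right : ltField π n ≤ E ⊔ ltField π n) (ltAct hπ n (γ₀ : 𝒪[F]) (cohPt hπ n)) := by
    conv_lhs => rw [cohPt_eq, inclPt_ltAct_genPt]
    rw [mapPt_relGalOfUnit_relAct, ← inclPt_ltAct_genPt, ltAct_mul, ← cohPt_eq]
  rw [h1, hγ₀, ltAct_one_add_pow_cohPt hπ hq n, inclPt_ltAdd hπ]

include hπ in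
/-- `1 + π^n` IS a unit of `𝒪_F` for `n ≥ 1` (so the unit `γ₀` of the Galois shift exists). -/
theorem isUnit_one_add_pow {n : ℕ} (hn : n ≠ 0) : IsUnit (1 + π ^ n : 𝒪[F]) := by
  have hπnu : ¬ IsUnit (π : 𝒪[F]) := fun h5 =>
    hπ.val_lt_one.ne ((Valuation.Integers.isUnit_iff_valuation_eq_one
      (Valuation.integer.integers (valuation F))).mp h5)
  have hmem' : (-(π ^ n) : 𝒪[F]) ∈ nonunits 𝒪[F] := by
    rw [← IsLocalRing.mem_maximalIdeal]
    exact neg_mem (Ideal.pow_mem_of_mem _ ((IsLocalRing.mem_maximalIdeal _).mpr (mem_nonunits_iff.mpr hπnu)) n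
      (Nat.pos_of_ne_zero hn))
  have h := IsLocalRing.isUnit_one_sub_self_of_mem_nonunits _ hmem'
  rwa [sub_neg_eq_add] at h

end TreeShift

/-! ## §B″. R222 RECOGNISED IN THE TREE (family-1 tool «tree match», declared): the comparison-currency
SHIFT₂ of record (`compSeriesC_torsion_shift : evS z' ϑ = (evS z ϑ) [+]_{f'} ω₁'`, `1 + z' = −(1+z)`) IS the
tree's ★★ `coe_evalPt₁_compSeriesC_reflect` (`LubinTateComparisonReflectionTwo`: `ϑ(−2 − x) = −π' − ϑ(x)` on
ALL of `𝔪_ℂ` — the STRONGER statement, torsion or not) read through `evalPt₁_compSeriesC_eq_mk_evS`;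
`y [+]_{f'} (−π') = −π' − y` is the tree's `coe_tPt_ltDivPt_two`, `ω₁' = ϑ(−2) = −π'` its
`coe_evalPt₁_compSeriesC_negTwo`.  The `evS`-currency corollary, PROVED in three lines: -/

section ShiftOfRecord

open ValuativeRel IsLocalRing Field
open Literature.NumberTheory.GaloisRepresentations Literature.NumberTheory.GaloisRepresentations.IsNonarchimedeanLocalField
  Literature.NumberTheory.GaloisRepresentations.LubinTate Literature.NumberTheory.PAdicHodge

variable {F : Type} [Field F] [ValuativeRel F] [TopologicalSpace F] [IsNonarchimedeanLocalField F]

variable (hq : residueFieldCard F = 2) (h2 : (valuation F).IsUniformizer (((2 : ℕ) : 𝒪[F]) : F))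
  {σ₀ : absoluteGaloisGroup F} (hσ₀ : IsAbsArithFrob σ₀) (u : 𝒪[F]ˣ)
  {ε : (maxUnramifiedCompletion F)ˣ}
  (hε : maxUnramifiedCompletion.galAut F σ₀ (ε : maxUnramifiedCompletion F) =
    algebraMap 𝒪[F] (maxUnramifiedCompletion F) (u : 𝒪[F]) * (ε : maxUnramifiedCompletion F))

include hq in
/-- ★★ **R222 «SHIFT₂» OF RECORD in `evS` currency**: for `z, z' ∈ 𝔪_ℂ` with `1 + z' = −(1 + z)`,
`ϑ̄(z') = −π' − ϑ̄(z)` (`= ϑ̄(z) [+]_{f'} ω₁'`, `ω₁' = −π'`, `π' = 2u`), where `ϑ̄ = ϑ.map (𝒪̂_{F^nr} → 𝒪_{ℂ_F})`,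
`ϑ = compSeriesC h2 hσ₀ u hε`.  (`F` any local field with `|𝓀_F| = 2` and `2` a uniformiser, e.g. `ℚ₂`.) -/
theorem compSeriesC_torsion_shift (z z' : (maxNilIdealC F).toIdeal)
    (hz' : ((z' : CBall F) : CompletedAlgClosure F) = -2 - ((z : CBall F) : CompletedAlgClosure F)) :
    ((evS (maxNilIdealC F) z' ((compSeriesC h2 hσ₀ u hε).map (algebraMap (UnrCoeff F) (CBall F))) : CBall F) :
        CompletedAlgClosure F) =
      -algebraMap F (CompletedAlgClosure F) ((((u : 𝒪[F]) * ((2 : ℕ) : 𝒪[F]) : 𝒪[F]) : F)) -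
        ((evS (maxNilIdealC F) z ((compSeriesC h2 hσ₀ u hε).map (algebraMap (UnrCoeff F) (CBall F))) : CBall F) :
          CompletedAlgClosure F) := by
  have h := coe_evalPt₁_compSeriesC_reflect hq h2 hσ₀ u hε z z' hz'
  rw [evalPt₁_compSeriesC_eq_mk_evS hσ₀ u hε h2 z', evalPt₁_compSeriesC_eq_mk_evS hσ₀ u hε h2 z] at h
  exact h

include hq in
/-- The same as an involution statement on values: `ϑ̄(z') + ϑ̄(z) = −π'` (symmetric in `z ↔ z'`). -/
theorem compSeriesC_torsion_shift_add (z z' : (maxNilIdealC F).toIdeal)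
    (hz' : ((z' : CBall F) : CompletedAlgClosure F) = -2 - ((z : CBall F) : CompletedAlgClosure F)) :
    ((evS (maxNilIdealC F) z' ((compSeriesC h2 hσ₀ u hε).map (algebraMap (UnrCoeff F) (CBall F))) : CBall F) :
        CompletedAlgClosure F) +
      ((evS (maxNilIdealC F) z ((compSeriesC h2 hσ₀ u hε).map (algebraMap (UnrCoeff F) (CBall F))) : CBall F) :
          CompletedAlgClosure F) =
      -algebraMap F (CompletedAlgClosure F) ((((u : 𝒪[F]) * ((2 : ℕ) : 𝒪[F]) : 𝒪[F]) : F)) := by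
  rw [compSeriesC_torsion_shift hq h2 hσ₀ u hε z z' hz']; ring

end ShiftOfRecord

/-! ## §C. k3-g40 H1 (PROVED, any commutative ring): a series `≡ 1 (mod 2)` coefficientwise is `1 + 2y`. -/

section HalfSeries

open PowerSeries

variable {A : Type*} [CommRing A]

/-- ★ k3-g40 H1 `exists_half_of_sub_one_mem`: if every coefficient of `P − 1` lies in `(2)`, then
`P = 1 + C 2 * y` for some `y` (coefficientwise choice). -/
theorem exists_half_of_sub_one_mem (P : A⟦X⟧)
    (h : ∀ n, (coeff n P : A) - (if n = 0 then 1 else 0) ∈ Ideal.span {(2 : A)}) :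
    ∃ y : A⟦X⟧, P = 1 + C (2 : A) * y := by
  choose c hc using fun n => Ideal.mem_span_singleton'.mp (h n)
  refine ⟨mk c, PowerSeries.ext fun n => ?_⟩
  rw [map_add, coeff_C_mul, coeff_mk, coeff_one, mul_comm, hc n]
  split_ifs <;> ring

/-- The same with the constant term pinned: if moreover `P(0) = 1` then `y(0) = 0`. -/
theorem exists_half_of_sub_one_mem' (P : A⟦X⟧) (h0 : constantCoeff P = 1)
    (h : ∀ n, (coeff n P : A) - (if n = 0 then 1 else 0) ∈ Ideal.span {(2 : A)}) :
    ∃ y : A⟦X⟧, constantCoeff y = 0 ∧ P = 1 + C (2 : A) * y := by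
  choose c hc using fun n => Ideal.mem_span_singleton'.mp (h n)
  refine ⟨mk fun n => if n = 0 then 0 else c n, ?_, PowerSeries.ext fun n => ?_⟩
  · rw [← coeff_zero_eq_constantCoeff_apply, coeff_mk]
    exact if_pos rfl
  · simp only [map_add, coeff_C_mul, coeff_mk, coeff_one]
    split_ifs with hn
    · subst hn; rw [mul_zero, add_zero, coeff_zero_eq_constantCoeff_apply, h0]
    · rw [zero_add, mul_comm, hc n, if_neg hn, sub_zero]

end HalfSeries

/-! ## §C′. k3-g40 H3 `exists_Lam2_lift` (R219-INST₂ piece, PROVED) under the WEAKEST SUFFICIENT hypothesis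
`‖2‖ < 1` in `ℂ_F` (residue characteristic `2`; implied by the frame's `h2 : 2` a uniformiser via the tree's
`norm_two_lt_one_C`, and weaker than k3-g40's `hq : |𝓀_F| = 2`): the `Λ₂`-scalars `(−1)^d 2^d/(d+1)` lie in
`𝒪_{ℂ_F}`, so `Λ₂ = Σ_d (−1)^d 2^d/(d+1)·X^{d+1}` lifts to `(CBall F)⟦X⟧` — the integrality making EVAL₂ a tree `evS`. -/

section LamTwoLift

open ValuativeRel IsLocalRing Field
open Literature.NumberTheory.GaloisRepresentations Literature.NumberTheory.GaloisRepresentations.IsNonarchimedeanLocalField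
  Literature.NumberTheory.GaloisRepresentations.LubinTate Literature.NumberTheory.PAdicHodge

variable {F : Type} [Field F] [ValuativeRel F] [TopologicalSpace F] [IsNonarchimedeanLocalField F]
variable (h2C : ‖(2 : CompletedAlgClosure F)‖ < 1)

include h2C in
/-- `‖m‖ = 1` in `ℂ_F` for odd `m` (residue characteristic `2`). -/
theorem norm_natCast_eq_one_of_odd_C {m : ℕ} (hm : ¬ 2 ∣ m) : ‖(m : CompletedAlgClosure F)‖ = 1 := by
  obtain ⟨k, hk⟩ : ∃ k, m = 2 * k + 1 := ⟨m / 2, by omega⟩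
  have hlt : ‖((2 * k : ℕ) : CompletedAlgClosure F)‖ < 1 := by
    rw [Nat.cast_mul, norm_mul, Nat.cast_ofNat]
    calc ‖(2 : CompletedAlgClosure F)‖ * ‖(k : CompletedAlgClosure F)‖
        ≤ ‖(2 : CompletedAlgClosure F)‖ * 1 := by
          gcongr; exact IsUltrametricDist.norm_natCast_le_one _ _
      _ < 1 := by rw [mul_one]; exact h2C
  rw [hk, Nat.cast_succ, IsUltrametricDist.norm_add_eq_max_of_norm_ne_norm (by rw [norm_one]; exact hlt.ne),
    norm_one, max_eq_right hlt.le]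

include h2C in
/-- ★ `‖(−1)^d · 2^d/(d+1)‖ ≤ 1` in `ℂ_F` of residue characteristic `2` (`v₂(d+1) ≤ d`; if `2 = 0` in `ℂ_F`
— equal characteristic — the scalar is `1` for `d = 0` and `0` for `d ≥ 1`). -/
theorem norm_lamCoeff_le_one (d : ℕ) :
    ‖((-1 : CompletedAlgClosure F) ^ d * 2 ^ d / ((d : CompletedAlgClosure F) + 1))‖ ≤ 1 := by
  by_cases h20 : (2 : CompletedAlgClosure F) = 0
  · cases d with
    | zero => simp
    | succ k => rw [h20, zero_pow (Nat.succ_ne_zero k), mul_zero, zero_div, norm_zero]; exact zero_le_one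
  obtain ⟨a, m, hm, hdm⟩ := Nat.exists_eq_pow_mul_and_not_dvd (show d + 1 ≠ 0 by omega) 2 (by norm_num)
  have hm0 : m ≠ 0 := by rintro rfl; exact hm (dvd_zero 2)
  have ha : a ≤ d := by
    have h1 : 2 ^ a ≤ d + 1 := by rw [hdm]; exact Nat.le_mul_of_pos_right _ (Nat.pos_of_ne_zero hm0)
    have h2' : d + 1 ≤ 2 ^ d := Nat.lt_two_pow_self
    exact (Nat.pow_le_pow_iff_right (by norm_num)).mp (h1.trans h2')
  have hcast : ((d : CompletedAlgClosure F) + 1) = ((2 ^ a * m : ℕ) : CompletedAlgClosure F) := by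
    rw [← hdm]; push_cast; ring
  have hm1 := norm_natCast_eq_one_of_odd_C h2C hm
  have hne : ((d : CompletedAlgClosure F) + 1) ≠ 0 := by
    rw [hcast]; push_cast
    exact mul_ne_zero (pow_ne_zero _ h20) fun h0 => by
      rw [h0, norm_zero] at hm1; exact zero_ne_one hm1
  rw [norm_div, div_le_one (norm_pos_iff.mpr hne), hcast]
  push_cast
  rw [norm_mul, norm_mul, norm_pow, norm_pow, norm_pow, norm_neg, norm_one, one_pow, one_mul, hm1, mul_one]
  obtain ⟨k, rfl⟩ := Nat.exists_eq_add_of_le ha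
  rw [pow_add]
  exact mul_le_of_le_one_right (pow_nonneg (norm_nonneg _) _) (pow_le_one₀ (norm_nonneg _) h2C.le)

include h2C in
/-- The `Λ₂` scalar `(−1)^d 2^d/(d+1)` as an element of `𝒪_{ℂ_F}`. -/
def lamCoeffC (d : ℕ) : CBall F :=
  ⟨(-1 : CompletedAlgClosure F) ^ d * 2 ^ d / ((d : CompletedAlgClosure F) + 1),
    (mem_unitBall_iff _).mpr (norm_lamCoeff_le_one h2C d)⟩

theorem coe_lamCoeffC (d : ℕ) :
    ((lamCoeffC h2C d : CBall F) : CompletedAlgClosure F) =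
      (-1 : CompletedAlgClosure F) ^ d * 2 ^ d / ((d : CompletedAlgClosure F) + 1) :=
  rfl

include h2C in
/-- ★★ **k3-g40 H3 `exists_Lam2_lift` (PROVED, weakest hypothesis `‖2‖_{ℂ_F} < 1`):**
`Λ₂ = ½·log(1 + 2X) = Σ_{d ≥ 0} (−1)^d 2^d/(d+1)·X^{d+1}` has a lift `L ∈ 𝒪_{ℂ_F}⟦X⟧` with `L(0) = 0`
(so the tree's `evS`/`evS_subst` apply to `L ∘ y ∘ ϑ`). -/
theorem exists_Lam2_lift :
    ∃ L : PowerSeries (CBall F), PowerSeries.constantCoeff L = 0 ∧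
      ∀ d : ℕ, ((PowerSeries.coeff (d + 1) L : CBall F) : CompletedAlgClosure F) =
        (-1 : CompletedAlgClosure F) ^ d * 2 ^ d / ((d : CompletedAlgClosure F) + 1) := by
  refine ⟨PowerSeries.mk fun n => if n = 0 then 0 else lamCoeffC h2C (n - 1), ?_, fun d => ?_⟩
  · rw [← PowerSeries.coeff_zero_eq_constantCoeff_apply, PowerSeries.coeff_mk]
    exact if_pos rfl
  · rw [PowerSeries.coeff_mk, if_neg (Nat.succ_ne_zero d), Nat.add_sub_cancel, coe_lamCoeffC]

include h2C in
/-- ★ **H3 in the consumer's shape**: pushed along any ring hom `θ : ℂ_F → K` into a field (e.g. the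
`θ = (equivPadicComplex 2).toRingHom : ℂ_F → ℂ_[2]` of record), the lift `L` has `θ`-coefficients
`θ[X⁰]L = 0`, `θ[X^{d+1}]L = (−1)^d 2^d/(d+1)` — these are VERBATIM the hypotheses `hL0`, `hL` of k3-g40's
★★ `read_value_eq_tsum_lamTerm` (R221 «EVAL₂» of record), which are thereby discharged by name. -/
theorem exists_Lam2_lift_map {K : Type*} [Field K] (θ : CompletedAlgClosure F →+* K) :
    ∃ L : PowerSeries (CBall F), PowerSeries.constantCoeff L = 0 ∧
      θ ((PowerSeries.coeff 0 L : CBall F) : CompletedAlgClosure F) = 0 ∧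
      ∀ d : ℕ, θ ((PowerSeries.coeff (d + 1) L : CBall F) : CompletedAlgClosure F) =
        (-1) ^ d * (2 : K) ^ d / ((d : K) + 1) := by
  obtain ⟨L, hL0, hL⟩ := exists_Lam2_lift h2C
  refine ⟨L, hL0, ?_, fun d => ?_⟩
  · rw [PowerSeries.coeff_zero_eq_constantCoeff, hL0]; simp
  · rw [hL d, map_div₀, map_mul, map_pow, map_pow, map_neg, map_one, map_add, map_one, map_natCast, map_ofNat]

/-- The same in the FRAME OF RECORD (`2` a uniformiser of `F`, the hypothesis `h2` of the tree's `q = 2`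
comparison block `LubinTateComparisonReflectionTwo` and of R222's text): via the tree's `norm_two_lt_one_C`. -/
theorem exists_Lam2_lift_map_of_isUniformizer
    (h2 : (valuation F).IsUniformizer (((2 : ℕ) : 𝒪[F]) : F)) {K : Type*} [Field K]
    (θ : CompletedAlgClosure F →+* K) :
    ∃ L : PowerSeries (CBall F), PowerSeries.constantCoeff L = 0 ∧
      θ ((PowerSeries.coeff 0 L : CBall F) : CompletedAlgClosure F) = 0 ∧
      ∀ d : ℕ, θ ((PowerSeries.coeff (d + 1) L : CBall F) : CompletedAlgClosure F) =
        (-1) ^ d * (2 : K) ^ d / ((d : K) + 1) :=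
  exists_Lam2_lift_map (norm_two_lt_one_C h2) θ

end LamTwoLift

end Summit.BirchSwinnertonDyer.BirchSwinnertonDyer.Cruxes.SplitBadTwoLowerHalfOfFacts.WeakStrongK1G39

end


/-! # PART F — the critic's INST₂-LEAVES junction (stub-critic g42, rows 120–121: cards k1-g39, k2-g41)

Every theorem below feeds a leaf PROVED in PART E / PART E′ into the EXACT binder list of an ADOPTED consumer of
PART A (k3-g40: `read_value_eq_tsum_lamTerm` = R221 «EVAL₂», `lambda_value_refl_evS` = S4-REFL, `read₂_of_refl_cut` =
the READ₂ glue) or of PART D (the row-117 certificate `CriticG41.refl_table_charSum`) by `obtain`/`exact` — NO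
rewriting, so a green check certifies «the leaf closes the consumer's hypothesis as typed».  BSD is not proved; the
stub and the crux are untouched; this is bookkeeping on road B′'s node R219-INST₂. -/

namespace Summit.BirchSwinnertonDyer.BirchSwinnertonDyer.Cruxes.SplitBadTwoLowerHalfOfFacts.CriticG42

section LeavesJunction

open ValuativeRel IsLocalRing Field
open Literature.NumberTheory.GaloisRepresentations Literature.NumberTheory.GaloisRepresentations.IsNonarchimedeanLocalField
  Literature.NumberTheory.GaloisRepresentations.LubinTate Literature.NumberTheory.PAdicHodge

variable {F : Type} [Field F] [ValuativeRel F] [TopologicalSpace F] [IsNonarchimedeanLocalField F]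

attribute [local instance] ltNormUniformSpace ltNormIsUniformAddGroup rk1 nF nE fintypeResidueField

/-- ★ J6 (k2-g41 `exists_Lam2_lift_map` → k3-g40 `read_value_eq_tsum_lamTerm`): H3 «Λ₂-LIFT» closes the binders
`(L, hL0, hL)` of R221's theorem BY `obtain` — the reading witness `L∘y` EXISTS and its value is `Σ' lamTerm`. -/
theorem read_value_of_Lam2_lift_k2g41 (θ : CompletedAlgClosure F →+* ℂ_[2]) (hθc : Continuous θ)
    (h2 : ‖(2 : CompletedAlgClosure F)‖ < 1)
    (y : PowerSeries (CBall F)) (hy : PowerSeries.constantCoeff y = 0) (z : (maxNilIdealC F).toIdeal) :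
    ∃ L : PowerSeries (CBall F), θ ((PowerSeries.coeff 0 L : CBall F) : CompletedAlgClosure F) = 0 ∧
      ∑' m : ℕ, PowerSeries.coeff m (PowerSeries.map (θ.comp (CBall F).subtype) (PowerSeries.subst y L)) *
          (θ ((z : CBall F) : CompletedAlgClosure F)) ^ m =
        ∑' d : ℕ, ReadTwoCutK3G40.lamTerm (θ ((evS (maxNilIdealC F) z y : CBall F) : CompletedAlgClosure F)) d := by
  obtain ⟨L, hL0, hL⟩ := DisjointShiftK2G41.exists_Lam2_lift_map h2 θ
  exact ⟨L, hL0, ReadTwoCutK3G40.read_value_eq_tsum_lamTerm θ hθc L y hy hL0 hL z⟩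

/-- ★ J7 (k1-g39 `exists_Lam2_lift_map` → k3-g40 `read_value_eq_tsum_lamTerm`): the same junction from k1-g39's
three-conjunct form (its first conjunct `constantCoeff L = 0` is surplus to the consumer). -/
theorem read_value_of_Lam2_lift_k1g39 (θ : CompletedAlgClosure F →+* ℂ_[2]) (hθc : Continuous θ)
    (h2 : ‖(2 : CompletedAlgClosure F)‖ < 1)
    (y : PowerSeries (CBall F)) (hy : PowerSeries.constantCoeff y = 0) (z : (maxNilIdealC F).toIdeal) :
    ∃ L : PowerSeries (CBall F), PowerSeries.constantCoeff L = 0 ∧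
      ∑' m : ℕ, PowerSeries.coeff m (PowerSeries.map (θ.comp (CBall F).subtype) (PowerSeries.subst y L)) *
          (θ ((z : CBall F) : CompletedAlgClosure F)) ^ m =
        ∑' d : ℕ, ReadTwoCutK3G40.lamTerm (θ ((evS (maxNilIdealC F) z y : CBall F) : CompletedAlgClosure F)) d := by
  obtain ⟨L, hLc, hL0, hL⟩ := WeakStrongK1G39.exists_Lam2_lift_map h2 θ
  exact ⟨L, hLc, ReadTwoCutK3G40.read_value_eq_tsum_lamTerm θ hθc L y hy hL0 hL z⟩

/-- ★ J6′ in the FRAME OF RECORD (`2` a uniformiser of `F`): `h2` from the tree's `norm_two_lt_one_C`, via k1-g39's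
`exists_Lam2_lift_map_of_isUniformizer`. -/
theorem read_value_of_Lam2_lift_frame (h2u : (valuation F).IsUniformizer (((2 : ℕ) : 𝒪[F]) : F))
    (θ : CompletedAlgClosure F →+* ℂ_[2]) (hθc : Continuous θ)
    (y : PowerSeries (CBall F)) (hy : PowerSeries.constantCoeff y = 0) (z : (maxNilIdealC F).toIdeal) :
    ∃ L : PowerSeries (CBall F),
      ∑' m : ℕ, PowerSeries.coeff m (PowerSeries.map (θ.comp (CBall F).subtype) (PowerSeries.subst y L)) *
          (θ ((z : CBall F) : CompletedAlgClosure F)) ^ m =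
        ∑' d : ℕ, ReadTwoCutK3G40.lamTerm (θ ((evS (maxNilIdealC F) z y : CBall F) : CompletedAlgClosure F)) d := by
  obtain ⟨L, -, hL0, hL⟩ := WeakStrongK1G39.exists_Lam2_lift_map_of_isUniformizer h2u θ
  exact ⟨L, ReadTwoCutK3G40.read_value_eq_tsum_lamTerm θ hθc L y hy hL0 hL z⟩

/-- ★ J8 (k2-g41 `exists_eq_one_add_C_mul` → k3-g40 `lambda_value_refl_evS` AND `read_value_eq_tsum_lamTerm`'s `hy`):
H1 «HALF-LIFT» in divisibility form produces `(y, hy, hP)` exactly as S4-REFL consumes them. -/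
theorem refl_value_of_half_lift_k2g41 (θ : CompletedAlgClosure F →+* ℂ_[2])
    (hθ1 : ∀ z : CBall F, ‖θ (z : CompletedAlgClosure F)‖ ≤ 1)
    (P : PowerSeries (CBall F)) (hP0 : PowerSeries.constantCoeff P = 1)
    (hP : ∀ n : ℕ, (2 : CBall F) ∣ PowerSeries.coeff (n + 1) P) (w : (maxNilIdealC F).toIdeal) :
    ∃ y : PowerSeries (CBall F), PowerSeries.constantCoeff y = 0 ∧ P = 1 + PowerSeries.C (2 : CBall F) * y ∧
      ∑' d : ℕ, ReadTwoCutK3G40.lamTerm (θ ((evS (maxNilIdealC F) w y : CBall F) : CompletedAlgClosure F)) d =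
        (2 : ℂ_[2])⁻¹ * Literature.NumberTheory.Transcendental.PadicExp.plog
          (θ ((evS (maxNilIdealC F) w P : CBall F) : CompletedAlgClosure F)) := by
  obtain ⟨y, hy0, hPy⟩ := DisjointShiftK2G41.exists_eq_one_add_C_mul (2 : CBall F) P hP0 hP
  exact ⟨y, hy0, hPy, ReadTwoCutK3G40.lambda_value_refl_evS θ hθ1 hPy w⟩

/-- ★ J9 (k1-g39 `exists_half_of_sub_one_mem'` → the same consumers): H1 in k3-g40's VERBATIM `Ideal.span {2}` form. -/
theorem refl_value_of_half_lift_k1g39 (θ : CompletedAlgClosure F →+* ℂ_[2])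
    (hθ1 : ∀ z : CBall F, ‖θ (z : CompletedAlgClosure F)‖ ≤ 1)
    (P : PowerSeries (CBall F)) (hP0 : PowerSeries.constantCoeff P = 1)
    (hP : ∀ n : ℕ, (PowerSeries.coeff n P : CBall F) - (if n = 0 then 1 else 0) ∈ Ideal.span {(2 : CBall F)})
    (w : (maxNilIdealC F).toIdeal) :
    ∃ y : PowerSeries (CBall F), PowerSeries.constantCoeff y = 0 ∧ P = 1 + PowerSeries.C (2 : CBall F) * y ∧
      ∑' d : ℕ, ReadTwoCutK3G40.lamTerm (θ ((evS (maxNilIdealC F) w y : CBall F) : CompletedAlgClosure F)) d =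
        (2 : ℂ_[2])⁻¹ * Literature.NumberTheory.Transcendental.PadicExp.plog
          (θ ((evS (maxNilIdealC F) w P : CBall F) : CompletedAlgClosure F)) := by
  obtain ⟨y, hy0, hPy⟩ := WeakStrongK1G39.exists_half_of_sub_one_mem' P hP0 hP
  exact ⟨y, hy0, hPy, ReadTwoCutK3G40.lambda_value_refl_evS θ hθ1 hPy w⟩

/-- ★★ J10 «THE INST₂ LEAVES ASSEMBLED» (k2-g41 H1 ⊕ H3 ⊕ k3-g40 R221 ⊕ S4-REFL): for the reflection quotient
`P ∈ 𝒪_ℂ⟦X⟧` with `P(0) = 1` and `2 ∣ [X^{n+1}]P`, the reading witness `L∘y` EXISTS in `𝒪_ℂ⟦X⟧` and its `θ`-value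
at every `z ∈ 𝔪_ℂ` IS `½·plog θ P(z)` — hypothesis-free except the frame (`θ` continuous & integral, `‖2‖_ℂ < 1`).
What remains of R219-INST₂ after this is witness-specific only: the `∘ϑ` line, `V = L_b + c`, SEAM, ONE application. -/
theorem inst₂_leaves_assembled (θ : CompletedAlgClosure F →+* ℂ_[2]) (hθc : Continuous θ)
    (hθ1 : ∀ z : CBall F, ‖θ (z : CompletedAlgClosure F)‖ ≤ 1) (h2 : ‖(2 : CompletedAlgClosure F)‖ < 1)
    (P : PowerSeries (CBall F)) (hP0 : PowerSeries.constantCoeff P = 1)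
    (hP : ∀ n : ℕ, (2 : CBall F) ∣ PowerSeries.coeff (n + 1) P) (z : (maxNilIdealC F).toIdeal) :
    ∃ L y : PowerSeries (CBall F), PowerSeries.constantCoeff y = 0 ∧ P = 1 + PowerSeries.C (2 : CBall F) * y ∧
      θ ((PowerSeries.coeff 0 L : CBall F) : CompletedAlgClosure F) = 0 ∧
      ∑' m : ℕ, PowerSeries.coeff m (PowerSeries.map (θ.comp (CBall F).subtype) (PowerSeries.subst y L)) *
          (θ ((z : CBall F) : CompletedAlgClosure F)) ^ m =
        (2 : ℂ_[2])⁻¹ * Literature.NumberTheory.Transcendental.PadicExp.plog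
          (θ ((evS (maxNilIdealC F) z P : CBall F) : CompletedAlgClosure F)) := by
  obtain ⟨y, hy0, hPy⟩ := DisjointShiftK2G41.exists_eq_one_add_C_mul (2 : CBall F) P hP0 hP
  obtain ⟨L, hL0, hL⟩ := DisjointShiftK2G41.exists_Lam2_lift_map h2 θ
  exact ⟨L, y, hy0, hPy, hL0, (ReadTwoCutK3G40.read_value_eq_tsum_lamTerm θ hθc L y hy0 hL0 hL z).trans
    (ReadTwoCutK3G40.lambda_value_refl_evS θ hθ1 hPy z)⟩

/-- J11: the two cards' R222 «SHIFT₂» `evS` texts are ONE statement (k1-g39 `compSeriesC_torsion_shift` ≡ k2-g41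
`evS_compSeriesC_shift`; both = tree ★★ `coe_evalPt₁_compSeriesC_reflect` read through `evalPt₁_compSeriesC_eq_mk_evS`). -/
theorem shift₂_texts_agree (hq : residueFieldCard F = 2) (h2 : (valuation F).IsUniformizer (((2 : ℕ) : 𝒪[F]) : F))
    {σ₀ : absoluteGaloisGroup F} (hσ₀ : IsAbsArithFrob σ₀) (u : 𝒪[F]ˣ) {ε : (maxUnramifiedCompletion F)ˣ}
    (hε : maxUnramifiedCompletion.galAut F σ₀ (ε : maxUnramifiedCompletion F) =
      algebraMap 𝒪[F] (maxUnramifiedCompletion F) (u : 𝒪[F]) * (ε : maxUnramifiedCompletion F))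
    (z z' : (maxNilIdealC F).toIdeal)
    (hz' : ((z' : CBall F) : CompletedAlgClosure F) = -2 - ((z : CBall F) : CompletedAlgClosure F)) :
    ((evS (maxNilIdealC F) z' ((compSeriesC h2 hσ₀ u hε).map (algebraMap (UnrCoeff F) (CBall F))) : CBall F) :
        CompletedAlgClosure F) =
      -algebraMap F (CompletedAlgClosure F) ((((u : 𝒪[F]) * ((2 : ℕ) : 𝒪[F]) : 𝒪[F]) : F)) -
        ((evS (maxNilIdealC F) z ((compSeriesC h2 hσ₀ u hε).map (algebraMap (UnrCoeff F) (CBall F))) : CBall F) :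
          CompletedAlgClosure F) :=
  WeakStrongK1G39.compSeriesC_torsion_shift hq h2 hσ₀ u hε z z' hz'

/-- J11′: … and k2-g41's text proves the same statement term-for-term. -/
theorem shift₂_texts_agree' (hq : residueFieldCard F = 2) (h2 : (valuation F).IsUniformizer (((2 : ℕ) : 𝒪[F]) : F))
    {σ₀ : absoluteGaloisGroup F} (hσ₀ : IsAbsArithFrob σ₀) (u : 𝒪[F]ˣ) {ε : (maxUnramifiedCompletion F)ˣ}
    (hε : maxUnramifiedCompletion.galAut F σ₀ (ε : maxUnramifiedCompletion F) =
      algebraMap 𝒪[F] (maxUnramifiedCompletion F) (u : 𝒪[F]) * (ε : maxUnramifiedCompletion F))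
    (z z' : (maxNilIdealC F).toIdeal)
    (hz' : ((z' : CBall F) : CompletedAlgClosure F) = -2 - ((z : CBall F) : CompletedAlgClosure F)) :
    ((evS (maxNilIdealC F) z' ((compSeriesC h2 hσ₀ u hε).map (algebraMap (UnrCoeff F) (CBall F))) : CBall F) :
        CompletedAlgClosure F) =
      -algebraMap F (CompletedAlgClosure F) ((((u : 𝒪[F]) * ((2 : ℕ) : 𝒪[F]) : 𝒪[F]) : F)) -
        ((evS (maxNilIdealC F) z ((compSeriesC h2 hσ₀ u hε).map (algebraMap (UnrCoeff F) (CBall F))) : CBall F) :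
          CompletedAlgClosure F) :=
  DisjointShiftK2G41.evS_compSeriesC_shift hq h2 hσ₀ u hε z z' hz'

end LeavesJunction

section CharacterJunction

/-- ★ J12 (k2-g41 digits → the row-117 certificate, PART D): BOTH hypotheses `hγ₀`, `hψ` of
`CriticG41.refl_table_charSum` are THEOREMS for `Γ := (ℤ/2^{n+1})ˣ`, `e := refl`, `γ₀ := 1 + 2^n`, every `n ≥ 1`,
every character NOT factoring through `2^n` (B72's exact wording) — k2-g41's `refl_table_charSum_two_pow`
re-derived from the ORIGINAL certificate (their in-file copy is thereby shown verbatim-compatible). -/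
theorem refl_table_charSum_two_pow_via_g41 {R : Type*} [CommRing R] [IsDomain R] {n : ℕ} (hn : 1 ≤ n)
    (χ : DirichletCharacter R (2 ^ (n + 1))) (hχ : ¬χ.FactorsThrough (2 ^ n))
    (T : (ZMod (2 ^ (n + 1)))ˣ → R) (κ : R) :
    ∑ γ : (ZMod (2 ^ (n + 1)))ˣ, χ (γ : ZMod (2 ^ (n + 1))) * (κ * (T γ - T (γ * DisjointShiftK2G41.gammaZero hn))) =
      2 * κ * ∑ γ : (ZMod (2 ^ (n + 1)))ˣ, χ (γ : ZMod (2 ^ (n + 1))) * T γ :=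
  CriticG41.refl_table_charSum (MulEquiv.refl _) χ T κ (DisjointShiftK2G41.gammaZero hn)
    (DisjointShiftK2G41.gammaZero_mul_self hn) (DisjointShiftK2G41.apply_gammaZero_eq_neg_one hn χ hχ)

/-- ★ J13 (k1-g39 digits → the row-117 certificate): the same with k1-g39's `gammaZero (hn : n ≠ 0)` and its
`IsPrimitive` hypothesis (`eval_gammaZero`, `gammaZero_mul_self`). -/
theorem refl_table_charSum_two_pow_via_g41' {R : Type*} [CommRing R] [IsDomain R] {n : ℕ} (hn : n ≠ 0)
    (χ : DirichletCharacter R (2 ^ (n + 1))) (hχ : χ.IsPrimitive)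
    (T : (ZMod (2 ^ (n + 1)))ˣ → R) (κ : R) :
    ∑ γ : (ZMod (2 ^ (n + 1)))ˣ, χ (γ : ZMod (2 ^ (n + 1))) * (κ * (T γ - T (γ * WeakStrongK1G39.gammaZero hn))) =
      2 * κ * ∑ γ : (ZMod (2 ^ (n + 1)))ˣ, χ (γ : ZMod (2 ^ (n + 1))) * T γ :=
  CriticG41.refl_table_charSum (MulEquiv.refl _) χ T κ (WeakStrongK1G39.gammaZero hn)
    (WeakStrongK1G39.gammaZero_mul_self hn) (WeakStrongK1G39.eval_gammaZero hn χ hχ)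

/-- J14: the two hypotheses are EQUIVALENT at level `2^{n+1}` (k2-g41's `¬FactorsThrough (2^n)` is B72's wording;
k1-g39's `IsPrimitive` implies it) — so J12 covers J13's characters. -/
theorem not_factorsThrough_of_isPrimitive {R : Type*} [CommRing R] [IsDomain R] {n : ℕ}
    (χ : DirichletCharacter R (2 ^ (n + 1))) (hχ : χ.IsPrimitive) : ¬χ.FactorsThrough (2 ^ n) := by
  intro hf
  have hc := (DirichletCharacter.mem_conductorSet_iff χ).mpr hf
  have hle : χ.conductor ≤ 2 ^ n := Nat.sInf_le hc
  have hc' : χ.conductor = 2 ^ (n + 1) := hχ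
  rw [hc'] at hle
  have hlt : 2 ^ n < 2 ^ (n + 1) := Nat.pow_lt_pow_right (by norm_num) (Nat.lt_succ_self n)
  exact absurd hle (not_le.mpr hlt)

/-- J15 (k1-g39 `coe_mul_gammaZero` → k3-g40 `read₂_of_refl_cut`'s `hshift` binder at `Γ := (ℤ/2^{n+1})ˣ`,
`e := Equiv.refl`, `s := 2^n`, `γ₀ := 1 + 2^n`): by `exact`. -/
theorem hshift_refl_k1g39 {n : ℕ} (hn : n ≠ 0) :
    ∀ γ : (ZMod (2 ^ (n + 1)))ˣ,
      ((Equiv.refl (ZMod (2 ^ (n + 1)))ˣ (γ * WeakStrongK1G39.gammaZero hn) : (ZMod (2 ^ (n + 1)))ˣ) :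
          ZMod (2 ^ (n + 1))) =
        ((Equiv.refl (ZMod (2 ^ (n + 1)))ˣ γ : (ZMod (2 ^ (n + 1)))ˣ) : ZMod (2 ^ (n + 1))) + 2 ^ n :=
  fun γ => WeakStrongK1G39.coe_mul_gammaZero hn γ

/-- J16: the two cards' `γ₀` are the SAME unit (values `1 + 2^n`). -/
theorem gammaZero_agree {n : ℕ} (hn : 1 ≤ n) :
    DisjointShiftK2G41.gammaZero hn = WeakStrongK1G39.gammaZero (Nat.one_le_iff_ne_zero.mp hn) := by
  ext
  rw [DisjointShiftK2G41.val_gammaZero, WeakStrongK1G39.coe_gammaZero]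

end CharacterJunction

section UntwistCrossCheck

open ValuativeRel IsLocalRing Field
open Literature.NumberTheory.GaloisRepresentations Literature.NumberTheory.GaloisRepresentations.IsNonarchimedeanLocalField
  Literature.NumberTheory.GaloisRepresentations.LubinTate Literature.NumberTheory.PAdicHodge

variable {F : Type} [Field F] [ValuativeRel F] [TopologicalSpace F] [IsNonarchimedeanLocalField F]

attribute [local instance] ltNormUniformSpace ltNormIsUniformAddGroup rk1 nF nE fintypeResidueField

variable {π : 𝒪[F]} (hπ : (valuation F).IsUniformizer (π : F))
variable (E : IntermediateField F (AlgebraicClosure F)) [FiniteDimensional F E] [Normal F E]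

/-- J17: k2-g41's §A copy of `LocalUntwistExists` IS k3-g40's node (token-identical bodies). -/
theorem localUntwistExists_iff_k2g41 (hE : E ≤ maxUnramified F) (σ₀ : absoluteGaloisGroup F) :
    ReadTwoCutK3G40.LocalUntwistExists hπ E hE σ₀ ↔ DisjointShiftK2G41.LocalUntwistExists hπ E hE σ₀ := Iff.rfl

/-- J17′: k2-g41's independent proof (appendix, not claimed) closes k3-g40's node — second cross-check of R217∃. -/
theorem localUntwistExists_holds_k2g41 (hE : E ≤ maxUnramified F) (σ₀ : absoluteGaloisGroup F) :
    ReadTwoCutK3G40.LocalUntwistExists hπ E hE σ₀ :=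
  (localUntwistExists_iff_k2g41 hπ E hE σ₀).mpr (DisjointShiftK2G41.localUntwistExists hπ E hE σ₀)

/-- J18: k1-g39's §A copy of `LocalUntwistExists` IS k3-g40's node (token-identical bodies). -/
theorem localUntwistExists_iff_k1g39 (hE : E ≤ maxUnramified F) (σ₀ : absoluteGaloisGroup F) :
    ReadTwoCutK3G40.LocalUntwistExists hπ E hE σ₀ ↔ WeakStrongK1G39.LocalUntwistExists hπ E hE σ₀ := Iff.rfl

/-- J18′: k1-g39's independent proof (cross-check, credit k3-g41) closes k3-g40's node — third proof of R217∃. -/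
theorem localUntwistExists_holds_k1g39 (hE : E ≤ maxUnramified F) (σ₀ : absoluteGaloisGroup F) :
    ReadTwoCutK3G40.LocalUntwistExists hπ E hE σ₀ :=
  (localUntwistExists_iff_k1g39 hπ E hE σ₀).mpr (WeakStrongK1G39.localUntwistExists hπ E hE σ₀)

end UntwistCrossCheck

end Summit.BirchSwinnertonDyer.BirchSwinnertonDyer.Cruxes.SplitBadTwoLowerHalfOfFacts.CriticG42
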